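import Literature.NumberTheory.Transcendental.ManyCurveEngine
import Literature.NumberTheory.Transcendental.ManyCurveInduction
import Literature.NumberTheory.Transcendental.StableClosing
import HarnessLib

/-!
# The closing argument on the `k`-lattice standard models: the `2 + 4k` 1-periods modulo Philippon's zero estimate

Topic `Literature/NumberTheory/Transcendental`; unit
`provefact-Literature.NumberTheory.Transcendental.H-0a3eb64689` (fact
`Literature.NumberTheory.Transcendental.HuberWustholzManyCurvePeriods`, `ManyCurvePeriods.lean`).
It introduces NO named fact. Lattice-family counterpart of the two-lattice `TwoCurveClosing.lean`
(port of the one-lattice files `IndexDescent.lean`, `SemistableNoSubgroup.lean`,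
`ClosingData.lean`, `ClosingDichotomy.lean`, `NumCondEnvelopes.lean`, `NumCondFamily.lean`,
`TorsionEnvelopes.lean`, `TorsionNumCond.lean`, `TorsionDichotomy.lean` and `StableClosing.lean`),
for the family standard models `M = 𝔾ₘ^β × P` (`ManyCurveStd.lean`, …, `ManyCurveEngine.lean`;
lattice family `L : 𝓙 → PeriodPair`, class map `cls : γ → 𝓙`), followed by the final assembly
with `ManyCurveInduction.lean`.

## What is proved here (everything; no `sorry`, no new `def … : Prop`)

* index descent `Semistable.index_le` (semistability with `ℚ̄`-data controls Philippon's
  obstruction data over `ℂ`; block-diagonal abelian parts throughout), `finrank_eq_zero_of_le_C`,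
  `exists_rational_datum`, `Semistable.exists_borderline_rational`;
* `exists_bakerData`, `orbitCard_lt_imp`, `SubgroupDataC.zero`, `AdmissibleParams`, and **the
  dichotomy theorem** `dichotomy` of Baker's method on `M` — GRANTED Philippon's zero estimate for
  `M`, stated INLINE as the hypothesis `hphil` (Philippon 1986, Thm. 2.1, for the family theta
  model of `ManyCurveTheta.lean`; the lattice-family twin of the tree's named fact
  `philippon1986_std`, same dictionary; D-0026: no `def`);
* the numerical condition in the parameter families (`numCond₂_family`, `admissibleParams_of_lt`,
  `dichotomy'`; torsion variants `numCond₃_family`, `admissibleParams₃_of_lt`), the envelopes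
  (`bigConst`, `houseBound_le`, `siegelHouseBound_le`, `lineValBound_le(₃)`, `saving_le(₃)`), reusing
  the generic one-lattice families `GaGmE.Std.BakerData.Family/TFamily` verbatim;
* `torsionDichotomy` and **`mem_ker_of_stable`: the Semistability Theorem for a STABLE `𝔟` at
  points with torsion abelian part** (modulo `hphil`), by the two runs of Baker's method;
* `GaGmEFam.Std.stableClosing_of_philippon` (the hypothesis `hclose` of
  `ManyCurveInduction.HuberWustholzManyCurvePeriods_of_stableClosing` from Philippon's zero
  estimate for all family models) and **`HuberWustholzManyCurvePeriods_of_philippon`: the named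
  fact `HuberWustholzManyCurvePeriods` granted Philippon 1986, Thm. 2.1, for the `k`-lattice
  standard models in their theta embedding** — the one remaining input, exactly as
  `philippon1986_std` is the one remaining input of the one-lattice
  `HuberWustholzOnePeriods_of_philippon`.

## Faithfulness of `hphil`

`hphil` is Philippon's Théorème 2.1 (Bull. SMF 114 (1986), p. 358) for `K = ℂ`, `p = 1`, `G = M`
a family standard model embedded in one projective space by the theta functions of
`ManyCurveTheta.lean`, `A = exp 𝔟`, `Σ = {0, g, …, Sg}`, read through `H(G'; D) ≥ D^{dim G'}`,
`H(G; c₁D) = deg M · c₁ⁿ Dⁿ` — word for word the statement of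
`PhilipponZeroEstimateStd.philippon1986_std` with the lattice `Λ` replaced by the family
`(Λ_{cls b})_b` (blockwise), the obstruction data being the connected algebraic subgroups of `M`
for pairwise non-isogenous `E_i` whose CM classes carry at most one block (`SubgroupDataC`,
block-diagonal abelian part: `Hom(E_i, E_j) = 0` for `i ≠ j`, and on a single block a CM
endomorphism gives no new connected subgroup), under which hypotheses alone it is invoked.
Nothing stronger than printed.

## References

* A. Baker, G. Wüstholz, *Logarithmic Forms and Diophantine Geometry*, CUP 2007: Thm. 6.15,
  §6.7, §6.8 (pp. 115–119). [BakerWustholz2007]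
* P. Philippon, *Lemmes de zéros dans les groupes algébriques commutatifs*, Bull. SMF 114 (1986),
  Thm. 2.1; P. Philippon, M. Waldschmidt, Illinois J. Math. 32 (1988), §5, §8. [Philippon1986]
* A. Huber, G. Wüstholz, *Transcendence and Linear Relations of 1-Periods*, Cambridge Tracts 227,
  CUP 2022: Thm. 15.3 (1) (p. 145). [HuberWustholz2022]
-/

noncomputable section

open Complex Filter Topology MvPolynomial
open scoped PeriodPair

namespace Literature.NumberTheory.Transcendental

namespace GaGmEFam

namespace Std

open GaGmE (Kbar)
open GaGmE.Std (iy iz is coords coords_iy coords_iz coords_is sum_blocks ThetaIdx thetaT thetaT_none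
  thetaT_some differentiable_thetaT VanishesAlong isAlgebraic_coe_Kbar
  Gen factorGen zetaHat zetaHatDer factorODE zetaHatODE FactorChartValid isOpen_factorChartValid
  factorGen_false factorGen_true zetaHat_false zetaHat_true hasDerivAt_zetaHat
  baseFin baseIdx rPoly corrPoly TPoly rVal corrVal factor_blocks line_apply genFin genIdx
  rVal_baseFin corrVal_baseFin rVal_genFin genericChart affGen affIdx homog isHomogeneous_homog
  eval_homog_of_base_eq_one factorODEᵣ zetaHatODEᵣ rPolyᵣ corrPolyᵣ TPolyᵣ homogMonomialᵣ
  map_homogMonomialᵣ homog_monomial homog_add homog_zero homog_sum homog_eq_sum)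

variable {𝓙 : Type} [Fintype 𝓙] [DecidableEq 𝓙] {β γ δ : Type} [Fintype β] [Fintype γ] [Fintype δ]

/-! ### Index descent and the absence of algebraic subalgebras in semistable subspaces -/

section Descent

open Module Submodule LiePresentation
open GaGmE.Std (πs πs_apply T₀ mem_T₀ isKRational_T₀ map_πs_T₀ finrank_T₀_inf_comap compatSpace mem_compatSpace span_C_eq isKRational_compatSpace eq_zero_of_index_le_of_lt)

variable {cls : γ → 𝓙} {κM : δ → γ → Kbar}

omit [Fintype 𝓙] in
/-- **`Lie(A, C, Ξ) = T₀ ∩ πs⁻¹(Ξ^⊥)`** for `ℂ`-data. [folklore] -/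
theorem SubgroupDataC.tangent_eq (K : SubgroupDataC β γ δ cls κM) :
    K.tangent = T₀ K.A (K.C) ⊓ (dotAnn K.Ξ).comap πs := by
  ext w
  rw [SubgroupDataC.mem_tangent_iff, Submodule.mem_inf, mem_T₀, Submodule.mem_comap, mem_dotAnn]
  simp only [πs_apply]
  tauto


omit [Fintype 𝓙] in
/-- **`Lie(A, C, Ξ) = T₀ ∩ πs⁻¹((span_ℂ Ξ)^⊥)`** for `ℚ̄`-data. [folklore] -/
theorem SubgroupData.tangent_eq (D : SubgroupData β γ δ cls κM) :
    D.tangent = T₀ D.A (D.C) ⊓ (dotAnn (span ℂ (ofK Kbar '' (D.Ξ : Set (δ → Kbar))))).comap πs := by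
  ext w
  rw [SubgroupData.mem_tangent_iff, Submodule.mem_inf, mem_T₀, Submodule.mem_comap, mem_dotAnn]
  have key : (∀ ξ ∈ D.Ξ, ∑ e, (ξ e : ℂ) * w (is e) = 0) ↔
      ∀ θ ∈ span ℂ (ofK Kbar '' (D.Ξ : Set (δ → Kbar))), ∑ e, θ e * πs w e = 0 := by
    constructor
    · intro h θ hθ
      refine Submodule.span_induction ?_ ?_ ?_ ?_ hθ
      · rintro _ ⟨ξ, hξ, rfl⟩
        simpa [ofK] using h ξ hξ
      · simp
      · intro x y _ _ hx hy
        simp only [Pi.add_apply, add_mul, Finset.sum_add_distrib, hx, hy, add_zero]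
      · intro a x _ hx
        simp only [Pi.smul_apply, smul_eq_mul, mul_assoc, ← Finset.mul_sum, hx, mul_zero]
    · intro h ξ hξ
      have := h (ofK Kbar ξ) (subset_span ⟨ξ, hξ, rfl⟩)
      simpa [ofK] using this
  rw [key]
  tauto


variable (cls κM) in
omit [Fintype 𝓙] in
/-- **Index descent.** For a `ℚ̄`-rational `𝔟 ⊆ Lie M_κ`, semistability (quantified over the
algebraic subgroups with `ℚ̄`-data) implies the index inequality for every subgroup datum over `ℂ`
other than `M_κ` itself: `dim 𝔟 · (n - dim Lie K) ≤ (dim 𝔟 - dim(𝔟 ∩ Lie K)) · n`.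
[cite: BakerWustholz2007, §6.7 (index and semistability)] -/
theorem Semistable.index_le {𝔟 : Submodule ℂ (β ⊕ (γ ⊕ δ) → ℂ)} (hss : Semistable cls κM 𝔟)
    (hrat : IsKRational Kbar 𝔟) (K : SubgroupDataC β γ δ cls κM) (hK : K.tangent ≠ ⊤) :
    Module.finrank ℂ 𝔟 * (Fintype.card (β ⊕ (γ ⊕ δ)) - Module.finrank ℂ K.tangent) ≤
      (Module.finrank ℂ 𝔟 - Module.finrank ℂ ↥(𝔟 ⊓ K.tangent)) * Fintype.card (β ⊕ (γ ⊕ δ)) := by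
  -- the players
  set Θ : Submodule ℂ (δ → ℂ) := dotAnn K.Ξ with hΘ
  set W₀ : Submodule ℂ (δ → ℂ) := compatSpace κM (K.C) with hW₀
  set Z : Submodule ℂ (δ → ℂ) := dotAnn W₀ with hZ
  have hΞW₀ : K.Ξ ≤ W₀ := fun ξ hξ => (mem_compatSpace).mpr (K.compat ξ hξ)
  have hZΘ : Z ≤ Θ := dotAnn_anti hΞW₀
  have hZrat : IsKRational Kbar Z := (isKRational_compatSpace (K.C)).dotAnn Kbar
  set U : Submodule ℂ (δ → ℂ) := (𝔟 ⊓ T₀ K.A (K.C)).map πs with hU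
  have hUrat : IsKRational Kbar U := (hrat.inf Kbar (isKRational_T₀ K.A (K.C))).map_funLeft Kbar is
  obtain ⟨Θ', hΘ'rat, hZΘ', hdimΘ', hdimU⟩ := exists_rational_replacement Kbar hZrat hUrat hZΘ
  -- the `ℚ̄`-datum
  set Ξ' : Submodule ℂ (δ → ℂ) := dotAnn Θ' with hΞ'
  have hΞ'rat : IsKRational Kbar Ξ' := hΘ'rat.dotAnn Kbar
  have hΞ'W₀ : Ξ' ≤ W₀ := by
    have : dotAnn Θ' ≤ dotAnn Z := dotAnn_anti hZΘ'
    rwa [hZ, dotAnn_dotAnn] at this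
  let D : SubgroupData β γ δ cls κM :=
    { A := K.A
      C := K.C
      blockDiag := K.blockDiag
      Ξ := kPoints Kbar Ξ'
      compat := by
        intro ξ hξ
        have hmem : ofK Kbar ξ ∈ W₀ := hΞ'W₀ hξ
        rw [hW₀, mem_compatSpace, span_C_eq] at hmem
        have e : (fun b => ∑ e, ofK Kbar (L := ℂ) ξ e * (κM e b : ℂ)) =
            ofK Kbar (fun b => ∑ e, ξ e * κM e b) := by
          funext b; simp [ofK, map_sum, map_mul]
        rw [e] at hmem
        have := (mem_kPoints Kbar).mpr hmem
        rwa [kPoints_span_ofK] at this }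
  have hDmem : D.tangent ∈ algLie cls κM := ⟨D, rfl⟩
  -- the tangent spaces
  have hKt : K.tangent = T₀ K.A (K.C) ⊓ Θ.comap πs := K.tangent_eq
  have hDt : D.tangent = T₀ K.A (K.C) ⊓ Θ'.comap πs := by
    rw [D.tangent_eq]
    show T₀ K.A (K.C) ⊓ (dotAnn (span ℂ (ofK Kbar '' (kPoints Kbar Ξ' : Set (δ → Kbar))))).comap πs = _
    rw [← hΞ'rat.eq_span_kPoints, hΞ', dotAnn_dotAnn]
  -- dimensions
  have hdimK : Module.finrank ℂ K.tangent = Module.finrank ℂ ↥(T₀ (δ := δ) K.A (K.C) ⊓ LinearMap.ker πs) +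
      Module.finrank ℂ Θ := by rw [hKt, finrank_T₀_inf_comap]
  have hdimD : Module.finrank ℂ D.tangent = Module.finrank ℂ ↥(T₀ (δ := δ) K.A (K.C) ⊓ LinearMap.ker πs) +
      Module.finrank ℂ Θ' := by rw [hDt, finrank_T₀_inf_comap]
  have hdimKD : Module.finrank ℂ D.tangent = Module.finrank ℂ K.tangent := by rw [hdimK, hdimD, hdimΘ']
  have hbK : Module.finrank ℂ ↥(𝔟 ⊓ K.tangent) =
      Module.finrank ℂ ↥((𝔟 ⊓ T₀ K.A (K.C)) ⊓ LinearMap.ker πs) + Module.finrank ℂ ↥(U ⊓ Θ) := by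
    rw [hKt, ← inf_assoc, finrank_inf_comap πs (𝔟 ⊓ T₀ K.A (K.C)) Θ]
  have hbD : Module.finrank ℂ ↥(𝔟 ⊓ D.tangent) =
      Module.finrank ℂ ↥((𝔟 ⊓ T₀ K.A (K.C)) ⊓ LinearMap.ker πs) + Module.finrank ℂ ↥(U ⊓ Θ') := by
    rw [hDt, ← inf_assoc, finrank_inf_comap πs (𝔟 ⊓ T₀ K.A (K.C)) Θ']
  have hbKD : Module.finrank ℂ ↥(𝔟 ⊓ K.tangent) ≤ Module.finrank ℂ ↥(𝔟 ⊓ D.tangent) := by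
    rw [hbK, hbD]; exact Nat.add_le_add_left hdimU _
  -- `D.tangent ≠ ⊤`
  have hDtop : D.tangent ≠ ⊤ := by
    intro h
    apply hK
    apply Submodule.eq_top_of_finrank_eq
    have h1 : Module.finrank ℂ D.tangent = Module.finrank ℂ (β ⊕ (γ ⊕ δ) → ℂ) := by
      rw [h, finrank_top]
    rw [← hdimKD, h1]
  -- semistability for `D`
  have hssD := hss D.tangent hDmem hDtop
  rw [hdimKD] at hssD
  refine hssD.trans (Nat.mul_le_mul_right _ ?_)
  omega


omit [Fintype 𝓙] in
/-- The same for Philippon's `ℂ`-data, for a `ℚ̄`-rational `𝔟` (index descent). [folklore] -/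
theorem Semistable.finrank_eq_zero_of_le_C {𝔟 : Submodule ℂ (β ⊕ (γ ⊕ δ) → ℂ)} (hss : Semistable cls κM 𝔟)
    (hrat : LiePresentation.IsKRational Kbar 𝔟) (h𝔟 : 𝔟 ≠ ⊤) (K : SubgroupDataC β γ δ cls κM)
    (hle : K.tangent ≤ 𝔟) : Module.finrank ℂ K.tangent = 0 := by
  have hKtop : K.tangent ≠ ⊤ := fun h => h𝔟 (eq_top_iff.mpr (h ▸ hle))
  have hineq := hss.index_le cls κM hrat K hKtop
  rw [inf_eq_right.mpr hle] at hineq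
  have hkb : Module.finrank ℂ K.tangent ≤ Module.finrank ℂ 𝔟 := Submodule.finrank_mono hle
  have hbn : Module.finrank ℂ 𝔟 < Fintype.card (β ⊕ (γ ⊕ δ)) := by
    have h1 : Module.finrank ℂ 𝔟 < Module.finrank ℂ (β ⊕ (γ ⊕ δ) → ℂ) := Submodule.finrank_lt h𝔟
    simpa using h1
  exact eq_zero_of_index_le_of_lt hkb hbn hineq


omit [Fintype 𝓙] in
/-- Equivalently: the Lie algebra is zero. [folklore] -/
theorem Semistable.tangent_eq_bot_of_le_C {𝔟 : Submodule ℂ (β ⊕ (γ ⊕ δ) → ℂ)} (hss : Semistable cls κM 𝔟)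
    (hrat : LiePresentation.IsKRational Kbar 𝔟) (h𝔟 : 𝔟 ≠ ⊤) (K : SubgroupDataC β γ δ cls κM)
    (hle : K.tangent ≤ 𝔟) : K.tangent = ⊥ :=
  Submodule.finrank_eq_zero.mp (hss.finrank_eq_zero_of_le_C hrat h𝔟 K hle)


variable (cls κM) in
omit [Fintype 𝓙] in
/-- **Rational replacement.** For a `ℚ̄`-rational `𝔟` and every subgroup datum `K` over `ℂ`
there is a `ℚ̄`-datum `D` (same torus and abelian data, vector data replaced) with
`dim Lie D = dim Lie K` and `dim(𝔟 ∩ Lie K) ≤ dim(𝔟 ∩ Lie D)`.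
[cite: BakerWustholz2007, §6.7 (index and semistability)] -/
theorem exists_rational_datum {𝔟 : Submodule ℂ (β ⊕ (γ ⊕ δ) → ℂ)} (hrat : IsKRational Kbar 𝔟)
    (K : SubgroupDataC β γ δ cls κM) :
    ∃ D : SubgroupData β γ δ cls κM, Module.finrank ℂ D.tangent = Module.finrank ℂ K.tangent ∧
      Module.finrank ℂ ↥(𝔟 ⊓ K.tangent) ≤ Module.finrank ℂ ↥(𝔟 ⊓ D.tangent) := by
  -- the players (as in `IndexDescent.index_le`)
  set Θ : Submodule ℂ (δ → ℂ) := dotAnn K.Ξ with hΘ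
  set W₀ : Submodule ℂ (δ → ℂ) := compatSpace κM (K.C) with hW₀
  set Z : Submodule ℂ (δ → ℂ) := dotAnn W₀ with hZ
  have hΞW₀ : K.Ξ ≤ W₀ := fun ξ hξ => (mem_compatSpace).mpr (K.compat ξ hξ)
  have hZΘ : Z ≤ Θ := dotAnn_anti hΞW₀
  have hZrat : IsKRational Kbar Z := (isKRational_compatSpace (K.C)).dotAnn Kbar
  set U : Submodule ℂ (δ → ℂ) := (𝔟 ⊓ T₀ K.A (K.C)).map πs with hU
  have hUrat : IsKRational Kbar U := (hrat.inf Kbar (isKRational_T₀ K.A (K.C))).map_funLeft Kbar is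
  obtain ⟨Θ', hΘ'rat, hZΘ', hdimΘ', hdimU⟩ := exists_rational_replacement Kbar hZrat hUrat hZΘ
  -- the `ℚ̄`-datum
  set Ξ' : Submodule ℂ (δ → ℂ) := dotAnn Θ' with hΞ'
  have hΞ'rat : IsKRational Kbar Ξ' := hΘ'rat.dotAnn Kbar
  have hΞ'W₀ : Ξ' ≤ W₀ := by
    have : dotAnn Θ' ≤ dotAnn Z := dotAnn_anti hZΘ'
    rwa [hZ, dotAnn_dotAnn] at this
  let D : SubgroupData β γ δ cls κM :=
    { A := K.A
      C := K.C
      blockDiag := K.blockDiag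
      Ξ := kPoints Kbar Ξ'
      compat := by
        intro ξ hξ
        have hmem : ofK Kbar ξ ∈ W₀ := hΞ'W₀ hξ
        rw [hW₀, mem_compatSpace, span_C_eq] at hmem
        have e : (fun b => ∑ e, ofK Kbar (L := ℂ) ξ e * (κM e b : ℂ)) =
            ofK Kbar (fun b => ∑ e, ξ e * κM e b) := by
          funext b; simp [ofK, map_sum, map_mul]
        rw [e] at hmem
        have := (mem_kPoints Kbar).mpr hmem
        rwa [kPoints_span_ofK] at this }
  -- the tangent spaces
  have hKt : K.tangent = T₀ K.A (K.C) ⊓ Θ.comap πs := K.tangent_eq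
  have hDt : D.tangent = T₀ K.A (K.C) ⊓ Θ'.comap πs := by
    rw [D.tangent_eq]
    show T₀ K.A (K.C) ⊓ (dotAnn (span ℂ (ofK Kbar '' (kPoints Kbar Ξ' : Set (δ → Kbar))))).comap πs = _
    rw [← hΞ'rat.eq_span_kPoints, hΞ', dotAnn_dotAnn]
  -- dimensions
  have hdimK : Module.finrank ℂ K.tangent = Module.finrank ℂ ↥(T₀ (δ := δ) K.A (K.C) ⊓ LinearMap.ker πs) +
      Module.finrank ℂ Θ := by rw [hKt, finrank_T₀_inf_comap]
  have hdimD : Module.finrank ℂ D.tangent = Module.finrank ℂ ↥(T₀ (δ := δ) K.A (K.C) ⊓ LinearMap.ker πs) +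
      Module.finrank ℂ Θ' := by rw [hDt, finrank_T₀_inf_comap]
  have hdimKD : Module.finrank ℂ D.tangent = Module.finrank ℂ K.tangent := by rw [hdimK, hdimD, hdimΘ']
  have hbK : Module.finrank ℂ ↥(𝔟 ⊓ K.tangent) =
      Module.finrank ℂ ↥((𝔟 ⊓ T₀ K.A (K.C)) ⊓ LinearMap.ker πs) + Module.finrank ℂ ↥(U ⊓ Θ) := by
    rw [hKt, ← inf_assoc, finrank_inf_comap πs (𝔟 ⊓ T₀ K.A (K.C)) Θ]
  have hbD : Module.finrank ℂ ↥(𝔟 ⊓ D.tangent) =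
      Module.finrank ℂ ↥((𝔟 ⊓ T₀ K.A (K.C)) ⊓ LinearMap.ker πs) + Module.finrank ℂ ↥(U ⊓ Θ') := by
    rw [hDt, ← inf_assoc, finrank_inf_comap πs (𝔟 ⊓ T₀ K.A (K.C)) Θ']
  have hbKD : Module.finrank ℂ ↥(𝔟 ⊓ K.tangent) ≤ Module.finrank ℂ ↥(𝔟 ⊓ D.tangent) := by
    rw [hbK, hbD]; exact Nat.add_le_add_left hdimU _
  exact ⟨D, hdimKD, hbKD⟩


variable (cls κM) in
omit [Fintype 𝓙] in
/-- **A borderline obstruction over `ℂ` with `0 ≠ 𝔨 ≠ Lie M_κ` yields a borderline `ℚ̄`-subgroup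
with `0 ≠ Lie D ≠ Lie M_κ`** (semistable `ℚ̄`-rational `𝔟`). [cite: BakerWustholz2007, §6.7] -/
theorem Semistable.exists_borderline_rational {𝔟 : Submodule ℂ (β ⊕ (γ ⊕ δ) → ℂ)} (hss : Semistable cls κM 𝔟)
    (hrat : IsKRational Kbar 𝔟) (K : SubgroupDataC β γ δ cls κM) (hKtop : K.tangent ≠ ⊤) (hKbot : K.tangent ≠ ⊥)
    (hbord : Module.finrank ℂ 𝔟 * (Fintype.card (β ⊕ (γ ⊕ δ)) - Module.finrank ℂ K.tangent) =
      (Module.finrank ℂ 𝔟 - Module.finrank ℂ ↥(𝔟 ⊓ K.tangent)) * Fintype.card (β ⊕ (γ ⊕ δ))) :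
    ∃ D : SubgroupData β γ δ cls κM, D.tangent ≠ ⊤ ∧ D.tangent ≠ ⊥ ∧
      Module.finrank ℂ 𝔟 * (Fintype.card (β ⊕ (γ ⊕ δ)) - Module.finrank ℂ D.tangent) =
        (Module.finrank ℂ 𝔟 - Module.finrank ℂ ↥(𝔟 ⊓ D.tangent)) * Fintype.card (β ⊕ (γ ⊕ δ)) := by
  obtain ⟨D, hdimKD, hbKD⟩ := exists_rational_datum cls κM hrat K
  -- `D.tangent ≠ ⊤`, `≠ ⊥`
  have hDtop : D.tangent ≠ ⊤ := by
    intro h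
    apply hKtop
    apply Submodule.eq_top_of_finrank_eq
    have h1 : Module.finrank ℂ D.tangent = Module.finrank ℂ (β ⊕ (γ ⊕ δ) → ℂ) := by rw [h, finrank_top]
    rw [← hdimKD, h1]
  have hDbot : D.tangent ≠ ⊥ := by
    intro h
    apply hKbot
    rw [← Submodule.finrank_eq_zero, ← hdimKD, h, finrank_bot]
  -- semistability for `D` and the borderline equality
  have hssD := hss D.tangent ⟨D, rfl⟩ hDtop
  refine ⟨D, hDtop, hDbot, ?_⟩
  rw [hdimKD] at hssD ⊢
  refine le_antisymm hssD ?_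
  calc (Module.finrank ℂ 𝔟 - Module.finrank ℂ ↥(𝔟 ⊓ D.tangent)) * Fintype.card (β ⊕ (γ ⊕ δ))
      ≤ (Module.finrank ℂ 𝔟 - Module.finrank ℂ ↥(𝔟 ⊓ K.tangent)) * Fintype.card (β ⊕ (γ ⊕ δ)) :=
        Nat.mul_le_mul_right _ (Nat.sub_le_sub_left hbKD _)
    _ = Module.finrank ℂ 𝔟 * (Fintype.card (β ⊕ (γ ⊕ δ)) - Module.finrank ℂ K.tangent) := hbord.symm


end Descent

/-! ### The Baker data of the closing argument, the orbit dichotomy, the zero subgroup -/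

section Closing

open Module Submodule LiePresentation

variable [DecidableEq γ]

/-- **The Baker data of the closing argument.** For `Λ` with algebraic invariants, a
`ℚ̄`-rational `𝔟` and `w ∈ AlgTors`, there is a `BakerData` with period pair `L`,
extension data `κ`, point `v = w`, `dd = dim 𝔟` directions spanning exactly `𝔟`.
[cite: BakerWustholz2007, §6.8 (p. 118: the data of the construction)] -/
theorem exists_bakerData (L : 𝓙 → PeriodPair) (cls : γ → 𝓙) (hL : ∀ i, IsAlgebraic ℚ (L i).g₂ ∧ IsAlgebraic ℚ (L i).g₃)
    (κM : δ → γ → Kbar) {𝔟 : Submodule ℂ (β ⊕ (γ ⊕ δ) → ℂ)} (hrat : IsKRational Kbar 𝔟)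
    {w : β ⊕ (γ ⊕ δ) → ℂ} (hw : w ∈ AlgTors L cls κM) :
    ∃ B : BakerData 𝓙 β γ δ, B.L = L ∧ B.cls = cls ∧ B.κM = κM ∧ B.v = w ∧ B.dd = Module.finrank ℂ 𝔟 ∧
      Submodule.span ℂ (Set.range B.xs) = 𝔟 := by
  obtain ⟨N, hN, ⟨tc⟩⟩ := torsionCoords_of_mem_algTors κM hw
  obtain ⟨b, -, hspan⟩ := hrat.exists_basis_ofK Kbar
  let B : BakerData 𝓙 β γ δ :=
    { L := L
      cls := cls
      κM := κM
      hL := hL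
      v := w
      hv := algTors_subset_alg hw
      N := N
      hN := hN
      tc := tc
      dd := Module.finrank ℂ 𝔟
      xs := fun m => ofK Kbar (b m)
      hxs := fun m k => isAlgebraic_coe_Kbar (b m k) }
  exact ⟨B, rfl, rfl, rfl, rfl, rfl, hspan⟩


variable (L : 𝓙 → PeriodPair) (cls : γ → 𝓙) (κM : δ → γ → Kbar)

omit [DecidableEq γ] in
omit [Fintype 𝓙] in
/-- **Orbit dichotomy**: either the `S + 1` multiples `0, v, …, Sv` are distinct modulo
`exp⁻¹(G')` (`orbitCard = S + 1`), or some multiple `r·v`, `0 < r ≤ S`, lies in `Lie G'_ℂ + ker`.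
[folklore] -/
theorem orbitCard_lt_imp (K : SubgroupDataC β γ δ cls κM) (v : β ⊕ (γ ⊕ δ) → ℂ) (S : ℕ)
    (h : orbitCard L cls κM K v S < S + 1) :
    ∃ r : ℕ, 0 < r ∧ r ≤ S ∧ (r : ℂ) • v ∈ preimageSubgroup L cls κM K := by
  by_contra hno
  push Not at hno
  have := orbitCard_eq L cls κM K v S fun r hr hrS => hno r hr hrS
  omega


variable {L cls κM}
variable [DecidableEq β] [DecidableEq δ]

variable (cls : γ → 𝓙) (κM : δ → γ → Kbar) in
/-- The trivial subgroup `0 ≤ M_κ` (`A`, `C`, `Ξ` everything); companion of the whole group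
`SubgroupDataC.top` of `ManyCurveTheta.lean`. [folklore] -/
def SubgroupDataC.zero : SubgroupDataC β γ δ cls κM where
  A := ⊤
  C := ⊤
  blockDiag := isBlockDiag_top cls
  Ξ := ⊤
  compat := by
    intro ξ _
    -- every vector of `ℂ^γ` is in the span of the rational vectors
    have hspan : Submodule.span ℂ ((fun c : γ → ℚ => fun b => (c b : ℂ)) '' ((⊤ : Submodule ℚ (γ → ℚ)) : Set (γ → ℚ))) = ⊤ := by
      classical
      rw [eq_top_iff]
      rintro u -
      have hsingle : ∀ b : γ, (Pi.single b (1 : ℂ) : γ → ℂ) ∈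
          Submodule.span ℂ ((fun c : γ → ℚ => fun b => (c b : ℂ)) '' ((⊤ : Submodule ℚ (γ → ℚ)) : Set (γ → ℚ))) := by
        intro b
        refine Submodule.subset_span ⟨Pi.single b 1, trivial, ?_⟩
        funext b'
        by_cases h : b' = b
        · subst h; simp
        · simp [h]
      rw [pi_eq_sum_univ u]
      refine Submodule.sum_mem _ fun b _ => Submodule.smul_mem _ _ ?_
      have e : (fun j => if b = j then (1 : ℂ) else 0) = Pi.single b (1 : ℂ) := by
        funext j; by_cases h : j = b
        · subst h; simp
        · simp [h, Ne.symm h]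
      rw [e]; exact hsingle b
    rw [hspan]
    trivial


omit [DecidableEq β] [DecidableEq δ] in
omit [Fintype 𝓙] in
/-- `Lie 0 = 0`. [folklore] -/
theorem SubgroupDataC.tangent_zero {κM : δ → γ → Kbar} :
    (SubgroupDataC.zero cls κM : SubgroupDataC β γ δ cls κM).tangent = ⊥ := by
  classical
  rw [eq_bot_iff]
  intro w hw
  rw [SubgroupDataC.mem_tangent_iff] at hw
  obtain ⟨hA, hC, hΞ⟩ := hw
  rw [Submodule.mem_bot]
  funext i
  rcases i with j | b | e
  · have := hA (Pi.single j 1) trivial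
    simp only [Pi.single_apply, apply_ite ((↑) : ℚ → ℂ), Rat.cast_one, Rat.cast_zero, ite_mul, one_mul,
      zero_mul, Finset.sum_ite_eq', Finset.mem_univ, if_true] at this
    simpa [iy] using this
  · have := hC (Pi.single b 1) trivial
    simp only [Pi.single_apply, apply_ite ((↑) : ℚ → ℂ), Rat.cast_one, Rat.cast_zero, ite_mul, one_mul,
      zero_mul, Finset.sum_ite_eq', Finset.mem_univ, if_true] at this
    simpa [iz] using this
  · have := hΞ (Pi.single e 1) trivial
    simp only [Pi.single_apply, ite_mul, one_mul, zero_mul, Finset.sum_ite_eq', Finset.mem_univ, if_true] at this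
    simpa [is] using this


/-- The admissible-parameter hypothesis of the dichotomy theorem: for the Baker datum `B` and
the constant `c > 0` there are parameters `D', T, S₀, S, T″, R` with the hypotheses of the scaled
engine `NewPointsScaled.engine₂` (`T ≥ 1`, Siegel feasibility `(S₀+1)T^{dd} < (D'+1)^n`,
`R ≥ 2(nS + S₀)`, the numerical condition `NumCond₂` for every coefficient vector within the Siegel
bound, with `S₁ = nS`, `T' = nT″ + 1`), `D' ≥ 1`, `S ≥ 1`, and the zero-estimate numerics: for
all `e, m` with `m < n` and `d·(n - m) ≤ e·n` (`d` the intended `dim 𝔟`),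
`c·D^n < binom(T″+e, e)·(S+1)·D^m`, and `c·D^n < binom(T″+e, e)·D^m` when the index inequality is
strict (`D = nD'`). Its satisfiability (for `B.dd = d < n`) is the parameter bookkeeping of the
source, not proved here. [cite: BakerWustholz2007, §6.8 (p. 119: choice of D, T, S)] -/
def AdmissibleParams (B : BakerData 𝓙 β γ δ) (d𝔟 : ℕ) (c : ℝ) : Prop :=
  ∃ (D' T S₀ S T'' : ℕ) (R : ℝ), 0 < T ∧ 1 ≤ D' ∧ 1 ≤ S ∧
    (S₀ + 1) * T ^ B.dd < (D' + 1) ^ Fintype.card (β ⊕ (γ ⊕ δ)) ∧ 0 < R ∧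
    2 * (((Fintype.card (β ⊕ (γ ⊕ δ)) * S : ℕ) : ℝ) + S₀) ≤ R ∧
    (∀ ξ : GaGmE.Std.BakerData.UIdx β γ δ D' → NumberField.RingOfIntegers B.K,
      (∀ u, NumberField.house ((ξ u : NumberField.RingOfIntegers B.K) : B.K) ≤ B.siegelHouseBound D' T S₀) →
        B.NumCond₂ ξ T S₀ (Fintype.card (β ⊕ (γ ⊕ δ)) * S) (Fintype.card (β ⊕ (γ ⊕ δ)) * T'' + 1) R) ∧
    ∀ e m : ℕ, m < Fintype.card (β ⊕ (γ ⊕ δ)) → d𝔟 * (Fintype.card (β ⊕ (γ ⊕ δ)) - m) ≤ e * Fintype.card (β ⊕ (γ ⊕ δ)) →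
      c * ((Fintype.card (β ⊕ (γ ⊕ δ)) * D' : ℕ) : ℝ) ^ Fintype.card (β ⊕ (γ ⊕ δ)) <
          (Nat.choose (T'' + e) e : ℝ) * ((S : ℝ) + 1) * ((Fintype.card (β ⊕ (γ ⊕ δ)) * D' : ℕ) : ℝ) ^ m ∧
      (d𝔟 * (Fintype.card (β ⊕ (γ ⊕ δ)) - m) < e * Fintype.card (β ⊕ (γ ⊕ δ)) →
        c * ((Fintype.card (β ⊕ (γ ⊕ δ)) * D' : ℕ) : ℝ) ^ Fintype.card (β ⊕ (γ ⊕ δ)) <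
          (Nat.choose (T'' + e) e : ℝ) * ((Fintype.card (β ⊕ (γ ⊕ δ)) * D' : ℕ) : ℝ) ^ m)


/-- **The dichotomy theorem of Baker's method on `M_κ`.** Let `Λ` have algebraic invariants
and no CM, `𝔟 ⊊ Lie M_κ` `ℚ̄`-rational and semistable, `w ∈ 𝔟` with `exp(w)` algebraic with
torsion abelian part. Assume Philippon's zero estimate, and admissible parameters (for every
constant) for every Baker datum with period pair `L`, extension data `κ`, point `w` and
`dd = dim 𝔟` directions spanning `𝔟` (exactly the data produced by `ClosingData.exists_bakerData`).
Then there is a connected algebraic subgroup datum `K ≠ M_κ`, borderline for semistability,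
with a multiple `r·w` (`r ≥ 1`) in `Lie K_ℂ + ker`. Conditional on the satisfiability of
`AdmissibleParams` (see the module docstring). [cite: BakerWustholz2007, §6.8 (pp. 118–119)] -/
theorem dichotomy (L : 𝓙 → PeriodPair) (cls : γ → 𝓙) (hL : ∀ i, IsAlgebraic ℚ (L i).g₂ ∧ IsAlgebraic ℚ (L i).g₃) (κM : δ → γ → Kbar)
    (hphil : ∃ c : ℝ, 0 < c ∧ ∀ (𝔟 : Submodule ℂ (β ⊕ (γ ⊕ δ) → ℂ)) (v : β ⊕ (γ ⊕ δ) → ℂ)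
      (P : MvPolynomial (Option β × ThetaIdx γ δ) ℂ) (D S T : ℕ),
      0 < Module.finrank ℂ 𝔟 → 1 ≤ D → 1 ≤ S → P.IsHomogeneous D → (∃ w, thetaEval L cls κM P w ≠ 0) →
      (∀ s : ℕ, s ≤ Fintype.card (β ⊕ (γ ⊕ δ)) * S →
        VanishesAlong 𝔟 (thetaEval L cls κM P) ((s : ℂ) • v) (Fintype.card (β ⊕ (γ ⊕ δ)) * T + 1)) →
      ∃ K : SubgroupDataC β γ δ cls κM, (∃ w₀, ∀ w ∈ K.tangent, thetaEval L cls κM P (w₀ + w) = 0) ∧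
        (Nat.choose (T + (Module.finrank ℂ 𝔟 - Module.finrank ℂ ↥(𝔟 ⊓ K.tangent)))
            (Module.finrank ℂ 𝔟 - Module.finrank ℂ ↥(𝔟 ⊓ K.tangent)) : ℝ) *
          (orbitCard L cls κM K v S : ℝ) * (D : ℝ) ^ Module.finrank ℂ K.tangent ≤
          c * (D : ℝ) ^ Fintype.card (β ⊕ (γ ⊕ δ)))
    {𝔟 : Submodule ℂ (β ⊕ (γ ⊕ δ) → ℂ)} (hrat : IsKRational Kbar 𝔟) (h𝔟 : 𝔟 ≠ ⊤)
    (hss : Semistable cls κM 𝔟) {w : β ⊕ (γ ⊕ δ) → ℂ} (hw𝔟 : w ∈ 𝔟) (hw : w ∈ AlgTors L cls κM)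
    (hpar : ∀ B : BakerData 𝓙 β γ δ, B.L = L → B.cls = cls → B.κM = κM → B.v = w → B.dd = Module.finrank ℂ 𝔟 →
      Submodule.span ℂ (Set.range B.xs) = 𝔟 → ∀ c : ℝ, 0 < c → AdmissibleParams B (Module.finrank ℂ 𝔟) c) :
    ∃ K : SubgroupDataC β γ δ cls κM, K.tangent ≠ ⊤ ∧
      Module.finrank ℂ 𝔟 * (Fintype.card (β ⊕ (γ ⊕ δ)) - Module.finrank ℂ K.tangent) =
        (Module.finrank ℂ 𝔟 - Module.finrank ℂ ↥(𝔟 ⊓ K.tangent)) * Fintype.card (β ⊕ (γ ⊕ δ)) ∧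
      ∃ r : ℕ, 0 < r ∧ (r : ℂ) • w ∈ preimageSubgroup L cls κM K := by
  classical
  set n := Fintype.card (β ⊕ (γ ⊕ δ)) with hn
  -- `n ≥ 1` and `dim 𝔟 < n`
  have h𝔟lt : Module.finrank ℂ 𝔟 < n := by
    have := Submodule.finrank_lt h𝔟; simpa [hn] using this
  -- the degenerate case `𝔟 = 0`: `w = 0`, take `K = 0`
  by_cases h0 : Module.finrank ℂ 𝔟 = 0
  · have h𝔟0 : 𝔟 = ⊥ := Submodule.finrank_eq_zero.mp h0
    have hw0 : w = 0 := by rw [h𝔟0, Submodule.mem_bot] at hw𝔟; exact hw𝔟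
    refine ⟨SubgroupDataC.zero cls κM, ?_, ?_, 1, one_pos, ?_⟩
    · rw [SubgroupDataC.tangent_zero]
      intro h
      have : Module.finrank ℂ (⊥ : Submodule ℂ (β ⊕ (γ ⊕ δ) → ℂ)) = Module.finrank ℂ (⊤ : Submodule ℂ (β ⊕ (γ ⊕ δ) → ℂ)) := by
        rw [h]
      rw [finrank_bot, finrank_top, Module.finrank_fintype_fun_eq_card, ← hn] at this
      omega
    · rw [h0]; simp
    · rw [hw0, smul_zero]; exact AddSubgroup.zero_mem _
  have h𝔟pos : 0 < Module.finrank ℂ 𝔟 := Nat.pos_of_ne_zero h0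
  -- the Baker datum and Philippon's constant
  obtain ⟨B, hBL, hBcls, hBκ, hBv, hBdd, hBspan⟩ := exists_bakerData L cls hL κM hrat hw
  obtain ⟨c, hc, hZ⟩ := hphil
  obtain ⟨D', T, S₀, S, T'', R, hT, hD', hS, hpq, hR0, hR, hnum, hineq⟩ := hpar B hBL hBcls hBκ hBv hBdd hBspan c hc
  -- run the engine
  have hv : B.v ∈ B.bSpan := by
    show B.v ∈ Submodule.span ℂ (Set.range B.xs)
    rw [hBspan, hBv]; exact hw𝔟
  obtain ⟨P, hP, hne, hvan⟩ := B.engine₂ hv D' T S₀ (n * S) (n * T'' + 1) R hT hpq hR0 (by exact_mod_cast hR) hnum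
  -- Philippon's zero estimate
  have hD1 : 1 ≤ n * D' := Nat.one_le_iff_ne_zero.mpr (Nat.mul_ne_zero (by omega) (by omega))
  have hvan' : ∀ s : ℕ, s ≤ n * S → VanishesAlong 𝔟 (thetaEval L cls κM P) ((s : ℂ) • w) (n * T'' + 1) := by
    intro s hs
    have := hvan s hs
    rwa [show B.bSpan = 𝔟 from hBspan, hBL, hBcls, hBκ, hBv] at this
  have hne' : ∃ w', thetaEval L cls κM P w' ≠ 0 := by rwa [hBL, hBcls, hBκ] at hne
  obtain ⟨K, ⟨w₀, hw₀⟩, hK⟩ := hZ 𝔟 w P (n * D') S T'' h𝔟pos hD1 hS hP hne' hvan'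
  -- `K ≠ M_κ`
  have hKtop : K.tangent ≠ ⊤ := by
    intro htop
    obtain ⟨w', hw'⟩ := hne'
    apply hw'
    have := hw₀ (w' - w₀) (by rw [htop]; trivial)
    simpa using this
  have hm : Module.finrank ℂ K.tangent < n := by
    have := Submodule.finrank_lt hKtop; simpa [hn] using this
  -- the index inequality
  have hidx := hss.index_le cls κM hrat K hKtop
  set e := Module.finrank ℂ 𝔟 - Module.finrank ℂ ↥(𝔟 ⊓ K.tangent) with he
  set m := Module.finrank ℂ K.tangent with hm'
  obtain ⟨hfull, hstrict⟩ := hineq e m hm hidx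
  -- orbit dichotomy
  have horb_le := orbitCard_le L cls κM K w S
  have hD0 : (0 : ℝ) < ((n * D' : ℕ) : ℝ) := by exact_mod_cast hD1
  by_cases horb : orbitCard L cls κM K w S = S + 1
  · -- full orbit: numerics contradict Philippon
    exfalso
    rw [horb] at hK
    rw [← hn] at hfull
    push_cast at hK hfull
    linarith
  · -- small orbit: a multiple of `w` meets `Lie K + ker`; then `K` must be borderline
    obtain ⟨r, hr, -, hrmem⟩ := orbitCard_lt_imp L cls κM K w S (lt_of_le_of_ne horb_le horb)
    refine ⟨K, hKtop, ?_, r, hr, hrmem⟩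
    by_contra hneq
    have hlt : Module.finrank ℂ 𝔟 * (n - m) < e * n := lt_of_le_of_ne hidx hneq
    have h1 := hstrict hlt
    have horb1 : (1 : ℝ) ≤ orbitCard L cls κM K w S := by exact_mod_cast one_le_orbitCard L cls κM K w S
    have h2 : (Nat.choose (T'' + e) e : ℝ) * ((n * D' : ℕ) : ℝ) ^ m ≤
        (Nat.choose (T'' + e) e : ℝ) * (orbitCard L cls κM K w S : ℝ) * ((n * D' : ℕ) : ℝ) ^ m := by
      have hch : (0 : ℝ) ≤ (Nat.choose (T'' + e) e : ℝ) := Nat.cast_nonneg _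
      have hpow : (0 : ℝ) ≤ ((n * D' : ℕ) : ℝ) ^ m := by positivity
      rw [show (Nat.choose (T'' + e) e : ℝ) * ((n * D' : ℕ) : ℝ) ^ m =
        (Nat.choose (T'' + e) e : ℝ) * 1 * ((n * D' : ℕ) : ℝ) ^ m from by ring]
      exact mul_le_mul_of_nonneg_right (mul_le_mul_of_nonneg_left horb1 hch) hpow
    rw [← hn] at h1
    push_cast at hK h1 h2
    linarith


end Closing

/-! ### Envelopes and the numerical condition in the parameter families -/

section Families

variable [DecidableEq γ]

open Finset NumberField
open GaGmE.Std.BakerData (UIdx νOf νOf_apply νOf_injective degree_νOf_le card_UIdx)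

namespace BakerData

variable (B : BakerData 𝓙 β γ δ)

/-- **The big constant** `G ≥ 2` dominating every constant of the datum that enters `NumCond₂`.
[folklore] -/
def bigConst : ℝ :=
  2 + |(B.d₁ : ℝ)| + B.M + B.hB + max 1 B.qB + ((B.dd : ℝ) + 1) + siegelConst B.K +
    Real.exp (thetaGrowthC (β := β) B.L B.cls B.κM) + B.thetaLowc⁻¹ + Real.exp B.thetaLowC +
    (B.dirNorm + 1) + (‖B.v‖ + 1)


/-- The summands of `G` are non-negative; `G` dominates each of them and `G ≥ 2`. [folklore] -/
theorem bigConst_spec :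
    2 ≤ B.bigConst ∧ |(B.d₁ : ℝ)| ≤ B.bigConst ∧ B.M ≤ B.bigConst ∧ B.hB ≤ B.bigConst ∧
    max 1 B.qB ≤ B.bigConst ∧ (B.dd : ℝ) + 1 ≤ B.bigConst ∧ siegelConst B.K ≤ B.bigConst ∧
    Real.exp (thetaGrowthC (β := β) B.L B.cls B.κM) ≤ B.bigConst ∧ B.thetaLowc⁻¹ ≤ B.bigConst ∧
    Real.exp B.thetaLowC ≤ B.bigConst ∧ B.dirNorm + 1 ≤ B.bigConst ∧ ‖B.v‖ + 1 ≤ B.bigConst := by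
  have h1 : 0 ≤ |(B.d₁ : ℝ)| := abs_nonneg _
  have h2 : 0 ≤ B.M := zero_le_one.trans B.gens.one_le_M
  have h3 : 0 ≤ B.hB := zero_le_one.trans B.one_le_hB
  have h4 : 0 ≤ max 1 B.qB := zero_le_one.trans (le_max_left _ _)
  have h5 : 0 ≤ (B.dd : ℝ) + 1 := by positivity
  have h6 : 0 ≤ siegelConst B.K := zero_le_one.trans (one_le_siegelConst B.K)
  have h7 : 0 ≤ Real.exp (thetaGrowthC (β := β) B.L B.cls B.κM) := Real.exp_nonneg _
  have h8 : 0 ≤ B.thetaLowc⁻¹ := inv_nonneg.mpr B.thetaLow_spec.1.le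
  have h9 : 0 ≤ Real.exp B.thetaLowC := Real.exp_nonneg _
  have h10 : 0 ≤ B.dirNorm + 1 := by have := B.dirNorm_nonneg; positivity
  have h11 : 0 ≤ ‖B.v‖ + 1 := by positivity
  unfold bigConst
  refine ⟨?_, ?_, ?_, ?_, ?_, ?_, ?_, ?_, ?_, ?_, ?_, ?_⟩ <;> linarith


/-- `1 ≤ G`. [folklore] -/
theorem one_le_bigConst : 1 ≤ B.bigConst := by have := B.bigConst_spec.1; linarith


/-- `x^N ≤ G^N` for `0 ≤ x ≤ G`. [folklore] -/
theorem pow_le_bigConst_pow {x : ℝ} (hx0 : 0 ≤ x) (hx : x ≤ B.bigConst) (N : ℕ) : x ^ N ≤ B.bigConst ^ N :=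
  pow_le_pow_left₀ hx0 hx N


/-- Monotonicity in the exponent: `G^N ≤ G^{N'}` for `N ≤ N'`. [folklore] -/
theorem bigConst_pow_mono {N N' : ℕ} (h : N ≤ N') : B.bigConst ^ N ≤ B.bigConst ^ N' :=
  pow_le_pow_right₀ B.one_le_bigConst h


/-- `exp(C·y) ≤ G^N` when `e^C ≤ G`, `0 ≤ y ≤ N`. [folklore] -/
theorem exp_mul_le_bigConst_pow {C y : ℝ} (hC : Real.exp C ≤ B.bigConst) (hC0 : 0 ≤ C)
    {N : ℕ} (hy : y ≤ N) : Real.exp (C * y) ≤ B.bigConst ^ N := by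
  have hG := B.one_le_bigConst
  calc Real.exp (C * y) ≤ Real.exp (C * N) := Real.exp_le_exp.mpr (mul_le_mul_of_nonneg_left hy hC0)
    _ = Real.exp C ^ N := by rw [← Real.exp_nat_mul, mul_comm]
    _ ≤ B.bigConst ^ N := pow_le_pow_left₀ (Real.exp_nonneg _) hC N


/-- **Envelope of `houseBound`**: with `D = nD'`, `E_T = expE D T`,
`A ≤ G^{(S₀+1)E_T + 2T + D + (S₀+1)(D·hdeg + 2T)} · W^{T + (D·hdeg + 2T)}`
whenever `D·hdeg + 2T + 1 ≤ W` and `S₀ + 1 ≤ W`. [folklore] -/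
theorem houseBound_le (D' T S₀ : ℕ) {W : ℝ} (hW1 : 1 ≤ W)
    (hWT : ((Fintype.card (β ⊕ (γ ⊕ δ)) * D' * B.hdeg : ℕ) : ℝ) + 2 * T + 1 ≤ W)
    (hWS : (S₀ : ℝ) + 1 ≤ W) :
    B.houseBound D' T S₀ ≤
      B.bigConst ^ ((S₀ + 1) * B.expE (Fintype.card (β ⊕ (γ ⊕ δ)) * D') T + 2 * T +
          Fintype.card (β ⊕ (γ ⊕ δ)) * D' +
          (S₀ + 1) * (Fintype.card (β ⊕ (γ ⊕ δ)) * D' * B.hdeg + 2 * T)) *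
        W ^ (T + (Fintype.card (β ⊕ (γ ⊕ δ)) * D' * B.hdeg + 2 * T)) := by
  obtain ⟨hG2, hd1, hM, hhB, hqB, hdd, -⟩ := B.bigConst_spec
  have hG1 := B.one_le_bigConst
  set n := Fintype.card (β ⊕ (γ ⊕ δ)) with hn
  set D := n * D' with hD
  set ET := B.expE D T with hET
  set P := D * B.hdeg + 2 * T with hP
  unfold houseBound
  rw [← hn, ← hD, ← hET]
  have hG0 : (0 : ℝ) ≤ B.bigConst := by linarith
  have hW0 : (0 : ℝ) ≤ W := by linarith
  have hM1 := B.gens.one_le_M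
  have e6 : ((S₀ : ℝ) + 1) * B.M ^ (S₀ + 1) ≤ W * B.bigConst ^ (S₀ + 1) :=
    mul_le_mul hWS (pow_le_pow_left₀ (zero_le_one.trans hM1) hM _) (by positivity) hW0
  -- factor by factor
  have f1 : (|(B.d₁ : ℝ)|) ^ ((S₀ + 1) * ET) ≤ B.bigConst ^ ((S₀ + 1) * ET) :=
    pow_le_pow_left₀ (abs_nonneg _) hd1 _
  have f2 : ((B.dd : ℝ) + 1) ^ T ≤ B.bigConst ^ T := pow_le_pow_left₀ (by positivity) hdd _
  have f3 : (((D * B.hdeg : ℕ) : ℝ) + 2 * T + 1) ^ T ≤ W ^ T := pow_le_pow_left₀ (by positivity) hWT _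
  have f4 : (max 1 B.qB) ^ T ≤ B.bigConst ^ T := pow_le_pow_left₀ (zero_le_one.trans (le_max_left _ _)) hqB _
  have f5 : B.hB ^ D ≤ B.bigConst ^ D := pow_le_pow_left₀ (zero_le_one.trans B.one_le_hB) hhB _
  have f6 : (((S₀ : ℝ) + 1) * B.M ^ (S₀ + 1)) ^ P ≤ (W * B.bigConst ^ (S₀ + 1)) ^ P :=
    pow_le_pow_left₀ (by positivity) e6 _
  have n1 : (0 : ℝ) ≤ (|(B.d₁ : ℝ)|) ^ ((S₀ + 1) * ET) := by positivity
  have n2 : (0 : ℝ) ≤ ((B.dd : ℝ) + 1) ^ T := by positivity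
  have n3 : (0 : ℝ) ≤ (((D * B.hdeg : ℕ) : ℝ) + 2 * T + 1) ^ T := by positivity
  have n4 : (0 : ℝ) ≤ (max 1 B.qB) ^ T := pow_nonneg (zero_le_one.trans (le_max_left _ _)) _
  have n5 : (0 : ℝ) ≤ B.hB ^ D := pow_nonneg (zero_le_one.trans B.one_le_hB) _
  have n6 : (0 : ℝ) ≤ (((S₀ : ℝ) + 1) * B.M ^ (S₀ + 1)) ^ P := by positivity
  have b1 : (0 : ℝ) ≤ B.bigConst ^ ((S₀ + 1) * ET) := pow_nonneg hG0 _
  have b12 : (0 : ℝ) ≤ B.bigConst ^ ((S₀ + 1) * ET) * B.bigConst ^ T := by positivity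
  have b123 : (0 : ℝ) ≤ B.bigConst ^ ((S₀ + 1) * ET) * B.bigConst ^ T * W ^ T := by positivity
  have b1234 : (0 : ℝ) ≤ B.bigConst ^ ((S₀ + 1) * ET) * B.bigConst ^ T * W ^ T * B.bigConst ^ T := by positivity
  have b12345 : (0 : ℝ) ≤ B.bigConst ^ ((S₀ + 1) * ET) * B.bigConst ^ T * W ^ T * B.bigConst ^ T * B.bigConst ^ D := by
    positivity
  show (|(B.d₁ : ℝ)|) ^ ((S₀ + 1) * ET) * ((B.dd : ℝ) + 1) ^ T * (((D * B.hdeg : ℕ) : ℝ) + 2 * T + 1) ^ T *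
      (max 1 B.qB) ^ T * B.hB ^ D * (((S₀ : ℝ) + 1) * B.M ^ (S₀ + 1)) ^ P ≤ _
  calc (|(B.d₁ : ℝ)|) ^ ((S₀ + 1) * ET) * ((B.dd : ℝ) + 1) ^ T * (((D * B.hdeg : ℕ) : ℝ) + 2 * T + 1) ^ T *
        (max 1 B.qB) ^ T * B.hB ^ D * (((S₀ : ℝ) + 1) * B.M ^ (S₀ + 1)) ^ P
      ≤ B.bigConst ^ ((S₀ + 1) * ET) * B.bigConst ^ T * W ^ T * B.bigConst ^ T * B.bigConst ^ D *
          (W * B.bigConst ^ (S₀ + 1)) ^ P :=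
        mul_le_mul (mul_le_mul (mul_le_mul (mul_le_mul (mul_le_mul f1 f2 n2 b1) f3 n3 b12) f4 n4 b123)
          f5 n5 b1234) f6 n6 b12345
    _ = B.bigConst ^ ((S₀ + 1) * ET + 2 * T + D + (S₀ + 1) * P) * W ^ (T + P) := by
        rw [mul_pow, ← pow_mul]; ring


/-- `x^t ≤ x` for `x ≥ 1` and `0 ≤ t ≤ 1`. [folklore] -/
theorem rpow_le_self_of_one_le {x t : ℝ} (hx : 1 ≤ x) (ht1 : t ≤ 1) : x ^ t ≤ x := by
  calc x ^ t ≤ x ^ (1 : ℝ) := Real.rpow_le_rpow_of_exponent_le hx ht1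
    _ = x := Real.rpow_one x


/-- **Envelope of the Siegel house bound** when `q ≥ 2p` (so the Siegel exponent is `≤ 1`):
`siegelHouseBound ≤ G² · W^n · A`, `A = houseBound`, given `(D'+1)^n ≤ W^n`-type control
`D' + 1 ≤ W`. [folklore] -/
theorem siegelHouseBound_le (D' T S₀ : ℕ) {W : ℝ} (hWD : (D' : ℝ) + 1 ≤ W)
    (hqp : 2 * ((S₀ + 1) * T ^ B.dd) ≤ (D' + 1) ^ Fintype.card (β ⊕ (γ ⊕ δ))) (hp : 0 < (S₀ + 1) * T ^ B.dd) :
    B.siegelHouseBound D' T S₀ ≤ B.bigConst ^ 2 * W ^ Fintype.card (β ⊕ (γ ⊕ δ)) * B.houseBound D' T S₀ := by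
  obtain ⟨hG2, -, -, -, -, -, hCK, -⟩ := B.bigConst_spec
  set n := Fintype.card (β ⊕ (γ ⊕ δ)) with hn
  set p : ℕ := (S₀ + 1) * T ^ B.dd with hp'
  set q : ℕ := (D' + 1) ^ n with hq
  have hA1 := B.one_le_houseBound D' T S₀
  have hC1 := one_le_siegelConst B.K
  have hq1 : (1 : ℝ) ≤ q := by
    have : 1 ≤ q := Nat.one_le_iff_ne_zero.mpr (pow_ne_zero _ (Nat.succ_ne_zero _))
    exact_mod_cast this
  -- the exponent `t = p/(q - p) ∈ [0, 1]`
  have hqp' : (2 : ℝ) * p ≤ q := by exact_mod_cast hqp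
  have hp0 : (0 : ℝ) < p := by exact_mod_cast hp
  set t : ℝ := (p : ℝ) / ((q : ℝ) - p) with ht
  have ht1 : t ≤ 1 := by rw [ht, div_le_one (by linarith)]; linarith
  have hbase : 1 ≤ siegelConst B.K * q * B.houseBound D' T S₀ :=
    one_le_mul_of_one_le_of_one_le (one_le_mul_of_one_le_of_one_le hC1 hq1) hA1
  unfold siegelHouseBound
  rw [← hn, ← hp', ← hq]
  calc siegelConst B.K * (siegelConst B.K * (q : ℝ) * B.houseBound D' T S₀) ^ t
      ≤ siegelConst B.K * (siegelConst B.K * (q : ℝ) * B.houseBound D' T S₀) :=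
        mul_le_mul_of_nonneg_left (rpow_le_self_of_one_le hbase ht1) (zero_le_one.trans hC1)
    _ = siegelConst B.K ^ 2 * (q : ℝ) * B.houseBound D' T S₀ := by ring
    _ ≤ B.bigConst ^ 2 * W ^ n * B.houseBound D' T S₀ := by
        have hqW : (q : ℝ) ≤ W ^ n := by
          rw [hq]; push_cast; exact pow_le_pow_left₀ (by positivity) hWD n
        have hCG : siegelConst B.K ^ 2 ≤ B.bigConst ^ 2 := pow_le_pow_left₀ (zero_le_one.trans hC1) hCK 2
        have : (0 : ℝ) ≤ B.bigConst ^ 2 := by positivity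
        exact mul_le_mul_of_nonneg_right (mul_le_mul hCG hqW (by positivity) this) (zero_le_one.trans hA1)


/-- **Envelope of the Siegel house bound of the spaced system** when `q ≥ 2p`:
`siegelHouseBound₃ ≤ G² · W^n · A`, `A = houseBound D' T (ℓ S_rows)`, given `D' + 1 ≤ W`. [folklore] -/
theorem siegelHouseBound₃_le (ℓ D' T Srows : ℕ) {W : ℝ} (hWD : (D' : ℝ) + 1 ≤ W)
    (hqp : 2 * ((Srows + 1) * T ^ B.dd) ≤ (D' + 1) ^ Fintype.card (β ⊕ (γ ⊕ δ)))
    (hp : 0 < (Srows + 1) * T ^ B.dd) :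
    B.siegelHouseBound₃ ℓ D' T Srows ≤
      B.bigConst ^ 2 * W ^ Fintype.card (β ⊕ (γ ⊕ δ)) * B.houseBound D' T (ℓ * Srows) := by
  obtain ⟨hG2, -, -, -, -, -, hCK, -⟩ := B.bigConst_spec
  set n := Fintype.card (β ⊕ (γ ⊕ δ)) with hn
  set p : ℕ := (Srows + 1) * T ^ B.dd with hp'
  set q : ℕ := (D' + 1) ^ n with hq
  have hA1 := B.one_le_houseBound D' T (ℓ * Srows)
  have hC1 := one_le_siegelConst B.K
  have hq1 : (1 : ℝ) ≤ q := by
    have : 1 ≤ q := Nat.one_le_iff_ne_zero.mpr (pow_ne_zero _ (Nat.succ_ne_zero _))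
    exact_mod_cast this
  have hqp' : (2 : ℝ) * p ≤ q := by exact_mod_cast hqp
  have hp0 : (0 : ℝ) < p := by exact_mod_cast hp
  set t : ℝ := (p : ℝ) / ((q : ℝ) - p) with ht
  have ht1 : t ≤ 1 := by rw [ht, div_le_one (by linarith)]; linarith
  have hbase : 1 ≤ siegelConst B.K * q * B.houseBound D' T (ℓ * Srows) :=
    one_le_mul_of_one_le_of_one_le (one_le_mul_of_one_le_of_one_le hC1 hq1) hA1
  unfold siegelHouseBound₃
  rw [← hn, ← hp', ← hq]
  calc siegelConst B.K * (siegelConst B.K * (q : ℝ) * B.houseBound D' T (ℓ * Srows)) ^ t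
      ≤ siegelConst B.K * (siegelConst B.K * (q : ℝ) * B.houseBound D' T (ℓ * Srows)) :=
        mul_le_mul_of_nonneg_left (rpow_le_self_of_one_le hbase ht1) (zero_le_one.trans hC1)
    _ = siegelConst B.K ^ 2 * (q : ℝ) * B.houseBound D' T (ℓ * Srows) := by ring
    _ ≤ B.bigConst ^ 2 * W ^ n * B.houseBound D' T (ℓ * Srows) := by
        have hqW : (q : ℝ) ≤ W ^ n := by
          rw [hq]; push_cast; exact pow_le_pow_left₀ (by positivity) hWD n
        have hCG : siegelConst B.K ^ 2 ≤ B.bigConst ^ 2 := pow_le_pow_left₀ (zero_le_one.trans hC1) hCK 2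
        have : (0 : ℝ) ≤ B.bigConst ^ 2 := by positivity
        exact mul_le_mul_of_nonneg_right (mul_le_mul hCG hqW (by positivity) this) (zero_le_one.trans hA1)


variable [DecidableEq β] [DecidableEq δ]

/-- **Envelope of `H_ξ`** under the Siegel house bound on the coefficients:
`H_ξ ≤ G³ · W^{2n} · A`. [folklore] -/
theorem houseXi_le {D' T S₀ : ℕ} (ξ : UIdx β γ δ D' → 𝓞 B.K)
    (hξ : ∀ u, house ((ξ u : 𝓞 B.K) : B.K) ≤ B.siegelHouseBound D' T S₀) {W : ℝ} (hW1 : 1 ≤ W)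
    (hWD : (D' : ℝ) + 1 ≤ W) (hqp : 2 * ((S₀ + 1) * T ^ B.dd) ≤ (D' + 1) ^ Fintype.card (β ⊕ (γ ⊕ δ)))
    (hp : 0 < (S₀ + 1) * T ^ B.dd) :
    B.houseXi ξ ≤ B.bigConst ^ 3 * W ^ (2 * Fintype.card (β ⊕ (γ ⊕ δ))) * B.houseBound D' T S₀ := by
  have hG2 := B.bigConst_spec.1
  set n := Fintype.card (β ⊕ (γ ⊕ δ)) with hn
  have hSHB := B.siegelHouseBound_le D' T S₀ hWD hqp hp
  rw [← hn] at hSHB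
  have hA1 := B.one_le_houseBound D' T S₀
  have hU : (Fintype.card (UIdx β γ δ D') : ℝ) ≤ W ^ n := by
    rw [card_UIdx]; push_cast; exact pow_le_pow_left₀ (by positivity) hWD n
  unfold houseXi
  have hsum : ∑ u, house ((ξ u : 𝓞 B.K) : B.K) ≤ (Fintype.card (UIdx β γ δ D') : ℝ) * B.siegelHouseBound D' T S₀ := by
    calc ∑ u, house ((ξ u : 𝓞 B.K) : B.K) ≤ ∑ _u : UIdx β γ δ D', B.siegelHouseBound D' T S₀ :=
          Finset.sum_le_sum fun u _ => hξ u
      _ = _ := by rw [Finset.sum_const, nsmul_eq_mul, Finset.card_univ]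
  have hSHB0 : 0 ≤ B.siegelHouseBound D' T S₀ := (house_nonneg _).trans (hξ (fun _ => 0))
  have hWn : (1 : ℝ) ≤ W ^ n := one_le_pow₀ hW1
  have hX : 1 + (Fintype.card (UIdx β γ δ D') : ℝ) * B.siegelHouseBound D' T S₀ ≤
      W ^ n * (B.bigConst ^ 2 * W ^ n * B.houseBound D' T S₀) + W ^ n * (B.bigConst ^ 2 * W ^ n * B.houseBound D' T S₀) := by
    have h1 : (1 : ℝ) ≤ W ^ n * (B.bigConst ^ 2 * W ^ n * B.houseBound D' T S₀) := by
      refine one_le_mul_of_one_le_of_one_le hWn (one_le_mul_of_one_le_of_one_le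
        (one_le_mul_of_one_le_of_one_le (by nlinarith) hWn) hA1)
    have h2 : (Fintype.card (UIdx β γ δ D') : ℝ) * B.siegelHouseBound D' T S₀ ≤
        W ^ n * (B.bigConst ^ 2 * W ^ n * B.houseBound D' T S₀) :=
      mul_le_mul hU hSHB hSHB0 (by positivity)
    linarith
  calc 1 + ∑ u, house ((ξ u : 𝓞 B.K) : B.K) ≤ 1 + (Fintype.card (UIdx β γ δ D') : ℝ) * B.siegelHouseBound D' T S₀ := by
        linarith
    _ ≤ 2 * (W ^ n * (B.bigConst ^ 2 * W ^ n * B.houseBound D' T S₀)) := by linarith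
    _ ≤ B.bigConst * (W ^ n * (B.bigConst ^ 2 * W ^ n * B.houseBound D' T S₀)) :=
        mul_le_mul_of_nonneg_right hG2 (by positivity)
    _ = B.bigConst ^ 3 * W ^ (2 * n) * B.houseBound D' T S₀ := by ring


omit [DecidableEq β] [DecidableEq δ] in
/-- **Envelope of `|d_s|^E`**: `|d_s|^{E(D,k)} ≤ G^{(S₁+1)·E(D,T')}` for `s ≤ S₁`, `k ≤ T'`. [folklore] -/
theorem dAt_pow_le {D S₁ T' s k : ℕ} (hs : s ≤ S₁) (hk : k ≤ T') :
    |(B.dAt s : ℝ)| ^ B.expE D k ≤ B.bigConst ^ ((S₁ + 1) * B.expE D T') := by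
  obtain ⟨-, hd1, -⟩ := B.bigConst_spec
  have hd1' := B.one_le_abs_d₁
  have e : |(B.dAt s : ℝ)| = |(B.d₁ : ℝ)| ^ (s + 1) := by
    rw [dAt]; push_cast; rw [abs_pow]
  rw [e, ← pow_mul]
  calc |(B.d₁ : ℝ)| ^ ((s + 1) * B.expE D k) ≤ |(B.d₁ : ℝ)| ^ ((S₁ + 1) * B.expE D T') :=
        pow_le_pow_right₀ hd1' (Nat.mul_le_mul (by omega) (B.expE_mono D hk))
    _ ≤ B.bigConst ^ ((S₁ + 1) * B.expE D T') := pow_le_pow_left₀ (abs_nonneg _) hd1 _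


omit [DecidableEq β] [DecidableEq δ] in
/-- **Envelope of the order loss** `k!·(kX+1)^k ≤ (G·W)^{2T'}` for `k ≤ T' ≤ W`. [folklore] -/
theorem orderLoss_le {T' k : ℕ} (hk : k ≤ T') {W : ℝ} (hW1 : 1 ≤ W) (hWT : (T' : ℝ) ≤ W) :
    (k.factorial : ℝ) * ((k : ℝ) * B.dirNorm + 1) ^ k ≤ (B.bigConst * W) ^ (2 * T') := by
  obtain ⟨hG2, -, -, -, -, -, -, -, -, -, hX, -⟩ := B.bigConst_spec
  have hX0 := B.dirNorm_nonneg
  have hG1 := B.one_le_bigConst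
  have hGW1 : 1 ≤ B.bigConst * W := one_le_mul_of_one_le_of_one_le hG1 hW1
  have hkW : (k : ℝ) ≤ W := le_trans (by exact_mod_cast hk) hWT
  -- `k! ≤ k^k ≤ W^k`
  have h1 : (k.factorial : ℝ) ≤ W ^ k := by
    calc (k.factorial : ℝ) ≤ ((k ^ k : ℕ) : ℝ) := by exact_mod_cast Nat.factorial_le_pow k
      _ = (k : ℝ) ^ k := by push_cast; ring
      _ ≤ W ^ k := pow_le_pow_left₀ (Nat.cast_nonneg _) hkW k
  -- `kX + 1 ≤ W·G`
  have h2 : (k : ℝ) * B.dirNorm + 1 ≤ B.bigConst * W := by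
    have : (k : ℝ) * B.dirNorm + 1 ≤ W * (B.dirNorm + 1) := by nlinarith
    calc (k : ℝ) * B.dirNorm + 1 ≤ W * (B.dirNorm + 1) := this
      _ ≤ W * B.bigConst := mul_le_mul_of_nonneg_left hX (by linarith)
      _ = B.bigConst * W := mul_comm _ _
  calc (k.factorial : ℝ) * ((k : ℝ) * B.dirNorm + 1) ^ k ≤ W ^ k * (B.bigConst * W) ^ k :=
        mul_le_mul h1 (pow_le_pow_left₀ (by positivity) h2 k) (by positivity) (by positivity)
    _ ≤ (B.bigConst * W) ^ k * (B.bigConst * W) ^ k := by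
        refine mul_le_mul_of_nonneg_right (pow_le_pow_left₀ (by linarith) ?_ k) (by positivity)
        nlinarith
    _ = (B.bigConst * W) ^ (2 * k) := by rw [← pow_add]; ring_nf
    _ ≤ (B.bigConst * W) ^ (2 * T') := pow_le_pow_right₀ hGW1 (by omega)


omit [DecidableEq β] [DecidableEq δ] in
/-- **Envelope of the growth factor**: with `R ≤ R'` (`R' ∈ ℕ`), `e^{C_Θ D (1 + (R‖v‖+1)²)} ≤ G^{D(1 + (R'+1)² G'²)}`
where `G ≤ G'` (`G' ∈ ℕ`). [folklore] -/
theorem growth_le (D : ℕ) {R : ℝ} (hR0 : 0 ≤ R) {R' G' : ℕ} (hR : R ≤ R') (hG' : B.bigConst ≤ G') :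
    Real.exp (thetaGrowthC (β := β) B.L B.cls B.κM * (1 + (R * ‖B.v‖ + 1) ^ 2)) ^ D ≤
      B.bigConst ^ (D * (1 + (R' + 1) ^ 2 * G' ^ 2)) := by
  obtain ⟨hG2, -, -, -, -, -, -, hexp, -, -, -, hv⟩ := B.bigConst_spec
  have hC0 := (thetaGrowthC_spec (β := β) B.L B.cls B.κM).1
  have hv0 : 0 ≤ ‖B.v‖ := norm_nonneg _
  have hin : R * ‖B.v‖ + 1 ≤ ((R' : ℝ) + 1) * B.bigConst := by
    have h1 : R * ‖B.v‖ + 1 ≤ (R + 1) * (‖B.v‖ + 1) := by nlinarith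
    calc R * ‖B.v‖ + 1 ≤ (R + 1) * (‖B.v‖ + 1) := h1
      _ ≤ ((R' : ℝ) + 1) * B.bigConst := mul_le_mul (by linarith) hv (by positivity) (by positivity)
  have hsq : (R * ‖B.v‖ + 1) ^ 2 ≤ (((R' : ℝ) + 1) * G') ^ 2 := by
    refine pow_le_pow_left₀ (by positivity) (hin.trans ?_) 2
    exact mul_le_mul_of_nonneg_left hG' (by positivity)
  have hy : 1 + (R * ‖B.v‖ + 1) ^ 2 ≤ ((1 + (R' + 1) ^ 2 * G' ^ 2 : ℕ) : ℝ) := by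
    push_cast; nlinarith
  rw [← Real.exp_nat_mul]
  rw [show (D : ℝ) * (thetaGrowthC (β := β) B.L B.cls B.κM * (1 + (R * ‖B.v‖ + 1) ^ 2)) =
      thetaGrowthC (β := β) B.L B.cls B.κM * ((D : ℝ) * (1 + (R * ‖B.v‖ + 1) ^ 2)) from by ring]
  refine B.exp_mul_le_bigConst_pow hexp hC0 ?_
  push_cast
  exact mul_le_mul_of_nonneg_left (by exact_mod_cast hy) (Nat.cast_nonneg D)


omit [DecidableEq β] [DecidableEq δ] in
/-- **Lower envelope of the right-hand side**: `G^{-D(2+s²)} ≤ (c_Θ e^{-C'_Θ(1+s²)})^D`. [folklore] -/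
theorem rhs_ge (D s : ℕ) :
    (B.bigConst ^ (D * (2 + s ^ 2)))⁻¹ ≤ (B.thetaLowc * Real.exp (-(B.thetaLowC * (1 + (s : ℝ) ^ 2)))) ^ D := by
  obtain ⟨hG2, -, -, -, -, -, -, -, hcinv, hCexp, -⟩ := B.bigConst_spec
  obtain ⟨hc0, hC'0, -⟩ := B.thetaLow_spec
  have hG1 := B.one_le_bigConst
  have hG0 : 0 < B.bigConst := by linarith
  -- `c_Θ ≥ 1/G` and `e^{-C'(1+s²)} ≥ G^{-(1+s²)}`
  have h1 : B.bigConst⁻¹ ≤ B.thetaLowc := by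
    rw [inv_le_comm₀ hG0 hc0]; exact hcinv
  have h2 : (B.bigConst ^ (1 + s ^ 2))⁻¹ ≤ Real.exp (-(B.thetaLowC * (1 + (s : ℝ) ^ 2))) := by
    rw [Real.exp_neg, inv_le_inv₀ (by positivity) (Real.exp_pos _)]
    calc Real.exp (B.thetaLowC * (1 + (s : ℝ) ^ 2)) = Real.exp B.thetaLowC ^ (1 + s ^ 2) := by
          rw [← Real.exp_nat_mul]; push_cast; ring_nf
      _ ≤ B.bigConst ^ (1 + s ^ 2) := pow_le_pow_left₀ (Real.exp_nonneg _) hCexp _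
  calc (B.bigConst ^ (D * (2 + s ^ 2)))⁻¹ = (B.bigConst⁻¹ * (B.bigConst ^ (1 + s ^ 2))⁻¹) ^ D := by
        rw [← mul_inv, ← pow_succ', inv_pow, ← pow_mul]
        congr 2; ring
    _ ≤ (B.thetaLowc * Real.exp (-(B.thetaLowC * (1 + (s : ℝ) ^ 2)))) ^ D :=
        pow_le_pow_left₀ (by positivity) (mul_le_mul h1 h2 (by positivity) hc0.le) D


/-- **Envelope of `lineValBound`**: for `s ≤ S₁`, `k ≤ T'`, under the Siegel house bound,
`Λ_{s,k} ≤ G^{2T' + 3 + D + (S₁+1)P₁} · W^{2T' + 3n + P₁} · A`, `P₁ = D·hdeg + 2T'`, `A = houseBound`.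
[folklore] -/
theorem lineValBound_le {D' T S₀ S₁ T' : ℕ} (ξ : UIdx β γ δ D' → 𝓞 B.K)
    (hξ : ∀ u, house ((ξ u : 𝓞 B.K) : B.K) ≤ B.siegelHouseBound D' T S₀) {W : ℝ} (hW1 : 1 ≤ W)
    (hWD : (D' : ℝ) + 1 ≤ W) (hqp : 2 * ((S₀ + 1) * T ^ B.dd) ≤ (D' + 1) ^ Fintype.card (β ⊕ (γ ⊕ δ)))
    (hp : 0 < (S₀ + 1) * T ^ B.dd) (hWT' : (T' : ℝ) ≤ W)
    (hWP : ((Fintype.card (β ⊕ (γ ⊕ δ)) * D' * B.hdeg : ℕ) : ℝ) + 2 * T' ≤ W) (hWS : (S₁ : ℝ) + 1 ≤ W)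
    {s k : ℕ} (hs : s ≤ S₁) (hk : k ≤ T') :
    B.lineValBound ξ s k ≤
      B.bigConst ^ (2 * T' + 3 + Fintype.card (β ⊕ (γ ⊕ δ)) * D' +
          (S₁ + 1) * (Fintype.card (β ⊕ (γ ⊕ δ)) * D' * B.hdeg + 2 * T')) *
        W ^ (2 * T' + 3 * Fintype.card (β ⊕ (γ ⊕ δ)) + (Fintype.card (β ⊕ (γ ⊕ δ)) * D' * B.hdeg + 2 * T')) *
        B.houseBound D' T S₀ := by
  obtain ⟨hG2, -, hM, hhB, hqB, hdd, -⟩ := B.bigConst_spec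
  have hG1 := B.one_le_bigConst
  have hG0 : (0 : ℝ) ≤ B.bigConst := by linarith
  have hW0 : (0 : ℝ) ≤ W := by linarith
  set n := Fintype.card (β ⊕ (γ ⊕ δ)) with hn
  set D := n * D' with hD
  set P₁ := D * B.hdeg + 2 * T' with hP₁
  have hA1 := B.one_le_houseBound D' T S₀
  have hHξ := B.houseXi_le ξ hξ hW1 hWD hqp hp
  rw [← hn] at hHξ
  have hkW : (k : ℝ) ≤ W := le_trans (by exact_mod_cast hk) hWT'
  have hU : (Fintype.card (UIdx β γ δ D') : ℝ) ≤ W ^ n := by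
    rw [card_UIdx]; push_cast; exact pow_le_pow_left₀ (by positivity) hWD n
  -- the factors
  have f1 : (B.dd : ℝ) ^ k ≤ B.bigConst ^ T' :=
    (pow_le_pow_left₀ (Nat.cast_nonneg _) (by linarith : (B.dd : ℝ) ≤ B.bigConst) k).trans
      (pow_le_pow_right₀ hG1 hk)
  have f2 : (k : ℝ) ^ k ≤ W ^ T' := (pow_le_pow_left₀ (Nat.cast_nonneg _) hkW k).trans (pow_le_pow_right₀ hW1 hk)
  have f5 : (((D * B.hdeg : ℕ) : ℝ) + 2 * k) ^ k ≤ W ^ T' := by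
    have : ((D * B.hdeg : ℕ) : ℝ) + 2 * k ≤ W := by
      have : (k : ℝ) ≤ T' := by exact_mod_cast hk
      rw [hD]; linarith
    exact (pow_le_pow_left₀ (by positivity) this k).trans (pow_le_pow_right₀ hW1 hk)
  have f6 : B.qB ^ k ≤ B.bigConst ^ T' :=
    ((pow_le_pow_left₀ B.qB_nonneg ((le_max_right 1 B.qB).trans hqB) k)).trans (pow_le_pow_right₀ hG1 hk)
  have f7 : B.hB ^ D ≤ B.bigConst ^ D := pow_le_pow_left₀ (zero_le_one.trans B.one_le_hB) hhB _
  have hsM1 : (1 : ℝ) ≤ ((s : ℝ) + 1) * B.M ^ (s + 1) :=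
    one_le_mul_of_one_le_of_one_le (by have : (0:ℝ) ≤ s := Nat.cast_nonneg s; linarith) (one_le_pow₀ B.gens.one_le_M)
  have hM0 : (0 : ℝ) ≤ B.M := zero_le_one.trans B.gens.one_le_M
  have hsM : ((s : ℝ) + 1) * B.M ^ (s + 1) ≤ W * B.bigConst ^ (S₁ + 1) := by
    have hsS : (s : ℝ) ≤ S₁ := by exact_mod_cast hs
    have h1 : (s : ℝ) + 1 ≤ W := by linarith
    have h2 : B.M ^ (s + 1) ≤ B.bigConst ^ (S₁ + 1) :=
      (pow_le_pow_left₀ hM0 hM _).trans (pow_le_pow_right₀ hG1 (by omega))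
    exact mul_le_mul h1 h2 (pow_nonneg hM0 _) hW0
  have hsM0 : (0 : ℝ) ≤ ((s : ℝ) + 1) * B.M ^ (s + 1) := mul_nonneg (by positivity) (pow_nonneg hM0 _)
  have f8 : (((s : ℝ) + 1) * B.M ^ (s + 1)) ^ (D * B.hdeg + 2 * k) ≤ (W * B.bigConst ^ (S₁ + 1)) ^ P₁ :=
    (pow_le_pow_left₀ hsM0 hsM _).trans (pow_le_pow_right₀ (by
      calc (1 : ℝ) ≤ ((s : ℝ) + 1) * B.M ^ (s + 1) := hsM1
        _ ≤ W * B.bigConst ^ (S₁ + 1) := hsM) (by rw [hP₁]; omega))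
  -- nonnegativity
  have n1 : (0 : ℝ) ≤ (B.dd : ℝ) ^ k := by positivity
  have n2 : (0 : ℝ) ≤ (k : ℝ) ^ k := by positivity
  have n3 : (0 : ℝ) ≤ (Fintype.card (UIdx β γ δ D') : ℝ) := Nat.cast_nonneg _
  have n4 : (0 : ℝ) ≤ B.houseXi ξ := zero_le_one.trans (B.one_le_houseXi ξ)
  have n5 : (0 : ℝ) ≤ (((D * B.hdeg : ℕ) : ℝ) + 2 * k) ^ k := by positivity
  have n6 : (0 : ℝ) ≤ B.qB ^ k := pow_nonneg B.qB_nonneg _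
  have n7 : (0 : ℝ) ≤ B.hB ^ D := pow_nonneg (zero_le_one.trans B.one_le_hB) _
  have n8 : (0 : ℝ) ≤ (((s : ℝ) + 1) * B.M ^ (s + 1)) ^ (D * B.hdeg + 2 * k) := pow_nonneg hsM0 _
  unfold lineValBound
  rw [← hn, ← hD]
  calc (B.dd : ℝ) ^ k * (k : ℝ) ^ k * (Fintype.card (UIdx β γ δ D') : ℝ) * B.houseXi ξ *
        ((((D * B.hdeg : ℕ) : ℝ) + 2 * k) ^ k * B.qB ^ k * B.hB ^ D *
          (((s : ℝ) + 1) * B.M ^ (s + 1)) ^ (D * B.hdeg + 2 * k))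
      ≤ B.bigConst ^ T' * W ^ T' * W ^ n * (B.bigConst ^ 3 * W ^ (2 * n) * B.houseBound D' T S₀) *
          (W ^ T' * B.bigConst ^ T' * B.bigConst ^ D * (W * B.bigConst ^ (S₁ + 1)) ^ P₁) := by
        refine mul_le_mul (mul_le_mul (mul_le_mul (mul_le_mul f1 f2 n2 (by positivity)) hU n3 (by positivity))
          hHξ n4 (by positivity)) (mul_le_mul (mul_le_mul (mul_le_mul f5 f6 n6 (by positivity)) f7 n7
          (by positivity)) f8 n8 (by positivity)) (by positivity) (by positivity)
    _ = B.bigConst ^ (2 * T' + 3 + D + (S₁ + 1) * P₁) * W ^ (2 * T' + 3 * n + P₁) * B.houseBound D' T S₀ := by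
        rw [mul_pow, ← pow_mul]; ring


omit [DecidableEq β] [DecidableEq δ] in
/-- **The saving factor**: if `2(S₁ + S₀)/R ≤ θ ≤ 1` then for `s ≤ S₁`, `k ≤ T'`,
`(2(s+S₀)/R)^{(T-k)(S₀+1)} ≤ θ^{(T-T')(S₀+1)}`. [folklore] -/
theorem saving_le {S₀ S₁ T T' : ℕ} {R θ : ℝ} (hR : 0 < R) (hθ : 2 * ((S₁ : ℝ) + S₀) / R ≤ θ) (hθ1 : θ ≤ 1)
    {s k : ℕ} (hs : s ≤ S₁) (hk : k ≤ T') :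
    (2 * ((s : ℝ) + S₀) / R) ^ ((T - k) * (S₀ + 1)) ≤ θ ^ ((T - T') * (S₀ + 1)) := by
  have hb0 : 0 ≤ 2 * ((s : ℝ) + S₀) / R := by positivity
  have hb : 2 * ((s : ℝ) + S₀) / R ≤ θ := by
    refine le_trans (div_le_div_of_nonneg_right ?_ hR.le) hθ
    have : (s : ℝ) ≤ S₁ := by exact_mod_cast hs
    linarith
  have hθ0 : 0 ≤ θ := hb0.trans hb
  calc (2 * ((s : ℝ) + S₀) / R) ^ ((T - k) * (S₀ + 1)) ≤ θ ^ ((T - k) * (S₀ + 1)) := pow_le_pow_left₀ hb0 hb _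
    _ ≤ θ ^ ((T - T') * (S₀ + 1)) := pow_le_pow_of_le_one hθ0 hθ1 (Nat.mul_le_mul_right _ (by omega))


/-- **`NumCond₂` holds along the family** (for `σ` beyond explicit thresholds), for every
coefficient vector within the Siegel house bound. Hypotheses: `n ≥ 1`, `dd < n`,
`a·dd + 2b + 2n + 4 ≤ a·n`, `b ≥ b₀(h, n, ℓ, hdeg, dd)`, a natural `G' ≥ G` and `σ ≥ G'`, and the
thresholds of `NumCondExponents.exponent_ineq` and `GaGmE.Std.BakerData.Family.sizes_le_W`.
[cite: BakerWustholz2007, §6.8 (p. 119)] -/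
theorem numCond₂_family (F : GaGmE.Std.BakerData.Family) {n : ℕ} (hn' : Fintype.card (β ⊕ (γ ⊕ δ)) = n) (hn : 1 ≤ n)
    (ha : F.a * B.dd + 2 * F.b + 2 * n + 4 ≤ F.a * n)
    (hb : GaGmE.Std.BakerData.Family.b₀ F n B.dd B.gens.h B.hdeg ≤ F.b)
    {G' : ℕ} (hG' : B.bigConst ≤ G') {σ : ℕ} (hσG : G' ≤ σ)
    (hσ1 : GaGmE.Std.BakerData.Family.κD n B.dd * (1 + (2 * (n * F.ℓ) + 3) ^ 2 * G' ^ 2) ≤ σ)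
    (hσ2 : GaGmE.Std.BakerData.Family.κD n B.dd * (2 + (n * F.ℓ) ^ 2) ≤ σ)
    (hσ3 : (F.a * n + 1) * (4 * n + 3 * n + B.gens.h * (4 * n + 3 * n + B.hdeg * GaGmE.Std.BakerData.Family.κD n B.dd + 4 * n) +
        B.gens.h * (4 * n + B.hdeg * GaGmE.Std.BakerData.Family.κD n B.dd + 8 * n)) ≤ σ)
    (hσW : B.hdeg * GaGmE.Std.BakerData.Family.κD n B.dd + 8 * n + n * F.ℓ + GaGmE.Std.BakerData.Family.κD n B.dd + 3 ≤ σ)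
    {ξ : UIdx β γ δ (F.D' n B.dd σ) → 𝓞 B.K}
    (hξ : ∀ u, house ((ξ u : 𝓞 B.K) : B.K) ≤ B.siegelHouseBound (F.D' n B.dd σ) (F.T n σ) (GaGmE.Std.BakerData.Family.S₀ n σ)) :
    B.NumCond₂ ξ (F.T n σ) (GaGmE.Std.BakerData.Family.S₀ n σ) (F.S₁ n σ) (F.T' n σ) (F.R n σ) := by
  -- basic facts about `σ`
  have hG2 := B.bigConst_spec.1
  have hG1 := B.one_le_bigConst
  have hGσ : B.bigConst ≤ (σ : ℝ) := hG'.trans (by exact_mod_cast hσG)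
  have hσr2 : (2 : ℝ) ≤ σ := by linarith
  have hσone : 1 ≤ σ := by
    have : (1 : ℝ) ≤ σ := by linarith
    exact_mod_cast this
  have hσr1 : (1 : ℝ) < σ := by linarith
  have hexp : 1 + F.a * B.dd ≤ F.a * n := by omega
  have ha1 : 1 ≤ F.a := by
    by_contra h0
    have : F.a = 0 := by omega
    rw [this] at ha; omega
  have h1 : 1 ≤ B.gens.h := B.gens.one_le_h
  -- the sizes and `W`
  have hW1 : (1 : ℝ) ≤ (σ : ℝ) ^ (F.a * n + 1) := one_le_pow₀ (by linarith)
  obtain ⟨sD, sT', sS₁, sS₀, sT, sP⟩ := F.sizes_le_W hn B.hdeg hσone hexp ha1 hσW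
  have castW : ∀ {m : ℕ}, m ≤ σ ^ (F.a * n + 1) → (m : ℝ) ≤ (σ : ℝ) ^ (F.a * n + 1) := fun hm => by
    exact_mod_cast hm
  have hWD : (F.D' n B.dd σ : ℝ) + 1 ≤ (σ : ℝ) ^ (F.a * n + 1) := by have := castW sD; push_cast at this; exact this
  have hWT' : (F.T' n σ : ℝ) ≤ (σ : ℝ) ^ (F.a * n + 1) := castW sT'
  have hWS₁ : (F.S₁ n σ : ℝ) + 1 ≤ (σ : ℝ) ^ (F.a * n + 1) := by have := castW sS₁; push_cast at this; exact this
  have hWS₀ : (GaGmE.Std.BakerData.Family.S₀ n σ : ℝ) + 1 ≤ (σ : ℝ) ^ (F.a * n + 1) := by have := castW sS₀; push_cast at this; exact this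
  have hWT : ((Fintype.card (β ⊕ (γ ⊕ δ)) * F.D' n B.dd σ * B.hdeg : ℕ) : ℝ) + 2 * (F.T n σ) + 1 ≤
      (σ : ℝ) ^ (F.a * n + 1) := by
    rw [hn']; have := castW sT; push_cast at this ⊢; linarith
  have hWP : ((Fintype.card (β ⊕ (γ ⊕ δ)) * F.D' n B.dd σ * B.hdeg : ℕ) : ℝ) + 2 * (F.T' n σ) ≤
      (σ : ℝ) ^ (F.a * n + 1) := by
    rw [hn']; have := castW sP; push_cast at this ⊢; linarith
  have hqp : 2 * ((GaGmE.Std.BakerData.Family.S₀ n σ + 1) * F.T n σ ^ B.dd) ≤ (F.D' n B.dd σ + 1) ^ Fintype.card (β ⊕ (γ ⊕ δ)) := by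
    rw [hn']; exact F.two_p_le_q hn hσone
  have hp : 0 < (GaGmE.Std.BakerData.Family.S₀ n σ + 1) * F.T n σ ^ B.dd := Nat.mul_pos (Nat.succ_pos _) (pow_pos (F.T_pos n hn hσone) _)
  -- `R`, `θ`
  obtain ⟨hR0, hR2⟩ := F.R_bounds n hn hσone
  have hRR' := F.R_le_R' (n := n) hσone
  have hθ1 : ((σ : ℝ) ^ F.b)⁻¹ ≤ 1 := inv_le_one_of_one_le₀ (one_le_pow₀ (by linarith))
  have hθeq : 2 * ((F.S₁ n σ : ℝ) + GaGmE.Std.BakerData.Family.S₀ n σ) / F.R n σ ≤ ((σ : ℝ) ^ F.b)⁻¹ := by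
    have hRdef : F.R n σ = (σ : ℝ) ^ F.b * (2 * ((F.S₁ n σ : ℝ) + GaGmE.Std.BakerData.Family.S₀ n σ)) := by
      unfold GaGmE.Std.BakerData.Family.R GaGmE.Std.BakerData.Family.S₁; push_cast; ring
    have hsum : (0 : ℝ) < 2 * ((F.S₁ n σ : ℝ) + GaGmE.Std.BakerData.Family.S₀ n σ) := by
      rw [hRdef] at hR0
      have hb : (0 : ℝ) < (σ : ℝ) ^ F.b := by positivity
      exact (pos_iff_pos_of_mul_pos hR0).mp hb
    rw [hRdef, div_le_iff₀ (by positivity)]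
    rw [show ((σ : ℝ) ^ F.b)⁻¹ * ((σ : ℝ) ^ F.b * (2 * ((F.S₁ n σ : ℝ) + GaGmE.Std.BakerData.Family.S₀ n σ))) =
      2 * ((F.S₁ n σ : ℝ) + GaGmE.Std.BakerData.Family.S₀ n σ) from by field_simp]
  intro s hs k hk
  have hk' : k ≤ F.T' n σ := hk.le
  -- the envelopes
  have e1 := B.orderLoss_le hk' hW1 hWT'
  have eU : (Fintype.card (UIdx β γ δ (F.D' n B.dd σ)) : ℝ) ≤ ((σ : ℝ) ^ (F.a * n + 1)) ^ n := by
    rw [card_UIdx, hn']; push_cast; exact pow_le_pow_left₀ (by positivity) hWD n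
  have e3 := B.houseXi_le ξ hξ hW1 hWD hqp hp
  have eA := B.houseBound_le (F.D' n B.dd σ) (F.T n σ) (GaGmE.Std.BakerData.Family.S₀ n σ) hW1 hWT hWS₀
  have e4 := B.growth_le (Fintype.card (β ⊕ (γ ⊕ δ)) * F.D' n B.dd σ) hR0.le hRR' hG'
  have e5 := saving_le (T := F.T n σ) hR0 hθeq hθ1 hs hk'
  have e6 := B.dAt_pow_le (D := Fintype.card (β ⊕ (γ ⊕ δ)) * F.D' n B.dd σ) hs hk'
  have e7 := B.lineValBound_le ξ hξ hW1 hWD hqp hp hWT' hWP hWS₁ hs hk'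
  -- rename `card` to `n` in the envelopes and in the goal
  rw [hn'] at e3 eA e4 e6 e7
  rw [hn']
  -- notation for the real quantities
  have hG0 : (0 : ℝ) ≤ B.bigConst := by linarith
  have hσ0 : (0 : ℝ) ≤ σ := by linarith
  have hWr0 : (0 : ℝ) ≤ (σ : ℝ) ^ (F.a * n + 1) := by positivity
  have hθ0 : (0 : ℝ) ≤ ((σ : ℝ) ^ F.b)⁻¹ := by positivity
  have hA1 := B.one_le_houseBound (F.D' n B.dd σ) (F.T n σ) (GaGmE.Std.BakerData.Family.S₀ n σ)
  have hA0 : (0 : ℝ) ≤ B.houseBound (F.D' n B.dd σ) (F.T n σ) (GaGmE.Std.BakerData.Family.S₀ n σ) := zero_le_one.trans hA1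
  -- identify the exponents with the `GaGmE.Std.BakerData.Family` names
  have iET : B.expE (n * F.D' n B.dd σ) (F.T n σ) = F.ET n B.dd B.hdeg σ := rfl
  have iE' : B.expE (n * F.D' n B.dd σ) (F.T' n σ) = F.E' n B.dd B.hdeg σ := rfl
  rw [iET] at eA
  rw [iE'] at e6
  -- substitute the house bound into `e3`, `e7`
  set EA : ℝ := B.bigConst ^ ((GaGmE.Std.BakerData.Family.S₀ n σ + 1) * F.ET n B.dd B.hdeg σ + 2 * F.T n σ + n * F.D' n B.dd σ +
      (GaGmE.Std.BakerData.Family.S₀ n σ + 1) * (n * F.D' n B.dd σ * B.hdeg + 2 * F.T n σ)) *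
    ((σ : ℝ) ^ (F.a * n + 1)) ^ (F.T n σ + (n * F.D' n B.dd σ * B.hdeg + 2 * F.T n σ)) with hEA
  have hEA0 : 0 ≤ EA := by rw [hEA]; positivity
  have e3' : B.houseXi ξ ≤ B.bigConst ^ 3 * ((σ : ℝ) ^ (F.a * n + 1)) ^ (2 * n) * EA :=
    e3.trans (mul_le_mul_of_nonneg_left eA (by positivity))
  have e7' : B.lineValBound ξ s k ≤
      B.bigConst ^ (2 * F.T' n σ + 3 + n * F.D' n B.dd σ + (F.S₁ n σ + 1) * (n * F.D' n B.dd σ * B.hdeg + 2 * F.T' n σ)) *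
        ((σ : ℝ) ^ (F.a * n + 1)) ^ (2 * F.T' n σ + 3 * n + (n * F.D' n B.dd σ * B.hdeg + 2 * F.T' n σ)) * EA :=
    e7.trans (mul_le_mul_of_nonneg_left eA (by positivity))
  -- nonnegativity of the true factors
  have n1 : (0 : ℝ) ≤ (k.factorial : ℝ) * ((k : ℝ) * B.dirNorm + 1) ^ k := by
    have := B.dirNorm_nonneg; positivity
  have nU : (0 : ℝ) ≤ (Fintype.card (UIdx β γ δ (F.D' n B.dd σ)) : ℝ) := Nat.cast_nonneg _
  have nH : (0 : ℝ) ≤ B.houseXi ξ := zero_le_one.trans (B.one_le_houseXi ξ)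
  have nG : (0 : ℝ) ≤ Real.exp (thetaGrowthC (β := β) B.L B.cls B.κM * (1 + (F.R n σ * ‖B.v‖ + 1) ^ 2)) ^ (n * F.D' n B.dd σ) :=
    pow_nonneg (Real.exp_nonneg _) _
  have nS : (0 : ℝ) ≤ (2 * ((s : ℝ) + GaGmE.Std.BakerData.Family.S₀ n σ) / F.R n σ) ^ ((F.T n σ - k) * (GaGmE.Std.BakerData.Family.S₀ n σ + 1)) := by
    positivity
  have nD : (0 : ℝ) ≤ |(B.dAt s : ℝ)| ^ B.expE (n * F.D' n B.dd σ) k := by positivity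
  have nL : (0 : ℝ) ≤ B.lineValBound ξ s k := B.lineValBound_nonneg ξ s k
  -- block 2: `#U · H_ξ · growth`
  have b2 : (Fintype.card (UIdx β γ δ (F.D' n B.dd σ)) : ℝ) * B.houseXi ξ *
        Real.exp (thetaGrowthC (β := β) B.L B.cls B.κM * (1 + (F.R n σ * ‖B.v‖ + 1) ^ 2)) ^ (n * F.D' n B.dd σ) ≤
      ((σ : ℝ) ^ (F.a * n + 1)) ^ n * (B.bigConst ^ 3 * ((σ : ℝ) ^ (F.a * n + 1)) ^ (2 * n) * EA) *
        B.bigConst ^ (n * F.D' n B.dd σ * (1 + (F.R' n σ + 1) ^ 2 * G' ^ 2)) :=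
    mul_le_mul (mul_le_mul eU e3' nH (by positivity)) e4 nG (by positivity)
  -- block 4: the Liouville factors
  have b4 : |(B.dAt s : ℝ)| ^ B.expE (n * F.D' n B.dd σ) k *
        (|(B.dAt s : ℝ)| ^ B.expE (n * F.D' n B.dd σ) k * B.lineValBound ξ s k) ^ (B.gens.h - 1) ≤
      B.bigConst ^ ((F.S₁ n σ + 1) * F.E' n B.dd B.hdeg σ) *
        (B.bigConst ^ ((F.S₁ n σ + 1) * F.E' n B.dd B.hdeg σ) *
          (B.bigConst ^ (2 * F.T' n σ + 3 + n * F.D' n B.dd σ + (F.S₁ n σ + 1) * (n * F.D' n B.dd σ * B.hdeg + 2 * F.T' n σ)) *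
            ((σ : ℝ) ^ (F.a * n + 1)) ^ (2 * F.T' n σ + 3 * n + (n * F.D' n B.dd σ * B.hdeg + 2 * F.T' n σ)) * EA)) ^
        (B.gens.h - 1) :=
    mul_le_mul e6 (pow_le_pow_left₀ (by positivity) (mul_le_mul e6 e7' nL (by positivity)) _) (by positivity)
      (by positivity)
  -- the whole left-hand side
  have hLHS := mul_le_mul (mul_le_mul (mul_le_mul e1 b2 (by positivity) (by positivity)) e5 nS (by positivity))
    b4 (by positivity) (by positivity)
  refine lt_of_le_of_lt hLHS ?_
  -- collect the exponents
  obtain ⟨h₁, hh₁⟩ : ∃ h₁, B.gens.h = h₁ + 1 := ⟨B.gens.h - 1, by omega⟩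
  have hX := F.exponent_ineq (n := n) (dd := B.dd) (h := B.gens.h) (hdeg := B.hdeg) (G' := G') hn ha hb hσone hσ1 hσ2 hσ3
  have key : B.bigConst ^ (F.X₁ n B.dd B.gens.h B.hdeg G' σ) * ((σ : ℝ) ^ (F.a * n + 1)) ^ (F.X₂ n B.dd B.gens.h B.hdeg σ) *
      (((σ : ℝ) ^ F.b)⁻¹) ^ (F.Msave n σ) <
      (B.thetaLowc * Real.exp (-(B.thetaLowC * (1 + (s : ℝ) ^ 2)))) ^ (n * F.D' n B.dd σ) := by
    -- right-hand side from below
    have hY : n * F.D' n B.dd σ * (2 + s ^ 2) ≤ F.Y n B.dd σ := by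
      unfold GaGmE.Std.BakerData.Family.Y GaGmE.Std.BakerData.Family.Dn
      exact Nat.mul_le_mul_left _ (Nat.add_le_add_left (Nat.pow_le_pow_left hs 2) 2)
    have hR := B.rhs_ge (n * F.D' n B.dd σ) s
    have hR' : ((σ : ℝ) ^ F.Y n B.dd σ)⁻¹ ≤ (B.thetaLowc * Real.exp (-(B.thetaLowC * (1 + (s : ℝ) ^ 2)))) ^ (n * F.D' n B.dd σ) := by
      refine le_trans ?_ hR
      rw [inv_le_inv₀ (by positivity) (by positivity)]
      calc B.bigConst ^ (n * F.D' n B.dd σ * (2 + s ^ 2)) ≤ (σ : ℝ) ^ (n * F.D' n B.dd σ * (2 + s ^ 2)) :=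
            pow_le_pow_left₀ hG0 hGσ _
        _ ≤ (σ : ℝ) ^ F.Y n B.dd σ := pow_le_pow_right₀ hσr1.le hY
    refine lt_of_lt_of_le ?_ hR'
    -- left-hand side from above, as a single power of `σ`
    have hGX : B.bigConst ^ (F.X₁ n B.dd B.gens.h B.hdeg G' σ) ≤ (σ : ℝ) ^ (F.X₁ n B.dd B.gens.h B.hdeg G' σ) :=
      pow_le_pow_left₀ hG0 hGσ _
    have hpos : (0 : ℝ) < (σ : ℝ) ^ (F.b * F.Msave n σ) := by positivity
    have hposY : (0 : ℝ) < (σ : ℝ) ^ F.Y n B.dd σ := by positivity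
    calc B.bigConst ^ (F.X₁ n B.dd B.gens.h B.hdeg G' σ) * ((σ : ℝ) ^ (F.a * n + 1)) ^ (F.X₂ n B.dd B.gens.h B.hdeg σ) *
          (((σ : ℝ) ^ F.b)⁻¹) ^ (F.Msave n σ)
        ≤ (σ : ℝ) ^ (F.X₁ n B.dd B.gens.h B.hdeg G' σ) * ((σ : ℝ) ^ (F.a * n + 1)) ^ (F.X₂ n B.dd B.gens.h B.hdeg σ) *
          (((σ : ℝ) ^ F.b)⁻¹) ^ (F.Msave n σ) :=
          mul_le_mul_of_nonneg_right (mul_le_mul_of_nonneg_right hGX (by positivity)) (by positivity)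
      _ = (σ : ℝ) ^ (F.X₁ n B.dd B.gens.h B.hdeg G' σ + (F.a * n + 1) * F.X₂ n B.dd B.gens.h B.hdeg σ) *
          ((σ : ℝ) ^ (F.b * F.Msave n σ))⁻¹ := by
          rw [inv_pow, ← pow_mul, ← pow_mul, pow_add]
      _ < ((σ : ℝ) ^ F.Y n B.dd σ)⁻¹ := by
          have hmain : (σ : ℝ) ^ (F.X₁ n B.dd B.gens.h B.hdeg G' σ + (F.a * n + 1) * F.X₂ n B.dd B.gens.h B.hdeg σ) *
              (σ : ℝ) ^ F.Y n B.dd σ < (σ : ℝ) ^ (F.b * F.Msave n σ) := by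
            rw [← pow_add]; exact pow_lt_pow_right₀ hσr1 hX
          rw [inv_eq_one_div ((σ : ℝ) ^ F.Y n B.dd σ), lt_div_iff₀ hposY, mul_assoc,
            mul_comm (((σ : ℝ) ^ (F.b * F.Msave n σ))⁻¹), ← mul_assoc, ← div_eq_mul_inv, div_lt_one hpos]
          exact hmain
  refine lt_of_eq_of_lt ?_ key
  rw [hEA]
  unfold GaGmE.Std.BakerData.Family.X₁ GaGmE.Std.BakerData.Family.X₂ GaGmE.Std.BakerData.Family.Msave GaGmE.Std.BakerData.Family.NA₁ GaGmE.Std.BakerData.Family.NA₂ GaGmE.Std.BakerData.Family.L₁ GaGmE.Std.BakerData.Family.L₂ GaGmE.Std.BakerData.Family.P₁ GaGmE.Std.BakerData.Family.Dn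
  rw [hh₁, Nat.add_sub_cancel]
  ring




/-- **`AdmissibleParams B dd c` holds for every Baker datum with `dd < n` and every `c > 0`.**
The parameters are those of the family with `ℓ = ⌈c κ^n dd!⌉ + 1`, `b = b₀`, `a = 2b + 3n + 5`,
`σ` the sum of all thresholds. [cite: BakerWustholz2007, §6.8 (p. 119)] -/
theorem admissibleParams_of_lt (hdd : B.dd < Fintype.card (β ⊕ (γ ⊕ δ))) {c : ℝ} (hc : 0 < c) :
    AdmissibleParams B B.dd c := by
  classical
  -- `n ≥ 1`
  have hn : 1 ≤ Fintype.card (β ⊕ (γ ⊕ δ)) := by omega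
  -- the family
  set κ : ℝ := ((Fintype.card (β ⊕ (γ ⊕ δ)) * (2 * (4 * Fintype.card (β ⊕ (γ ⊕ δ))) ^ B.dd) : ℕ) : ℝ) with hκ
  set ℓ : ℕ := ⌈c * κ ^ Fintype.card (β ⊕ (γ ⊕ δ)) * (B.dd.factorial : ℝ)⌉₊ + 1 with hℓ
  have hℓ1 : 1 ≤ ℓ := by omega
  set F₀ : GaGmE.Std.BakerData.Family := ⟨0, 0, ℓ, hℓ1⟩ with hF₀
  set b : ℕ := GaGmE.Std.BakerData.Family.b₀ F₀ (Fintype.card (β ⊕ (γ ⊕ δ))) B.dd B.gens.h B.hdeg with hb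
  set a : ℕ := 2 * b + 3 * Fintype.card (β ⊕ (γ ⊕ δ)) + 5 with ha
  set F : GaGmE.Std.BakerData.Family := ⟨a, b, ℓ, hℓ1⟩ with hF
  have hb₀ : GaGmE.Std.BakerData.Family.b₀ F (Fintype.card (β ⊕ (γ ⊕ δ))) B.dd B.gens.h B.hdeg ≤ F.b := le_of_eq rfl
  have haF : F.a * B.dd + 2 * F.b + 2 * Fintype.card (β ⊕ (γ ⊕ δ)) + 4 ≤ F.a * Fintype.card (β ⊕ (γ ⊕ δ)) := by
    show a * B.dd + 2 * b + 2 * Fintype.card (β ⊕ (γ ⊕ δ)) + 4 ≤ a * Fintype.card (β ⊕ (γ ⊕ δ))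
    have h1 : a * (B.dd + 1) ≤ a * Fintype.card (β ⊕ (γ ⊕ δ)) := Nat.mul_le_mul_left a hdd
    have h2 : 2 * b + 2 * Fintype.card (β ⊕ (γ ⊕ δ)) + 4 ≤ a := by rw [ha]; omega
    nlinarith [h1, h2]
  have han : Fintype.card (β ⊕ (γ ⊕ δ)) < F.a := by show _ < a; rw [ha]; omega
  -- thresholds
  set G' : ℕ := ⌈B.bigConst⌉₊ with hG'
  have hGG' : B.bigConst ≤ G' := Nat.le_ceil _
  set K₀ : ℕ := ⌈c * κ ^ Fintype.card (β ⊕ (γ ⊕ δ)) * ((Fintype.card (β ⊕ (γ ⊕ δ))).factorial : ℝ)⌉₊ + 1 with hK₀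
  set σ : ℕ := G' + GaGmE.Std.BakerData.Family.κD (Fintype.card (β ⊕ (γ ⊕ δ))) B.dd *
      (1 + (2 * (Fintype.card (β ⊕ (γ ⊕ δ)) * F.ℓ) + 3) ^ 2 * G' ^ 2) +
    GaGmE.Std.BakerData.Family.κD (Fintype.card (β ⊕ (γ ⊕ δ))) B.dd * (2 + (Fintype.card (β ⊕ (γ ⊕ δ)) * F.ℓ) ^ 2) +
    (F.a * Fintype.card (β ⊕ (γ ⊕ δ)) + 1) * (4 * Fintype.card (β ⊕ (γ ⊕ δ)) + 3 * Fintype.card (β ⊕ (γ ⊕ δ)) +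
      B.gens.h * (4 * Fintype.card (β ⊕ (γ ⊕ δ)) + 3 * Fintype.card (β ⊕ (γ ⊕ δ)) +
        B.hdeg * GaGmE.Std.BakerData.Family.κD (Fintype.card (β ⊕ (γ ⊕ δ))) B.dd + 4 * Fintype.card (β ⊕ (γ ⊕ δ))) +
      B.gens.h * (4 * Fintype.card (β ⊕ (γ ⊕ δ)) + B.hdeg * GaGmE.Std.BakerData.Family.κD (Fintype.card (β ⊕ (γ ⊕ δ))) B.dd +
        8 * Fintype.card (β ⊕ (γ ⊕ δ)))) +
    (B.hdeg * GaGmE.Std.BakerData.Family.κD (Fintype.card (β ⊕ (γ ⊕ δ))) B.dd + 8 * Fintype.card (β ⊕ (γ ⊕ δ)) +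
      Fintype.card (β ⊕ (γ ⊕ δ)) * F.ℓ + GaGmE.Std.BakerData.Family.κD (Fintype.card (β ⊕ (γ ⊕ δ))) B.dd + 3) + K₀ with hσ
  have hσG : G' ≤ σ := by rw [hσ]; omega
  have hσ1 : GaGmE.Std.BakerData.Family.κD (Fintype.card (β ⊕ (γ ⊕ δ))) B.dd *
      (1 + (2 * (Fintype.card (β ⊕ (γ ⊕ δ)) * F.ℓ) + 3) ^ 2 * G' ^ 2) ≤ σ := by rw [hσ]; omega
  have hσ2 : GaGmE.Std.BakerData.Family.κD (Fintype.card (β ⊕ (γ ⊕ δ))) B.dd * (2 + (Fintype.card (β ⊕ (γ ⊕ δ)) * F.ℓ) ^ 2) ≤ σ := by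
    rw [hσ]; omega
  have hσ3 : (F.a * Fintype.card (β ⊕ (γ ⊕ δ)) + 1) * (4 * Fintype.card (β ⊕ (γ ⊕ δ)) + 3 * Fintype.card (β ⊕ (γ ⊕ δ)) +
      B.gens.h * (4 * Fintype.card (β ⊕ (γ ⊕ δ)) + 3 * Fintype.card (β ⊕ (γ ⊕ δ)) +
        B.hdeg * GaGmE.Std.BakerData.Family.κD (Fintype.card (β ⊕ (γ ⊕ δ))) B.dd + 4 * Fintype.card (β ⊕ (γ ⊕ δ))) +
      B.gens.h * (4 * Fintype.card (β ⊕ (γ ⊕ δ)) + B.hdeg * GaGmE.Std.BakerData.Family.κD (Fintype.card (β ⊕ (γ ⊕ δ))) B.dd +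
        8 * Fintype.card (β ⊕ (γ ⊕ δ)))) ≤ σ := by rw [hσ]; omega
  have hσW : B.hdeg * GaGmE.Std.BakerData.Family.κD (Fintype.card (β ⊕ (γ ⊕ δ))) B.dd + 8 * Fintype.card (β ⊕ (γ ⊕ δ)) +
      Fintype.card (β ⊕ (γ ⊕ δ)) * F.ℓ + GaGmE.Std.BakerData.Family.κD (Fintype.card (β ⊕ (γ ⊕ δ))) B.dd + 3 ≤ σ := by rw [hσ]; omega
  have hσK₀ : K₀ ≤ σ := by rw [hσ]; omega
  have hσone : 1 ≤ σ := le_trans (by rw [hK₀]; omega) hσK₀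
  have hσK : c * κ ^ Fintype.card (β ⊕ (γ ⊕ δ)) * ((Fintype.card (β ⊕ (γ ⊕ δ))).factorial : ℝ) < σ := by
    have h1 := Nat.le_ceil (c * κ ^ Fintype.card (β ⊕ (γ ⊕ δ)) * ((Fintype.card (β ⊕ (γ ⊕ δ))).factorial : ℝ))
    have h2 : (K₀ : ℝ) ≤ σ := by exact_mod_cast hσK₀
    rw [hK₀] at h2; push_cast at h2; linarith
  have hℓc : c * κ ^ Fintype.card (β ⊕ (γ ⊕ δ)) * (B.dd.factorial : ℝ) < F.ℓ := by
    show _ < ((ℓ : ℕ) : ℝ)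
    have h1 := Nat.le_ceil (c * κ ^ Fintype.card (β ⊕ (γ ⊕ δ)) * (B.dd.factorial : ℝ))
    rw [hℓ]; push_cast; linarith
  -- the parameters
  obtain ⟨hR0, hR2⟩ := F.R_bounds (Fintype.card (β ⊕ (γ ⊕ δ))) hn hσone
  refine ⟨F.D' (Fintype.card (β ⊕ (γ ⊕ δ))) B.dd σ, F.T (Fintype.card (β ⊕ (γ ⊕ δ))) σ,
    GaGmE.Std.BakerData.Family.S₀ (Fintype.card (β ⊕ (γ ⊕ δ))) σ, F.S (Fintype.card (β ⊕ (γ ⊕ δ))) σ,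
    F.T₂ (Fintype.card (β ⊕ (γ ⊕ δ))) σ, F.R (Fintype.card (β ⊕ (γ ⊕ δ))) σ,
    F.T_pos _ hn hσone, F.one_le_D' _ B.dd hn hσone, F.one_le_S _ hσone,
    F.siegel_feasible _ B.dd hn hσone, hR0, hR2, ?_, ?_⟩
  · intro ξ hξ
    exact B.numCond₂_family F rfl hn haF hb₀ hGG' hσG hσ1 hσ2 hσ3 hσW hξ
  · intro e m hm hidx
    exact F.numerics (Fintype.card (β ⊕ (γ ⊕ δ))) B.dd hn hdd hc han hℓc hσone hσK e m hm hidx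


/-- **The dichotomy, unconditionally in the parameters.** `ClosingDichotomy.dichotomy` with its
hypothesis `hpar` discharged by `admissibleParams_of_lt`: modulo Philippon's zero estimate, for a
semistable proper `K`-rational `𝔟` and a torsion-abelian algebraic point `w ∈ 𝔟` of `M_κ` there is
a proper connected algebraic subgroup `K`, borderline for `𝔟`, with a multiple of `w` in
`Lie K_ℂ + ker exp`. [cite: BakerWustholz2007, Lemma 6.7, Thm 6.15 (pp. 136–139)] -/
theorem dichotomy' (L : 𝓙 → PeriodPair) (cls : γ → 𝓙) (hL : ∀ i, IsAlgebraic ℚ (L i).g₂ ∧ IsAlgebraic ℚ (L i).g₃) (κM : δ → γ → Kbar)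
    (hphil : ∃ c : ℝ, 0 < c ∧ ∀ (𝔟 : Submodule ℂ (β ⊕ (γ ⊕ δ) → ℂ)) (v : β ⊕ (γ ⊕ δ) → ℂ)
      (P : MvPolynomial (Option β × ThetaIdx γ δ) ℂ) (D S T : ℕ),
      0 < Module.finrank ℂ 𝔟 → 1 ≤ D → 1 ≤ S → P.IsHomogeneous D → (∃ w, thetaEval L cls κM P w ≠ 0) →
      (∀ s : ℕ, s ≤ Fintype.card (β ⊕ (γ ⊕ δ)) * S →
        VanishesAlong 𝔟 (thetaEval L cls κM P) ((s : ℂ) • v) (Fintype.card (β ⊕ (γ ⊕ δ)) * T + 1)) →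
      ∃ K : SubgroupDataC β γ δ cls κM, (∃ w₀, ∀ w ∈ K.tangent, thetaEval L cls κM P (w₀ + w) = 0) ∧
        (Nat.choose (T + (Module.finrank ℂ 𝔟 - Module.finrank ℂ ↥(𝔟 ⊓ K.tangent)))
            (Module.finrank ℂ 𝔟 - Module.finrank ℂ ↥(𝔟 ⊓ K.tangent)) : ℝ) *
          (orbitCard L cls κM K v S : ℝ) * (D : ℝ) ^ Module.finrank ℂ K.tangent ≤
          c * (D : ℝ) ^ Fintype.card (β ⊕ (γ ⊕ δ)))
    {𝔟 : Submodule ℂ (β ⊕ (γ ⊕ δ) → ℂ)} (hrat : LiePresentation.IsKRational Kbar 𝔟) (h𝔟 : 𝔟 ≠ ⊤)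
    (hss : Semistable cls κM 𝔟) {w : β ⊕ (γ ⊕ δ) → ℂ} (hw𝔟 : w ∈ 𝔟) (hw : w ∈ AlgTors L cls κM) :
    ∃ K : SubgroupDataC β γ δ cls κM, K.tangent ≠ ⊤ ∧
      Module.finrank ℂ 𝔟 * (Fintype.card (β ⊕ (γ ⊕ δ)) - Module.finrank ℂ K.tangent) =
        (Module.finrank ℂ 𝔟 - Module.finrank ℂ ↥(𝔟 ⊓ K.tangent)) * Fintype.card (β ⊕ (γ ⊕ δ)) ∧
      ∃ r : ℕ, 0 < r ∧ (r : ℂ) • w ∈ preimageSubgroup L cls κM K := by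
  refine dichotomy L cls hL κM hphil hrat h𝔟 hss hw𝔟 hw ?_
  intro B _ _ _ _ hBdd _ c hc
  have hlt : Module.finrank ℂ 𝔟 < Fintype.card (β ⊕ (γ ⊕ δ)) := by
    have h := Submodule.finrank_lt h𝔟
    simpa [Module.finrank_fintype_fun_eq_card] using h
  have hdd : B.dd < Fintype.card (β ⊕ (γ ⊕ δ)) := hBdd ▸ hlt
  exact hBdd ▸ B.admissibleParams_of_lt hdd hc


/-- **Envelope of `H_ξ`** under the Siegel house bound of the spaced system:
`H_ξ ≤ G³ · W^{2n} · A`, `A = houseBound D' T (ℓ S_rows)`. [folklore] -/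
theorem houseXi_le₃ {ℓ D' T Srows : ℕ} (ξ : UIdx β γ δ D' → 𝓞 B.K)
    (hξ : ∀ u, house ((ξ u : 𝓞 B.K) : B.K) ≤ B.siegelHouseBound₃ ℓ D' T Srows) {W : ℝ} (hW1 : 1 ≤ W)
    (hWD : (D' : ℝ) + 1 ≤ W) (hqp : 2 * ((Srows + 1) * T ^ B.dd) ≤ (D' + 1) ^ Fintype.card (β ⊕ (γ ⊕ δ)))
    (hp : 0 < (Srows + 1) * T ^ B.dd) :
    B.houseXi ξ ≤ B.bigConst ^ 3 * W ^ (2 * Fintype.card (β ⊕ (γ ⊕ δ))) * B.houseBound D' T (ℓ * Srows) := by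
  have hG2 := B.bigConst_spec.1
  set n := Fintype.card (β ⊕ (γ ⊕ δ)) with hn
  set A := B.houseBound D' T (ℓ * Srows) with hA
  have hSHB := B.siegelHouseBound₃_le ℓ D' T Srows hWD hqp hp
  rw [← hn] at hSHB
  have hA1 : 1 ≤ A := B.one_le_houseBound D' T (ℓ * Srows)
  have hU : (Fintype.card (UIdx β γ δ D') : ℝ) ≤ W ^ n := by
    rw [card_UIdx]; push_cast; exact pow_le_pow_left₀ (by positivity) hWD n
  unfold houseXi
  have hsum : ∑ u, house ((ξ u : 𝓞 B.K) : B.K) ≤ (Fintype.card (UIdx β γ δ D') : ℝ) * B.siegelHouseBound₃ ℓ D' T Srows := by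
    calc ∑ u, house ((ξ u : 𝓞 B.K) : B.K) ≤ ∑ _u : UIdx β γ δ D', B.siegelHouseBound₃ ℓ D' T Srows :=
          Finset.sum_le_sum fun u _ => hξ u
      _ = _ := by rw [Finset.sum_const, nsmul_eq_mul, Finset.card_univ]
  have hSHB0 : 0 ≤ B.siegelHouseBound₃ ℓ D' T Srows := (house_nonneg _).trans (hξ (fun _ => 0))
  have hWn : (1 : ℝ) ≤ W ^ n := one_le_pow₀ hW1
  have hX : 1 + (Fintype.card (UIdx β γ δ D') : ℝ) * B.siegelHouseBound₃ ℓ D' T Srows ≤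
      W ^ n * (B.bigConst ^ 2 * W ^ n * A) + W ^ n * (B.bigConst ^ 2 * W ^ n * A) := by
    have h1 : (1 : ℝ) ≤ W ^ n * (B.bigConst ^ 2 * W ^ n * A) := by
      refine one_le_mul_of_one_le_of_one_le hWn (one_le_mul_of_one_le_of_one_le
        (one_le_mul_of_one_le_of_one_le (by nlinarith) hWn) hA1)
    have h2 : (Fintype.card (UIdx β γ δ D') : ℝ) * B.siegelHouseBound₃ ℓ D' T Srows ≤
        W ^ n * (B.bigConst ^ 2 * W ^ n * A) :=
      mul_le_mul hU hSHB hSHB0 (by positivity)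
    linarith
  calc 1 + ∑ u, house ((ξ u : 𝓞 B.K) : B.K) ≤ 1 + (Fintype.card (UIdx β γ δ D') : ℝ) * B.siegelHouseBound₃ ℓ D' T Srows := by
        linarith
    _ ≤ 2 * (W ^ n * (B.bigConst ^ 2 * W ^ n * A)) := by linarith
    _ ≤ B.bigConst * (W ^ n * (B.bigConst ^ 2 * W ^ n * A)) :=
        mul_le_mul_of_nonneg_right hG2 (by positivity)
    _ = B.bigConst ^ 3 * W ^ (2 * n) * A := by ring


/-- **Envelope of `lineValBound`** under the Siegel house bound of the spaced system: for
`s ≤ S₁`, `k ≤ T'`, `Λ_{s,k} ≤ G^{2T' + 3 + D + (S₁+1)P₁} · W^{2T' + 3n + P₁} · A`,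
`P₁ = D·hdeg + 2T'`, `A = houseBound D' T (ℓ S_rows)`. [folklore] -/
theorem lineValBound_le₃ {ℓ D' T Srows S₁ T' : ℕ} (ξ : UIdx β γ δ D' → 𝓞 B.K)
    (hξ : ∀ u, house ((ξ u : 𝓞 B.K) : B.K) ≤ B.siegelHouseBound₃ ℓ D' T Srows) {W : ℝ} (hW1 : 1 ≤ W)
    (hWD : (D' : ℝ) + 1 ≤ W) (hqp : 2 * ((Srows + 1) * T ^ B.dd) ≤ (D' + 1) ^ Fintype.card (β ⊕ (γ ⊕ δ)))
    (hp : 0 < (Srows + 1) * T ^ B.dd) (hWT' : (T' : ℝ) ≤ W)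
    (hWP : ((Fintype.card (β ⊕ (γ ⊕ δ)) * D' * B.hdeg : ℕ) : ℝ) + 2 * T' ≤ W) (hWS : (S₁ : ℝ) + 1 ≤ W)
    {s k : ℕ} (hs : s ≤ S₁) (hk : k ≤ T') :
    B.lineValBound ξ s k ≤
      B.bigConst ^ (2 * T' + 3 + Fintype.card (β ⊕ (γ ⊕ δ)) * D' +
          (S₁ + 1) * (Fintype.card (β ⊕ (γ ⊕ δ)) * D' * B.hdeg + 2 * T')) *
        W ^ (2 * T' + 3 * Fintype.card (β ⊕ (γ ⊕ δ)) + (Fintype.card (β ⊕ (γ ⊕ δ)) * D' * B.hdeg + 2 * T')) *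
        B.houseBound D' T (ℓ * Srows) := by
  obtain ⟨hG2, -, hM, hhB, hqB, hdd, -⟩ := B.bigConst_spec
  have hG1 := B.one_le_bigConst
  have hG0 : (0 : ℝ) ≤ B.bigConst := by linarith
  have hW0 : (0 : ℝ) ≤ W := by linarith
  set n := Fintype.card (β ⊕ (γ ⊕ δ)) with hn
  set D := n * D' with hD
  set P₁ := D * B.hdeg + 2 * T' with hP₁
  set A := B.houseBound D' T (ℓ * Srows) with hA
  have hA1 : 1 ≤ A := B.one_le_houseBound D' T (ℓ * Srows)
  have hHξ := B.houseXi_le₃ ξ hξ hW1 hWD hqp hp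
  rw [← hn, ← hA] at hHξ
  have hkW : (k : ℝ) ≤ W := le_trans (by exact_mod_cast hk) hWT'
  have hU : (Fintype.card (UIdx β γ δ D') : ℝ) ≤ W ^ n := by
    rw [card_UIdx]; push_cast; exact pow_le_pow_left₀ (by positivity) hWD n
  -- the factors
  have f1 : (B.dd : ℝ) ^ k ≤ B.bigConst ^ T' :=
    (pow_le_pow_left₀ (Nat.cast_nonneg _) (by linarith : (B.dd : ℝ) ≤ B.bigConst) k).trans
      (pow_le_pow_right₀ hG1 hk)
  have f2 : (k : ℝ) ^ k ≤ W ^ T' := (pow_le_pow_left₀ (Nat.cast_nonneg _) hkW k).trans (pow_le_pow_right₀ hW1 hk)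
  have f5 : (((D * B.hdeg : ℕ) : ℝ) + 2 * k) ^ k ≤ W ^ T' := by
    have : ((D * B.hdeg : ℕ) : ℝ) + 2 * k ≤ W := by
      have : (k : ℝ) ≤ T' := by exact_mod_cast hk
      rw [hD]; linarith
    exact (pow_le_pow_left₀ (by positivity) this k).trans (pow_le_pow_right₀ hW1 hk)
  have f6 : B.qB ^ k ≤ B.bigConst ^ T' :=
    ((pow_le_pow_left₀ B.qB_nonneg ((le_max_right 1 B.qB).trans hqB) k)).trans (pow_le_pow_right₀ hG1 hk)
  have f7 : B.hB ^ D ≤ B.bigConst ^ D := pow_le_pow_left₀ (zero_le_one.trans B.one_le_hB) hhB _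
  have hsM1 : (1 : ℝ) ≤ ((s : ℝ) + 1) * B.M ^ (s + 1) :=
    one_le_mul_of_one_le_of_one_le (by have : (0:ℝ) ≤ s := Nat.cast_nonneg s; linarith) (one_le_pow₀ B.gens.one_le_M)
  have hM0 : (0 : ℝ) ≤ B.M := zero_le_one.trans B.gens.one_le_M
  have hsM : ((s : ℝ) + 1) * B.M ^ (s + 1) ≤ W * B.bigConst ^ (S₁ + 1) := by
    have hsS : (s : ℝ) ≤ S₁ := by exact_mod_cast hs
    have h1 : (s : ℝ) + 1 ≤ W := by linarith
    have h2 : B.M ^ (s + 1) ≤ B.bigConst ^ (S₁ + 1) :=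
      (pow_le_pow_left₀ hM0 hM _).trans (pow_le_pow_right₀ hG1 (by omega))
    exact mul_le_mul h1 h2 (pow_nonneg hM0 _) hW0
  have hsM0 : (0 : ℝ) ≤ ((s : ℝ) + 1) * B.M ^ (s + 1) := mul_nonneg (by positivity) (pow_nonneg hM0 _)
  have f8 : (((s : ℝ) + 1) * B.M ^ (s + 1)) ^ (D * B.hdeg + 2 * k) ≤ (W * B.bigConst ^ (S₁ + 1)) ^ P₁ :=
    (pow_le_pow_left₀ hsM0 hsM _).trans (pow_le_pow_right₀ (by
      calc (1 : ℝ) ≤ ((s : ℝ) + 1) * B.M ^ (s + 1) := hsM1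
        _ ≤ W * B.bigConst ^ (S₁ + 1) := hsM) (by rw [hP₁]; omega))
  -- nonnegativity
  have n1 : (0 : ℝ) ≤ (B.dd : ℝ) ^ k := by positivity
  have n2 : (0 : ℝ) ≤ (k : ℝ) ^ k := by positivity
  have n3 : (0 : ℝ) ≤ (Fintype.card (UIdx β γ δ D') : ℝ) := Nat.cast_nonneg _
  have n4 : (0 : ℝ) ≤ B.houseXi ξ := zero_le_one.trans (B.one_le_houseXi ξ)
  have n5 : (0 : ℝ) ≤ (((D * B.hdeg : ℕ) : ℝ) + 2 * k) ^ k := by positivity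
  have n6 : (0 : ℝ) ≤ B.qB ^ k := pow_nonneg B.qB_nonneg _
  have n7 : (0 : ℝ) ≤ B.hB ^ D := pow_nonneg (zero_le_one.trans B.one_le_hB) _
  have n8 : (0 : ℝ) ≤ (((s : ℝ) + 1) * B.M ^ (s + 1)) ^ (D * B.hdeg + 2 * k) := pow_nonneg hsM0 _
  unfold lineValBound
  rw [← hn, ← hD]
  calc (B.dd : ℝ) ^ k * (k : ℝ) ^ k * (Fintype.card (UIdx β γ δ D') : ℝ) * B.houseXi ξ *
        ((((D * B.hdeg : ℕ) : ℝ) + 2 * k) ^ k * B.qB ^ k * B.hB ^ D *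
          (((s : ℝ) + 1) * B.M ^ (s + 1)) ^ (D * B.hdeg + 2 * k))
      ≤ B.bigConst ^ T' * W ^ T' * W ^ n * (B.bigConst ^ 3 * W ^ (2 * n) * A) *
          (W ^ T' * B.bigConst ^ T' * B.bigConst ^ D * (W * B.bigConst ^ (S₁ + 1)) ^ P₁) := by
        refine mul_le_mul (mul_le_mul (mul_le_mul (mul_le_mul f1 f2 n2 (by positivity)) hU n3 (by positivity))
          hHξ n4 (by positivity)) (mul_le_mul (mul_le_mul (mul_le_mul f5 f6 n6 (by positivity)) f7 n7
          (by positivity)) f8 n8 (by positivity)) (by positivity) (by positivity)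
    _ = B.bigConst ^ (2 * T' + 3 + D + (S₁ + 1) * P₁) * W ^ (2 * T' + 3 * n + P₁) * A := by
        rw [mul_pow, ← pow_mul]; ring


omit [DecidableEq β] [DecidableEq δ] in
/-- **The saving factor of the spaced zeros**: if `2(S₁ + ℓS₀)/R ≤ θ ≤ 1` then for `s ≤ S₁`,
`k ≤ T'`, `(2(s+ℓS₀)/R)^{(T-k)(S₀+1)} ≤ θ^{(T-T')(S₀+1)}`. [folklore] -/
theorem saving_le₃ {ℓ S₀ S₁ T T' : ℕ} {R θ : ℝ} (hR : 0 < R) (hθ : 2 * ((S₁ : ℝ) + ℓ * S₀) / R ≤ θ)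
    (hθ1 : θ ≤ 1) {s k : ℕ} (hs : s ≤ S₁) (hk : k ≤ T') :
    (2 * ((s : ℝ) + ℓ * S₀) / R) ^ ((T - k) * (S₀ + 1)) ≤ θ ^ ((T - T') * (S₀ + 1)) := by
  have hb0 : 0 ≤ 2 * ((s : ℝ) + ℓ * S₀) / R := by positivity
  have hb : 2 * ((s : ℝ) + ℓ * S₀) / R ≤ θ := by
    refine le_trans (div_le_div_of_nonneg_right ?_ hR.le) hθ
    have : (s : ℝ) ≤ S₁ := by exact_mod_cast hs
    linarith
  have hθ0 : 0 ≤ θ := hb0.trans hb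
  calc (2 * ((s : ℝ) + ℓ * S₀) / R) ^ ((T - k) * (S₀ + 1)) ≤ θ ^ ((T - k) * (S₀ + 1)) := pow_le_pow_left₀ hb0 hb _
    _ ≤ θ ^ ((T - T') * (S₀ + 1)) := pow_le_pow_of_le_one hθ0 hθ1 (Nat.mul_le_mul_right _ (by omega))


omit [DecidableEq β] [DecidableEq δ] in
/-- `expE` is monotone in `D`. [folklore] -/
theorem expE_mono_left {D D₂ : ℕ} (h : D ≤ D₂) (k : ℕ) : B.expE D k ≤ B.expE D₂ k := by
  unfold expE
  have := Nat.mul_le_mul_right B.hdeg h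
  omega


/-- **`NumCond₃` holds along the torsion family** (for `σ` beyond explicit thresholds), for every
coefficient vector within the Siegel house bound of the spaced system. Hypotheses: `n ≥ 1`,
`a·dd + 2b + 2n + 4 ≤ a·n`, `b ≥ b₀(fam)`, a natural `G' ≥ G` and `σ ≥ G'`, `σ ≥ sp·P₀`, and the
thresholds of `NumCondExponents.exponent_ineq` and `GaGmE.Std.BakerData.Family.sizes_le_W` for `fam`.
[cite: BakerWustholz2007, §6.8 (p. 119)] -/
theorem numCond₃_family (F : GaGmE.Std.BakerData.TFamily) {n : ℕ} (hn' : Fintype.card (β ⊕ (γ ⊕ δ)) = n) (hn : 1 ≤ n)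
    (ha : F.a * B.dd + 2 * F.b + 2 * n + 4 ≤ F.a * n)
    (hb : GaGmE.Std.BakerData.Family.b₀ F.fam n B.dd B.gens.h B.hdeg ≤ F.b)
    {G' : ℕ} (hG' : B.bigConst ≤ G') {σ : ℕ} (hσG : G' ≤ σ)
    (hσ1 : GaGmE.Std.BakerData.Family.κD n B.dd * (1 + (2 * (n * (F.ℓ + F.sp)) + 3) ^ 2 * G' ^ 2) ≤ σ)
    (hσ2 : GaGmE.Std.BakerData.Family.κD n B.dd * (2 + (n * (F.ℓ + F.sp)) ^ 2) ≤ σ)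
    (hσ3 : (F.a * n + 1) * (4 * n + 3 * n + B.gens.h * (4 * n + 3 * n + B.hdeg * GaGmE.Std.BakerData.Family.κD n B.dd + 4 * n) +
        B.gens.h * (4 * n + B.hdeg * GaGmE.Std.BakerData.Family.κD n B.dd + 8 * n)) ≤ σ)
    (hσW : B.hdeg * GaGmE.Std.BakerData.Family.κD n B.dd + 8 * n + n * (F.ℓ + F.sp) + GaGmE.Std.BakerData.Family.κD n B.dd + 3 ≤ σ)
    (hσP : F.sp * F.P₀ ≤ σ)
    {ξ : UIdx β γ δ (F.D' n B.dd σ) → 𝓞 B.K}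
    (hξ : ∀ u, house ((ξ u : 𝓞 B.K) : B.K) ≤ B.siegelHouseBound₃ F.sp (F.D' n B.dd σ) (F.T n σ) F.Srows) :
    B.NumCond₃ ξ F.sp (F.T n σ) (GaGmE.Std.BakerData.Family.S₀ n σ) (F.S₁ n σ) (F.T' n σ) (F.R n σ) := by
  -- the comparison family and its identifications
  set Fm : GaGmE.Std.BakerData.Family := F.fam with hFm
  have hFa : Fm.a = F.a := rfl
  have hFb : Fm.b = F.b := rfl
  have hFℓ : Fm.ℓ = F.ℓ + F.sp := rfl
  have hT : F.T n σ = Fm.T n σ := rfl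
  have hT' : F.T' n σ = Fm.T' n σ := rfl
  -- basic facts about `σ`
  have hG2 := B.bigConst_spec.1
  have hG1 := B.one_le_bigConst
  have hGσ : B.bigConst ≤ (σ : ℝ) := hG'.trans (by exact_mod_cast hσG)
  have hσr2 : (2 : ℝ) ≤ σ := by linarith
  have hσone : 1 ≤ σ := by
    have : (1 : ℝ) ≤ σ := by linarith
    exact_mod_cast this
  have hσr1 : (1 : ℝ) < σ := by linarith
  have haFm : Fm.a * B.dd + 2 * Fm.b + 2 * n + 4 ≤ Fm.a * n := by rw [hFa, hFb]; exact ha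
  have hexp : 1 + Fm.a * B.dd ≤ Fm.a * n := by omega
  have ha1 : 1 ≤ Fm.a := by
    by_contra h0
    have : Fm.a = 0 := by omega
    rw [this] at haFm; omega
  have h1 : 1 ≤ B.gens.h := B.gens.one_le_h
  have hP₀σ : F.P₀ ≤ σ := le_trans (Nat.le_mul_of_pos_left _ (by have := F.hsp; omega)) hσP
  -- the sizes and `W` (for `fam`), then for the torsion family
  have hW1 : (1 : ℝ) ≤ (σ : ℝ) ^ (Fm.a * n + 1) := one_le_pow₀ (by linarith)
  have hσW' : B.hdeg * GaGmE.Std.BakerData.Family.κD n B.dd + 8 * n + n * Fm.ℓ + GaGmE.Std.BakerData.Family.κD n B.dd + 3 ≤ σ := by rw [hFℓ]; exact hσW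
  obtain ⟨sD, sT', sS₁, sS₀, sT, sP⟩ := Fm.sizes_le_W hn B.hdeg hσone hexp ha1 hσW'
  have hD'le : F.D' n B.dd σ ≤ Fm.D' n B.dd σ := F.D'_le_fam n B.dd hP₀σ
  have hDn : n * F.D' n B.dd σ ≤ Fm.Dn n B.dd σ := F.nD'_le_Dn n B.dd hP₀σ
  have hS₁le : F.S₁ n σ ≤ Fm.S₁ n σ := F.S₁_le_fam n σ
  have hrows : F.sp * F.Srows + 1 ≤ GaGmE.Std.BakerData.Family.S₀ n σ + 1 := F.sp_mul_Srows_lt n hn hσP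
  have castW : ∀ {m : ℕ}, m ≤ σ ^ (Fm.a * n + 1) → (m : ℝ) ≤ (σ : ℝ) ^ (Fm.a * n + 1) := fun hm => by
    exact_mod_cast hm
  have hWD : (F.D' n B.dd σ : ℝ) + 1 ≤ (σ : ℝ) ^ (Fm.a * n + 1) := by
    have := castW (le_trans (Nat.succ_le_succ hD'le) sD); push_cast at this; exact this
  have hWT' : (F.T' n σ : ℝ) ≤ (σ : ℝ) ^ (Fm.a * n + 1) := castW sT'
  have hWS₁ : (F.S₁ n σ : ℝ) + 1 ≤ (σ : ℝ) ^ (Fm.a * n + 1) := by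
    have := castW (le_trans (Nat.succ_le_succ hS₁le) sS₁); push_cast at this; exact this
  have hWS₀ : (GaGmE.Std.BakerData.Family.S₀ n σ : ℝ) + 1 ≤ (σ : ℝ) ^ (Fm.a * n + 1) := by have := castW sS₀; push_cast at this; exact this
  have hWSrows : ((F.sp * F.Srows : ℕ) : ℝ) + 1 ≤ (σ : ℝ) ^ (Fm.a * n + 1) := by
    have := castW (le_trans hrows sS₀); push_cast at this ⊢; linarith
  have hWT : ((Fintype.card (β ⊕ (γ ⊕ δ)) * F.D' n B.dd σ * B.hdeg : ℕ) : ℝ) + 2 * (F.T n σ) + 1 ≤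
      (σ : ℝ) ^ (Fm.a * n + 1) := by
    rw [hn']
    have h0 : n * F.D' n B.dd σ * B.hdeg + 2 * Fm.T n σ + 1 ≤ σ ^ (Fm.a * n + 1) :=
      le_trans (by have := Nat.mul_le_mul_right B.hdeg hDn; unfold GaGmE.Std.BakerData.Family.Dn at this; omega) sT
    have := castW h0; push_cast at this ⊢; rw [hT]; linarith
  have hWP : ((Fintype.card (β ⊕ (γ ⊕ δ)) * F.D' n B.dd σ * B.hdeg : ℕ) : ℝ) + 2 * (F.T' n σ) ≤
      (σ : ℝ) ^ (Fm.a * n + 1) := by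
    rw [hn']
    have h0 : n * F.D' n B.dd σ * B.hdeg + 2 * Fm.T' n σ ≤ σ ^ (Fm.a * n + 1) :=
      le_trans (by have := Nat.mul_le_mul_right B.hdeg hDn; unfold GaGmE.Std.BakerData.Family.Dn at this; omega) sP
    have := castW h0; push_cast at this ⊢; rw [hT']; linarith
  have hqp : 2 * ((F.Srows + 1) * F.T n σ ^ B.dd) ≤ (F.D' n B.dd σ + 1) ^ Fintype.card (β ⊕ (γ ⊕ δ)) := by
    rw [hn']; exact F.two_p_le_q n B.dd hn σ
  have hp : 0 < (F.Srows + 1) * F.T n σ ^ B.dd := Nat.mul_pos (Nat.succ_pos _) (pow_pos (Fm.T_pos n hn hσone) _)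
  -- `R`, `θ`
  obtain ⟨hR0, hR2⟩ := F.R_bounds n hn hσone
  have hRR' : F.R n σ ≤ (Fm.R' n σ : ℝ) := F.R_le_R' n hn hσone
  have hθ1 : ((σ : ℝ) ^ F.b)⁻¹ ≤ 1 := inv_le_one_of_one_le₀ (one_le_pow₀ (by linarith))
  have hθeq : 2 * ((F.S₁ n σ : ℝ) + F.sp * GaGmE.Std.BakerData.Family.S₀ n σ) / F.R n σ ≤ ((σ : ℝ) ^ F.b)⁻¹ := by
    have hRdef : F.R n σ = (σ : ℝ) ^ F.b * (2 * ((F.S₁ n σ : ℝ) + F.sp * GaGmE.Std.BakerData.Family.S₀ n σ)) := rfl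
    have hsum : (0 : ℝ) < 2 * ((F.S₁ n σ : ℝ) + F.sp * GaGmE.Std.BakerData.Family.S₀ n σ) := by
      rw [hRdef] at hR0
      have hbpos : (0 : ℝ) < (σ : ℝ) ^ F.b := by positivity
      exact (pos_iff_pos_of_mul_pos hR0).mp hbpos
    rw [hRdef, div_le_iff₀ (by positivity)]
    rw [show ((σ : ℝ) ^ F.b)⁻¹ * ((σ : ℝ) ^ F.b * (2 * ((F.S₁ n σ : ℝ) + F.sp * GaGmE.Std.BakerData.Family.S₀ n σ))) =
      2 * ((F.S₁ n σ : ℝ) + F.sp * GaGmE.Std.BakerData.Family.S₀ n σ) from by field_simp]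
  intro s hs k hk
  have hk' : k ≤ F.T' n σ := hk.le
  have hsFm : s ≤ Fm.S₁ n σ := hs.trans hS₁le
  -- the envelopes (torsion versions)
  have e1 := B.orderLoss_le hk' hW1 hWT'
  have eU : (Fintype.card (UIdx β γ δ (F.D' n B.dd σ)) : ℝ) ≤ ((σ : ℝ) ^ (Fm.a * n + 1)) ^ n := by
    rw [card_UIdx, hn']; push_cast; exact pow_le_pow_left₀ (by positivity) hWD n
  have e3 := B.houseXi_le₃ ξ hξ hW1 hWD hqp hp
  have eA₃ := B.houseBound_le (F.D' n B.dd σ) (F.T n σ) (F.sp * F.Srows) hW1 hWT hWSrows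
  have e4₃ := B.growth_le (Fintype.card (β ⊕ (γ ⊕ δ)) * F.D' n B.dd σ) hR0.le hRR' hG'
  have e5 := saving_le₃ (T := F.T n σ) hR0 hθeq hθ1 hs hk'
  have e6₃ := B.dAt_pow_le (D := Fintype.card (β ⊕ (γ ⊕ δ)) * F.D' n B.dd σ) hs hk'
  have e7₃ := B.lineValBound_le₃ ξ hξ hW1 hWD hqp hp hWT' hWP hWS₁ hs hk'
  -- rename `card` to `n` in the envelopes and in the goal
  rw [hn'] at e3 eA₃ e4₃ e6₃ e7₃
  rw [hn']
  -- notation for the real quantities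
  have hG0 : (0 : ℝ) ≤ B.bigConst := by linarith
  have hσ0 : (0 : ℝ) ≤ σ := by linarith
  have hWr0 : (0 : ℝ) ≤ (σ : ℝ) ^ (Fm.a * n + 1) := by positivity
  have hθ0 : (0 : ℝ) ≤ ((σ : ℝ) ^ F.b)⁻¹ := by positivity
  set A₃ := B.houseBound (F.D' n B.dd σ) (F.T n σ) (F.sp * F.Srows) with hA₃
  have hA1 : 1 ≤ A₃ := B.one_le_houseBound _ _ _
  have hA0 : (0 : ℝ) ≤ A₃ := zero_le_one.trans hA1
  -- exponent comparisons with `fam`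
  have hET : B.expE (n * F.D' n B.dd σ) (F.T n σ) ≤ Fm.ET n B.dd B.hdeg σ := by
    have := B.expE_mono_left hDn (F.T n σ)
    exact this.trans (le_of_eq rfl)
  have hE' : B.expE (n * F.D' n B.dd σ) (F.T' n σ) ≤ Fm.E' n B.dd B.hdeg σ := by
    have := B.expE_mono_left hDn (F.T' n σ)
    exact this.trans (le_of_eq rfl)
  have hDh : n * F.D' n B.dd σ * B.hdeg ≤ Fm.Dn n B.dd σ * B.hdeg := Nat.mul_le_mul_right _ hDn
  -- the `fam` envelope of the house bound
  set EA : ℝ := B.bigConst ^ ((GaGmE.Std.BakerData.Family.S₀ n σ + 1) * Fm.ET n B.dd B.hdeg σ + 2 * Fm.T n σ + Fm.Dn n B.dd σ +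
      (GaGmE.Std.BakerData.Family.S₀ n σ + 1) * (Fm.Dn n B.dd σ * B.hdeg + 2 * Fm.T n σ)) *
    ((σ : ℝ) ^ (Fm.a * n + 1)) ^ (Fm.T n σ + (Fm.Dn n B.dd σ * B.hdeg + 2 * Fm.T n σ)) with hEA
  have hEA0 : 0 ≤ EA := by rw [hEA]; positivity
  have eA : A₃ ≤ EA := by
    refine eA₃.trans ?_
    rw [hEA, ← hT]
    refine mul_le_mul (B.bigConst_pow_mono ?_) (pow_le_pow_right₀ hW1 ?_) (by positivity) (by positivity)
    · have h2 : (F.sp * F.Srows + 1) * B.expE (n * F.D' n B.dd σ) (F.T n σ) ≤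
          (GaGmE.Std.BakerData.Family.S₀ n σ + 1) * Fm.ET n B.dd B.hdeg σ := Nat.mul_le_mul hrows hET
      have h3 : (F.sp * F.Srows + 1) * (n * F.D' n B.dd σ * B.hdeg + 2 * F.T n σ) ≤
          (GaGmE.Std.BakerData.Family.S₀ n σ + 1) * (Fm.Dn n B.dd σ * B.hdeg + 2 * F.T n σ) :=
        Nat.mul_le_mul hrows (Nat.add_le_add_right hDh _)
      omega
    · omega
  have e3' : B.houseXi ξ ≤ B.bigConst ^ 3 * ((σ : ℝ) ^ (Fm.a * n + 1)) ^ (2 * n) * EA :=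
    e3.trans (mul_le_mul_of_nonneg_left eA (by positivity))
  have e4 : Real.exp (thetaGrowthC (β := β) B.L B.cls B.κM * (1 + (F.R n σ * ‖B.v‖ + 1) ^ 2)) ^ (n * F.D' n B.dd σ) ≤
      B.bigConst ^ (Fm.Dn n B.dd σ * (1 + (Fm.R' n σ + 1) ^ 2 * G' ^ 2)) :=
    e4₃.trans (B.bigConst_pow_mono (Nat.mul_le_mul_right _ hDn))
  have e6 : |(B.dAt s : ℝ)| ^ B.expE (n * F.D' n B.dd σ) k ≤ B.bigConst ^ ((Fm.S₁ n σ + 1) * Fm.E' n B.dd B.hdeg σ) :=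
    e6₃.trans (B.bigConst_pow_mono (Nat.mul_le_mul (Nat.succ_le_succ hS₁le) hE'))
  have e7' : B.lineValBound ξ s k ≤
      B.bigConst ^ (2 * Fm.T' n σ + 3 + Fm.Dn n B.dd σ + (Fm.S₁ n σ + 1) * (Fm.Dn n B.dd σ * B.hdeg + 2 * Fm.T' n σ)) *
        ((σ : ℝ) ^ (Fm.a * n + 1)) ^ (2 * Fm.T' n σ + 3 * n + (Fm.Dn n B.dd σ * B.hdeg + 2 * Fm.T' n σ)) * EA := by
    refine e7₃.trans ?_
    rw [← hT']
    refine mul_le_mul (mul_le_mul (B.bigConst_pow_mono ?_) (pow_le_pow_right₀ hW1 ?_) (by positivity) (by positivity))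
      eA hA0 (by positivity)
    · have h3 : (F.S₁ n σ + 1) * (n * F.D' n B.dd σ * B.hdeg + 2 * F.T' n σ) ≤
          (Fm.S₁ n σ + 1) * (Fm.Dn n B.dd σ * B.hdeg + 2 * F.T' n σ) :=
        Nat.mul_le_mul (Nat.succ_le_succ hS₁le) (Nat.add_le_add_right hDh _)
      omega
    · omega
  -- nonnegativity of the true factors
  have n1 : (0 : ℝ) ≤ (k.factorial : ℝ) * ((k : ℝ) * B.dirNorm + 1) ^ k := by
    have := B.dirNorm_nonneg; positivity
  have nU : (0 : ℝ) ≤ (Fintype.card (UIdx β γ δ (F.D' n B.dd σ)) : ℝ) := Nat.cast_nonneg _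
  have nH : (0 : ℝ) ≤ B.houseXi ξ := zero_le_one.trans (B.one_le_houseXi ξ)
  have nG : (0 : ℝ) ≤ Real.exp (thetaGrowthC (β := β) B.L B.cls B.κM * (1 + (F.R n σ * ‖B.v‖ + 1) ^ 2)) ^ (n * F.D' n B.dd σ) :=
    pow_nonneg (Real.exp_nonneg _) _
  have nS : (0 : ℝ) ≤ (2 * ((s : ℝ) + F.sp * GaGmE.Std.BakerData.Family.S₀ n σ) / F.R n σ) ^ ((F.T n σ - k) * (GaGmE.Std.BakerData.Family.S₀ n σ + 1)) := by
    positivity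
  have nD : (0 : ℝ) ≤ |(B.dAt s : ℝ)| ^ B.expE (n * F.D' n B.dd σ) k := by positivity
  have nL : (0 : ℝ) ≤ B.lineValBound ξ s k := B.lineValBound_nonneg ξ s k
  -- block 2: `#U · H_ξ · growth`
  have b2 : (Fintype.card (UIdx β γ δ (F.D' n B.dd σ)) : ℝ) * B.houseXi ξ *
        Real.exp (thetaGrowthC (β := β) B.L B.cls B.κM * (1 + (F.R n σ * ‖B.v‖ + 1) ^ 2)) ^ (n * F.D' n B.dd σ) ≤
      ((σ : ℝ) ^ (Fm.a * n + 1)) ^ n * (B.bigConst ^ 3 * ((σ : ℝ) ^ (Fm.a * n + 1)) ^ (2 * n) * EA) *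
        B.bigConst ^ (Fm.Dn n B.dd σ * (1 + (Fm.R' n σ + 1) ^ 2 * G' ^ 2)) :=
    mul_le_mul (mul_le_mul eU e3' nH (by positivity)) e4 nG (by positivity)
  -- block 4: the Liouville factors
  have b4 : |(B.dAt s : ℝ)| ^ B.expE (n * F.D' n B.dd σ) k *
        (|(B.dAt s : ℝ)| ^ B.expE (n * F.D' n B.dd σ) k * B.lineValBound ξ s k) ^ (B.gens.h - 1) ≤
      B.bigConst ^ ((Fm.S₁ n σ + 1) * Fm.E' n B.dd B.hdeg σ) *
        (B.bigConst ^ ((Fm.S₁ n σ + 1) * Fm.E' n B.dd B.hdeg σ) *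
          (B.bigConst ^ (2 * Fm.T' n σ + 3 + Fm.Dn n B.dd σ + (Fm.S₁ n σ + 1) * (Fm.Dn n B.dd σ * B.hdeg + 2 * Fm.T' n σ)) *
            ((σ : ℝ) ^ (Fm.a * n + 1)) ^ (2 * Fm.T' n σ + 3 * n + (Fm.Dn n B.dd σ * B.hdeg + 2 * Fm.T' n σ)) * EA)) ^
        (B.gens.h - 1) :=
    mul_le_mul e6 (pow_le_pow_left₀ (by positivity) (mul_le_mul e6 e7' nL (by positivity)) _) (by positivity)
      (by positivity)
  -- the saving factor in the `fam` normalisation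
  have e5' : (2 * ((s : ℝ) + F.sp * GaGmE.Std.BakerData.Family.S₀ n σ) / F.R n σ) ^ ((F.T n σ - k) * (GaGmE.Std.BakerData.Family.S₀ n σ + 1)) ≤
      (((σ : ℝ) ^ F.b)⁻¹) ^ (Fm.Msave n σ) := by
    refine e5.trans (le_of_eq ?_)
    rfl
  have e1' : (k.factorial : ℝ) * ((k : ℝ) * B.dirNorm + 1) ^ k ≤ (B.bigConst * (σ : ℝ) ^ (Fm.a * n + 1)) ^ (2 * Fm.T' n σ) := e1
  -- the whole left-hand side
  have hLHS := mul_le_mul (mul_le_mul (mul_le_mul e1' b2 (by positivity) (by positivity)) e5' nS (by positivity))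
    b4 (by positivity) (by positivity)
  refine lt_of_le_of_lt hLHS ?_
  -- collect the exponents
  obtain ⟨h₁, hh₁⟩ : ∃ h₁, B.gens.h = h₁ + 1 := ⟨B.gens.h - 1, by omega⟩
  have hX := Fm.exponent_ineq (n := n) (dd := B.dd) (h := B.gens.h) (hdeg := B.hdeg) (G' := G') hn haFm hb hσone
    (by rw [hFℓ]; exact hσ1) (by rw [hFℓ]; exact hσ2) hσ3
  have key : B.bigConst ^ (Fm.X₁ n B.dd B.gens.h B.hdeg G' σ) * ((σ : ℝ) ^ (Fm.a * n + 1)) ^ (Fm.X₂ n B.dd B.gens.h B.hdeg σ) *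
      (((σ : ℝ) ^ F.b)⁻¹) ^ (Fm.Msave n σ) <
      (B.thetaLowc * Real.exp (-(B.thetaLowC * (1 + (s : ℝ) ^ 2)))) ^ (n * F.D' n B.dd σ) := by
    -- right-hand side from below
    have hY : n * F.D' n B.dd σ * (2 + s ^ 2) ≤ Fm.Y n B.dd σ := by
      unfold GaGmE.Std.BakerData.Family.Y
      exact Nat.mul_le_mul hDn (Nat.add_le_add_left (Nat.pow_le_pow_left hsFm 2) 2)
    have hR := B.rhs_ge (n * F.D' n B.dd σ) s
    have hR' : ((σ : ℝ) ^ Fm.Y n B.dd σ)⁻¹ ≤ (B.thetaLowc * Real.exp (-(B.thetaLowC * (1 + (s : ℝ) ^ 2)))) ^ (n * F.D' n B.dd σ) := by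
      refine le_trans ?_ hR
      rw [inv_le_inv₀ (by positivity) (by positivity)]
      calc B.bigConst ^ (n * F.D' n B.dd σ * (2 + s ^ 2)) ≤ (σ : ℝ) ^ (n * F.D' n B.dd σ * (2 + s ^ 2)) :=
            pow_le_pow_left₀ hG0 hGσ _
        _ ≤ (σ : ℝ) ^ Fm.Y n B.dd σ := pow_le_pow_right₀ hσr1.le hY
    refine lt_of_lt_of_le ?_ hR'
    -- left-hand side from above, as a single power of `σ`
    have hGX : B.bigConst ^ (Fm.X₁ n B.dd B.gens.h B.hdeg G' σ) ≤ (σ : ℝ) ^ (Fm.X₁ n B.dd B.gens.h B.hdeg G' σ) :=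
      pow_le_pow_left₀ hG0 hGσ _
    have hpos : (0 : ℝ) < (σ : ℝ) ^ (Fm.b * Fm.Msave n σ) := by positivity
    have hposY : (0 : ℝ) < (σ : ℝ) ^ Fm.Y n B.dd σ := by positivity
    calc B.bigConst ^ (Fm.X₁ n B.dd B.gens.h B.hdeg G' σ) * ((σ : ℝ) ^ (Fm.a * n + 1)) ^ (Fm.X₂ n B.dd B.gens.h B.hdeg σ) *
          (((σ : ℝ) ^ F.b)⁻¹) ^ (Fm.Msave n σ)
        ≤ (σ : ℝ) ^ (Fm.X₁ n B.dd B.gens.h B.hdeg G' σ) * ((σ : ℝ) ^ (Fm.a * n + 1)) ^ (Fm.X₂ n B.dd B.gens.h B.hdeg σ) *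
          (((σ : ℝ) ^ F.b)⁻¹) ^ (Fm.Msave n σ) :=
          mul_le_mul_of_nonneg_right (mul_le_mul_of_nonneg_right hGX (by positivity)) (by positivity)
      _ = (σ : ℝ) ^ (Fm.X₁ n B.dd B.gens.h B.hdeg G' σ + (Fm.a * n + 1) * Fm.X₂ n B.dd B.gens.h B.hdeg σ) *
          ((σ : ℝ) ^ (Fm.b * Fm.Msave n σ))⁻¹ := by
          rw [hFb, inv_pow, ← pow_mul, ← pow_mul, pow_add]
      _ < ((σ : ℝ) ^ Fm.Y n B.dd σ)⁻¹ := by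
          have hmain : (σ : ℝ) ^ (Fm.X₁ n B.dd B.gens.h B.hdeg G' σ + (Fm.a * n + 1) * Fm.X₂ n B.dd B.gens.h B.hdeg σ) *
              (σ : ℝ) ^ Fm.Y n B.dd σ < (σ : ℝ) ^ (Fm.b * Fm.Msave n σ) := by
            rw [← pow_add]; exact pow_lt_pow_right₀ hσr1 hX
          rw [inv_eq_one_div ((σ : ℝ) ^ Fm.Y n B.dd σ), lt_div_iff₀ hposY, mul_assoc,
            mul_comm (((σ : ℝ) ^ (Fm.b * Fm.Msave n σ))⁻¹), ← mul_assoc, ← div_eq_mul_inv, div_lt_one hpos]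
          exact hmain
  refine lt_of_eq_of_lt ?_ key
  rw [hEA]
  unfold GaGmE.Std.BakerData.Family.X₁ GaGmE.Std.BakerData.Family.X₂ GaGmE.Std.BakerData.Family.Msave GaGmE.Std.BakerData.Family.NA₁ GaGmE.Std.BakerData.Family.NA₂ GaGmE.Std.BakerData.Family.L₁ GaGmE.Std.BakerData.Family.L₂ GaGmE.Std.BakerData.Family.P₁ GaGmE.Std.BakerData.Family.Dn
  rw [hh₁, Nat.add_sub_cancel]
  ring


/-- The admissible-parameter hypothesis of the torsion-case closing: for the Baker datum `B`,
the constant `c > 0`, the spacing `sp` and `S_rows + 1` rows there are parameters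
`D', T, S₀, S, T″, R` with the hypotheses of the torsion engine `NewPointsTorsion.engine₃`
(`T ≥ 1`, `(S_rows+1)T^{dd} < (D'+1)^n`, `R ≥ 2(nS + sp·S₀) > 0`, `NumCond₃` for every
coefficient vector within `siegelHouseBound₃`, with `S₁ = nS`, `T' = nT″ + 1`), `D' ≥ 1`, `S ≥ 1`,
`sp ≤ S + 1`, and the zero-estimate numerics with the constant orbit factor `sp`: for all `e, m`
with `m < n` and `d·(n - m) ≤ e·n`, `c·D^n < binom(T″+e, e)·sp·D^m`, and
`c·D^n < binom(T″+e, e)·D^m` when the index inequality is strict (`D = nD'`).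
[cite: BakerWustholz2007, §6.8 (pp. 117–119)] -/
def AdmissibleParams₃ (B : BakerData 𝓙 β γ δ) (d𝔟 : ℕ) (c : ℝ) (sp Srows : ℕ) : Prop :=
  ∃ (D' T S₀ S T'' : ℕ) (R : ℝ), 0 < T ∧ 1 ≤ D' ∧ 1 ≤ S ∧ sp ≤ S + 1 ∧
    (Srows + 1) * T ^ B.dd < (D' + 1) ^ Fintype.card (β ⊕ (γ ⊕ δ)) ∧ 0 < R ∧
    2 * ((((Fintype.card (β ⊕ (γ ⊕ δ)) * S : ℕ)) : ℝ) + sp * S₀) ≤ R ∧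
    (∀ ξ : GaGmE.Std.BakerData.UIdx β γ δ D' → NumberField.RingOfIntegers B.K,
      (∀ u, NumberField.house ((ξ u : NumberField.RingOfIntegers B.K) : B.K) ≤ B.siegelHouseBound₃ sp D' T Srows) →
        B.NumCond₃ ξ sp T S₀ (Fintype.card (β ⊕ (γ ⊕ δ)) * S) (Fintype.card (β ⊕ (γ ⊕ δ)) * T'' + 1) R) ∧
    ∀ e m : ℕ, m < Fintype.card (β ⊕ (γ ⊕ δ)) → d𝔟 * (Fintype.card (β ⊕ (γ ⊕ δ)) - m) ≤ e * Fintype.card (β ⊕ (γ ⊕ δ)) →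
      c * ((Fintype.card (β ⊕ (γ ⊕ δ)) * D' : ℕ) : ℝ) ^ Fintype.card (β ⊕ (γ ⊕ δ)) <
          (Nat.choose (T'' + e) e : ℝ) * (sp : ℝ) * ((Fintype.card (β ⊕ (γ ⊕ δ)) * D' : ℕ) : ℝ) ^ m ∧
      (d𝔟 * (Fintype.card (β ⊕ (γ ⊕ δ)) - m) < e * Fintype.card (β ⊕ (γ ⊕ δ)) →
        c * ((Fintype.card (β ⊕ (γ ⊕ δ)) * D' : ℕ) : ℝ) ^ Fintype.card (β ⊕ (γ ⊕ δ)) <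
          (Nat.choose (T'' + e) e : ℝ) * ((Fintype.card (β ⊕ (γ ⊕ δ)) * D' : ℕ) : ℝ) ^ m)


/-- **`AdmissibleParams₃ B dd c sp S_rows` holds** for every Baker datum with `dd < n`, every
`c > 0`, every number of rows and every spacing `sp > c·κ₃^n·n!`, `κ₃ = n·2(4n)^{dd}(S_rows+1)`.
The parameters are those of the torsion family with `ℓ = 1`, `b = b₀(fam₀)`, `a = 2b + 3n + 5`,
`σ` the sum of all thresholds. [cite: BakerWustholz2007, §6.8 (p. 119)] -/
theorem admissibleParams₃_of_lt (hdd : B.dd < Fintype.card (β ⊕ (γ ⊕ δ))) {c : ℝ} (hc : 0 < c)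
    {sp : ℕ} (Srows : ℕ)
    (hspc : c * ((Fintype.card (β ⊕ (γ ⊕ δ)) * (2 * (4 * Fintype.card (β ⊕ (γ ⊕ δ))) ^ B.dd * (Srows + 1)) : ℕ) : ℝ) ^
      Fintype.card (β ⊕ (γ ⊕ δ)) * (Fintype.card (β ⊕ (γ ⊕ δ))).factorial < sp) :
    AdmissibleParams₃ B B.dd c sp Srows := by
  classical
  set n := Fintype.card (β ⊕ (γ ⊕ δ)) with hn'
  -- `n ≥ 1`, `sp ≥ 1`
  have hn : 1 ≤ n := by omega
  have hsp1 : 1 ≤ sp := by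
    have h0 : (0 : ℝ) ≤ c * ((n * (2 * (4 * n) ^ B.dd * (Srows + 1)) : ℕ) : ℝ) ^ n * (n.factorial : ℝ) := by positivity
    have : (0 : ℝ) < sp := lt_of_le_of_lt h0 hspc
    exact_mod_cast this
  -- the family
  set F₀ : GaGmE.Std.BakerData.TFamily := ⟨0, 0, 1, le_rfl, sp, hsp1, Srows + 1, Nat.succ_pos _⟩ with hF₀
  set b : ℕ := GaGmE.Std.BakerData.Family.b₀ F₀.fam n B.dd B.gens.h B.hdeg with hb
  set a : ℕ := 2 * b + 3 * n + 5 with ha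
  set F : GaGmE.Std.BakerData.TFamily := ⟨a, b, 1, le_rfl, sp, hsp1, Srows + 1, Nat.succ_pos _⟩ with hF
  have hfam : F.fam = ⟨a, b, 1 + sp, le_add_right le_rfl⟩ := rfl
  have hb₀ : GaGmE.Std.BakerData.Family.b₀ F.fam n B.dd B.gens.h B.hdeg ≤ F.b := by
    show GaGmE.Std.BakerData.Family.b₀ F.fam n B.dd B.gens.h B.hdeg ≤ b
    rw [hb]; exact le_of_eq rfl
  have haF : F.a * B.dd + 2 * F.b + 2 * n + 4 ≤ F.a * n := by
    show a * B.dd + 2 * b + 2 * n + 4 ≤ a * n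
    have h1 : a * (B.dd + 1) ≤ a * n := Nat.mul_le_mul_left a hdd
    have h2 : 2 * b + 2 * n + 4 ≤ a := by rw [ha]; omega
    nlinarith [h1, h2]
  have ha1 : 1 ≤ F.a := by show 1 ≤ a; rw [ha]; omega
  have hSrows : F.Srows = Srows := by show Srows + 1 - 1 = Srows; omega
  -- thresholds
  set G' : ℕ := ⌈B.bigConst⌉₊ with hG'
  have hGG' : B.bigConst ≤ G' := Nat.le_ceil _
  set K₀ : ℕ := ⌈c * ((n * (2 * (4 * n) ^ B.dd * (Srows + 1)) : ℕ) : ℝ) ^ n * (n.factorial : ℝ)⌉₊ + 1 with hK₀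
  set σ : ℕ := G' + GaGmE.Std.BakerData.Family.κD n B.dd * (1 + (2 * (n * (F.ℓ + F.sp)) + 3) ^ 2 * G' ^ 2) +
    GaGmE.Std.BakerData.Family.κD n B.dd * (2 + (n * (F.ℓ + F.sp)) ^ 2) +
    (F.a * n + 1) * (4 * n + 3 * n + B.gens.h * (4 * n + 3 * n + B.hdeg * GaGmE.Std.BakerData.Family.κD n B.dd + 4 * n) +
      B.gens.h * (4 * n + B.hdeg * GaGmE.Std.BakerData.Family.κD n B.dd + 8 * n)) +
    (B.hdeg * GaGmE.Std.BakerData.Family.κD n B.dd + 8 * n + n * (F.ℓ + F.sp) + GaGmE.Std.BakerData.Family.κD n B.dd + 3) + F.sp * F.P₀ + K₀ with hσ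
  have hσG : G' ≤ σ := by rw [hσ]; omega
  have hσ1 : GaGmE.Std.BakerData.Family.κD n B.dd * (1 + (2 * (n * (F.ℓ + F.sp)) + 3) ^ 2 * G' ^ 2) ≤ σ := by rw [hσ]; omega
  have hσ2 : GaGmE.Std.BakerData.Family.κD n B.dd * (2 + (n * (F.ℓ + F.sp)) ^ 2) ≤ σ := by rw [hσ]; omega
  have hσ3 : (F.a * n + 1) * (4 * n + 3 * n + B.gens.h * (4 * n + 3 * n + B.hdeg * GaGmE.Std.BakerData.Family.κD n B.dd + 4 * n) +
      B.gens.h * (4 * n + B.hdeg * GaGmE.Std.BakerData.Family.κD n B.dd + 8 * n)) ≤ σ := by rw [hσ]; omega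
  have hσW : B.hdeg * GaGmE.Std.BakerData.Family.κD n B.dd + 8 * n + n * (F.ℓ + F.sp) + GaGmE.Std.BakerData.Family.κD n B.dd + 3 ≤ σ := by rw [hσ]; omega
  have hσP : F.sp * F.P₀ ≤ σ := by rw [hσ]; omega
  have hσK₀ : K₀ ≤ σ := by rw [hσ]; omega
  have hσone : 1 ≤ σ := le_trans (by rw [hK₀]; omega) hσK₀
  have hσsp : F.sp ≤ σ := le_trans (Nat.le_mul_of_pos_right _ F.hP₀) hσP
  have hσK : c * ((n * (2 * (4 * n) ^ B.dd * F.P₀) : ℕ) : ℝ) ^ n * (n.factorial : ℝ) < σ := by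
    show c * ((n * (2 * (4 * n) ^ B.dd * (Srows + 1)) : ℕ) : ℝ) ^ n * (n.factorial : ℝ) < σ
    have h1 := Nat.le_ceil (c * ((n * (2 * (4 * n) ^ B.dd * (Srows + 1)) : ℕ) : ℝ) ^ n * (n.factorial : ℝ))
    have h2 : (K₀ : ℝ) ≤ σ := by exact_mod_cast hσK₀
    rw [hK₀] at h2; push_cast at h1 h2 ⊢; linarith
  have hspc' : c * ((n * (2 * (4 * n) ^ B.dd * F.P₀) : ℕ) : ℝ) ^ n * (n.factorial : ℝ) < F.sp := hspc
  -- the parameters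
  obtain ⟨hR0, hR2⟩ := F.R_bounds n hn hσone
  have hS1 : F.sp ≤ F.S n σ + 1 := by
    unfold GaGmE.Std.BakerData.TFamily.S
    show sp ≤ 1 * σ ^ n + 1
    calc sp ≤ σ := hσsp
      _ = σ ^ 1 := (pow_one σ).symm
      _ ≤ σ ^ n := Nat.pow_le_pow_right hσone hn
      _ ≤ 1 * σ ^ n + 1 := by omega
  refine ⟨F.D' n B.dd σ, F.T n σ, GaGmE.Std.BakerData.Family.S₀ n σ, F.S n σ, F.T₂ n σ, F.R n σ,
    F.fam.T_pos _ hn hσone, F.one_le_D' _ B.dd hn hσone, F.one_le_S _ hσone, hS1, ?_, hR0, ?_, ?_, ?_⟩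
  · have := F.siegel_feasible n B.dd hn σ; rwa [hSrows] at this
  · have := hR2; unfold GaGmE.Std.BakerData.TFamily.S₁ at this; push_cast at this ⊢; exact this
  · intro ξ hξ
    have hξ' : ∀ u, NumberField.house ((ξ u : NumberField.RingOfIntegers B.K) : B.K) ≤
        B.siegelHouseBound₃ F.sp (F.D' n B.dd σ) (F.T n σ) F.Srows := by rw [hSrows]; exact hξ
    have := B.numCond₃_family F hn'.symm hn haF hb₀ hGG' hσG hσ1 hσ2 hσ3 hσW hσP hξ'
    unfold GaGmE.Std.BakerData.TFamily.S₁ at this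
    exact this
  · intro e m hm hidx
    exact F.numerics n B.dd hn hdd hc ha1 hspc' hσone hσK e m hm hidx


end BakerData

end Families

/-! ### The torsion dichotomy and the stable case -/

section Stable

open Module Submodule LiePresentation

variable [DecidableEq γ] [DecidableEq β] [DecidableEq δ]

/-- **The dichotomy theorem of the torsion case.** Let `Λ` have algebraic invariants and no CM,
`𝔟 ⊊ Lie M_κ` `ℚ̄`-rational and semistable, `w ∈ 𝔟` with `exp(w)` algebraic with torsion abelian
part, `P₀·w ∈ ker(exp)` for some `P₀ ≥ 1` but `w ∉ ker(exp)`. Assume Philippon's zero estimate.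
Then there is a connected algebraic subgroup datum `K` over `ℂ` with `Lie K ≠ Lie M_κ`,
`Lie K ≠ 0`, borderline for the semistability of `𝔟`.
[cite: BakerWustholz2007, §6.8 (pp. 117–119: division point γ = exp(u/ℓ), ord γ = ℓ ord γ', "ℓS'T^d ≫ D^n")] -/
theorem torsionDichotomy (L : 𝓙 → PeriodPair) (cls : γ → 𝓙) (hL : ∀ i, IsAlgebraic ℚ (L i).g₂ ∧ IsAlgebraic ℚ (L i).g₃) (κM : δ → γ → Kbar)
    (hphil : ∃ c : ℝ, 0 < c ∧ ∀ (𝔟 : Submodule ℂ (β ⊕ (γ ⊕ δ) → ℂ)) (v : β ⊕ (γ ⊕ δ) → ℂ)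
      (P : MvPolynomial (Option β × ThetaIdx γ δ) ℂ) (D S T : ℕ),
      0 < Module.finrank ℂ 𝔟 → 1 ≤ D → 1 ≤ S → P.IsHomogeneous D → (∃ w, thetaEval L cls κM P w ≠ 0) →
      (∀ s : ℕ, s ≤ Fintype.card (β ⊕ (γ ⊕ δ)) * S →
        VanishesAlong 𝔟 (thetaEval L cls κM P) ((s : ℂ) • v) (Fintype.card (β ⊕ (γ ⊕ δ)) * T + 1)) →
      ∃ K : SubgroupDataC β γ δ cls κM, (∃ w₀, ∀ w ∈ K.tangent, thetaEval L cls κM P (w₀ + w) = 0) ∧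
        (Nat.choose (T + (Module.finrank ℂ 𝔟 - Module.finrank ℂ ↥(𝔟 ⊓ K.tangent)))
            (Module.finrank ℂ 𝔟 - Module.finrank ℂ ↥(𝔟 ⊓ K.tangent)) : ℝ) *
          (orbitCard L cls κM K v S : ℝ) * (D : ℝ) ^ Module.finrank ℂ K.tangent ≤
          c * (D : ℝ) ^ Fintype.card (β ⊕ (γ ⊕ δ)))
    {𝔟 : Submodule ℂ (β ⊕ (γ ⊕ δ) → ℂ)} (hrat : IsKRational Kbar 𝔟) (h𝔟 : 𝔟 ≠ ⊤)
    (hss : Semistable cls κM 𝔟) {w : β ⊕ (γ ⊕ δ) → ℂ} (hw𝔟 : w ∈ 𝔟) (hw : w ∈ AlgTors L cls κM)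
    {P₀ : ℕ} (hP₀ : 0 < P₀) (hPw : (P₀ : ℂ) • w ∈ ker L cls κM) (hwker : w ∉ ker L cls κM) :
    ∃ K : SubgroupDataC β γ δ cls κM, K.tangent ≠ ⊤ ∧ K.tangent ≠ ⊥ ∧
      Module.finrank ℂ 𝔟 * (Fintype.card (β ⊕ (γ ⊕ δ)) - Module.finrank ℂ K.tangent) =
        (Module.finrank ℂ 𝔟 - Module.finrank ℂ ↥(𝔟 ⊓ K.tangent)) * Fintype.card (β ⊕ (γ ⊕ δ)) := by
  classical
  set n := Fintype.card (β ⊕ (γ ⊕ δ)) with hn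
  set d := Module.finrank ℂ 𝔟 with hd
  -- `0 < d < n`
  have hdlt : d < n := by
    have := Submodule.finrank_lt h𝔟; simpa [hn, hd] using this
  have hdpos : 0 < d := by
    by_contra h0
    have h0' : d = 0 := by omega
    have h𝔟0 : 𝔟 = ⊥ := Submodule.finrank_eq_zero.mp h0'
    have hw0 : w = 0 := by rw [h𝔟0, Submodule.mem_bot] at hw𝔟; exact hw𝔟
    exact hwker (by rw [hw0]; exact zero_mem_ker L cls κM)
  have hn1 : 1 ≤ n := by omega
  -- Philippon's constant
  obtain ⟨c, hc, hZ⟩ := hphil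
  -- the orbit bound and the threshold for the prime `ℓ`
  obtain ⟨M₀, hM₀⟩ := exists_bound_forall_notMem_ker L cls κM hP₀ hPw hwker
  set Kc : ℝ := c * ((n * (2 * (4 * n) ^ d * (P₀ - 1 + 1)) : ℕ) : ℝ) ^ n * (n.factorial : ℝ) with hKc
  obtain ⟨ℓ, hℓge, hℓ⟩ := Nat.exists_infinite_primes (M₀ + ⌈Kc⌉₊ + 1)
  have hℓM₀ : M₀ < ℓ := by omega
  have hℓKc : Kc < ℓ := by
    have h1 := Nat.le_ceil Kc
    have h2 : ((⌈Kc⌉₊ + 1 : ℕ) : ℝ) ≤ ℓ := by exact_mod_cast (show ⌈Kc⌉₊ + 1 ≤ ℓ by omega)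
    push_cast at h2; linarith
  have hℓpos : 0 < ℓ := hℓ.pos
  have hℓ0 : (ℓ : ℂ) ≠ 0 := by exact_mod_cast hℓ.ne_zero
  -- the division point `v = w/ℓ`
  set v : β ⊕ (γ ⊕ δ) → ℂ := (ℓ : ℂ)⁻¹ • w with hv
  have hv𝔟 : v ∈ 𝔟 := Submodule.smul_mem _ _ hw𝔟
  have hvAlg : v ∈ AlgTors L cls κM := inv_natCast_smul_mem_AlgTors hL hw hℓpos
  have horbit : ∀ r : ℕ, 0 < r → r < ℓ → (r : ℂ) • v ∉ ker L cls κM := hM₀ ℓ hℓ hℓM₀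
  -- the Baker datum at `v`
  obtain ⟨B, hBL, hBcls, hBκ, hBv, hBdd, hBspan⟩ := exists_bakerData L cls hL κM hrat hvAlg
  have hBdd' : B.dd = d := hBdd
  have hddlt : B.dd < Fintype.card (β ⊕ (γ ⊕ δ)) := by rw [hBdd', ← hn]; exact hdlt
  -- the parameters of the torsion engine
  have hspc : c * ((Fintype.card (β ⊕ (γ ⊕ δ)) * (2 * (4 * Fintype.card (β ⊕ (γ ⊕ δ))) ^ B.dd * (P₀ - 1 + 1)) : ℕ) : ℝ) ^
      Fintype.card (β ⊕ (γ ⊕ δ)) * ((Fintype.card (β ⊕ (γ ⊕ δ))).factorial : ℝ) < ℓ := by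
    rw [hBdd', ← hn]; exact hℓKc
  obtain ⟨D', T, S₀, S, T'', R, hT, hD', hS, hℓS, hpq, hR0, hR, hnum, hineq⟩ :=
    B.admissibleParams₃_of_lt hddlt hc (P₀ - 1) hspc
  -- periodicity datum: `(ℓ P₀)·v = P₀·w ∈ ker`
  have hper : ((ℓ * (P₀ - 1 + 1) : ℕ) : ℂ) • B.v ∈ ker B.L B.cls B.κM := by
    rw [hBv, hBL, hBcls, hBκ, hv, smul_smul, show P₀ - 1 + 1 = P₀ by omega]
    have e : ((ℓ * P₀ : ℕ) : ℂ) * (ℓ : ℂ)⁻¹ = (P₀ : ℂ) := by push_cast; field_simp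
    rw [e]; exact hPw
  -- run the torsion engine
  have hvspan : B.v ∈ B.bSpan := by
    show B.v ∈ Submodule.span ℂ (Set.range B.xs)
    rw [hBspan, hBv]; exact hv𝔟
  obtain ⟨P, hP, hne, hvan⟩ := B.engine₃ hvspan ℓ D' T (P₀ - 1) S₀ (n * S) (n * T'' + 1) R hℓpos hT hpq hper hR0
    (by rw [hn]; exact hR) (by rw [hn]; exact hnum)
  -- Philippon's zero estimate
  have hD1 : 1 ≤ n * D' := Nat.one_le_iff_ne_zero.mpr (Nat.mul_ne_zero (by omega) (by omega))
  have hvan' : ∀ s : ℕ, s ≤ n * S → VanishesAlong 𝔟 (thetaEval L cls κM P) ((s : ℂ) • v) (n * T'' + 1) := by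
    intro s hs
    have := hvan s hs
    rwa [show B.bSpan = 𝔟 from hBspan, hBL, hBcls, hBκ, hBv] at this
  have hne' : ∃ w', thetaEval L cls κM P w' ≠ 0 := by rwa [hBL, hBcls, hBκ] at hne
  have hP' : P.IsHomogeneous (n * D') := by rw [hn]; exact hP
  obtain ⟨K, ⟨w₀, hw₀⟩, hK⟩ := hZ 𝔟 v P (n * D') S T'' (by rw [← hd]; exact hdpos) hD1 hS hP' hne' hvan'
  -- `K ≠ M_κ`
  have hKtop : K.tangent ≠ ⊤ := by
    intro htop
    obtain ⟨w', hw'⟩ := hne'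
    apply hw'
    have := hw₀ (w' - w₀) (by rw [htop]; trivial)
    simpa using this
  have hm : Module.finrank ℂ K.tangent < n := by
    have := Submodule.finrank_lt hKtop; simpa [hn] using this
  -- the index inequality and the numerics
  have hidx := hss.index_le cls κM hrat K hKtop
  set e := Module.finrank ℂ 𝔟 - Module.finrank ℂ ↥(𝔟 ⊓ K.tangent) with he
  set m := Module.finrank ℂ K.tangent with hm'
  rw [← hn, ← hd] at hidx
  obtain ⟨hfull, hstrict⟩ := hineq e m hm (by rw [hBdd']; exact hidx)
  have hD0 : (0 : ℝ) < ((n * D' : ℕ) : ℝ) := by exact_mod_cast hD1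
  have horb1 : (1 : ℝ) ≤ orbitCard L cls κM K v S := by exact_mod_cast one_le_orbitCard L cls κM K v S
  -- orbit dichotomy at the threshold `ℓ`
  by_cases horb : ℓ ≤ orbitCard L cls κM K v S
  · -- large orbit: the numerics contradict Philippon
    exfalso
    have horb' : (ℓ : ℝ) ≤ orbitCard L cls κM K v S := by exact_mod_cast horb
    have h2 : (Nat.choose (T'' + e) e : ℝ) * (ℓ : ℝ) * ((n * D' : ℕ) : ℝ) ^ m ≤
        (Nat.choose (T'' + e) e : ℝ) * (orbitCard L cls κM K v S : ℝ) * ((n * D' : ℕ) : ℝ) ^ m := by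
      have hch : (0 : ℝ) ≤ (Nat.choose (T'' + e) e : ℝ) := Nat.cast_nonneg _
      have hpow : (0 : ℝ) ≤ ((n * D' : ℕ) : ℝ) ^ m := by positivity
      exact mul_le_mul_of_nonneg_right (mul_le_mul_of_nonneg_left horb' hch) hpow
    rw [← hn] at hfull
    push_cast at hK hfull h2
    linarith
  · -- small orbit: a multiple `r·v`, `0 < r < ℓ`, lies in `Lie K + ker`
    have hsmall : ∃ r : ℕ, 0 < r ∧ r < ℓ ∧ (r : ℂ) • v ∈ preimageSubgroup L cls κM K := by
      by_contra hno
      push Not at hno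
      exact horb (le_orbitCard L cls κM K v hℓS fun r hr hrℓ => hno r hr hrℓ)
    obtain ⟨r, hr, hrℓ, hrmem⟩ := hsmall
    -- `K ≠ 0`: otherwise `r·v` would be a period
    have hKbot : K.tangent ≠ ⊥ := by
      intro hbot
      exact horbit r hr hrℓ ((mem_preimageSubgroup_of_tangent_eq_bot L cls κM hbot).mp hrmem)
    refine ⟨K, hKtop, hKbot, ?_⟩
    -- `K` must be borderline
    change d * (n - m) = e * n
    by_contra hneq
    have hlt : d * (n - m) < e * n := lt_of_le_of_ne hidx hneq
    have h1 := hstrict (by rw [hBdd']; exact hlt)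
    have h2 : (Nat.choose (T'' + e) e : ℝ) * ((n * D' : ℕ) : ℝ) ^ m ≤
        (Nat.choose (T'' + e) e : ℝ) * (orbitCard L cls κM K v S : ℝ) * ((n * D' : ℕ) : ℝ) ^ m := by
      have hch : (0 : ℝ) ≤ (Nat.choose (T'' + e) e : ℝ) := Nat.cast_nonneg _
      have hpow : (0 : ℝ) ≤ ((n * D' : ℕ) : ℝ) ^ m := by positivity
      rw [show (Nat.choose (T'' + e) e : ℝ) * ((n * D' : ℕ) : ℝ) ^ m =
        (Nat.choose (T'' + e) e : ℝ) * 1 * ((n * D' : ℕ) : ℝ) ^ m from by ring]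
      exact mul_le_mul_of_nonneg_right (mul_le_mul_of_nonneg_left horb1 hch) hpow
    rw [← hn] at h1
    push_cast at hK h1 h2
    linarith


variable {κM : δ → γ → Kbar}

variable (κM) in
/-- **The Semistability Theorem for a STABLE `𝔟`** (modulo Philippon's zero estimate). Let `Λ`
have algebraic invariants and no CM, `𝔟 ⊊ Lie M_κ` `ℚ̄`-rational and semistable, and assume that
no connected algebraic subgroup `0 ≠ K ≠ M_κ` (`ℚ̄`-data) is borderline for `𝔟`. Then every
`w ∈ 𝔟` with `exp(w)` algebraic with torsion abelian part lies in `ker(exp)`.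
[cite: BakerWustholz2007, Thm. 6.15, §6.8 (pp. 116–119)] -/
theorem mem_ker_of_stable (L : 𝓙 → PeriodPair) (cls : γ → 𝓙) (hL : ∀ i, IsAlgebraic ℚ (L i).g₂ ∧ IsAlgebraic ℚ (L i).g₃)
    (hphil : ∃ c : ℝ, 0 < c ∧ ∀ (𝔟 : Submodule ℂ (β ⊕ (γ ⊕ δ) → ℂ)) (v : β ⊕ (γ ⊕ δ) → ℂ)
      (P : MvPolynomial (Option β × ThetaIdx γ δ) ℂ) (D S T : ℕ),
      0 < Module.finrank ℂ 𝔟 → 1 ≤ D → 1 ≤ S → P.IsHomogeneous D → (∃ w, thetaEval L cls κM P w ≠ 0) →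
      (∀ s : ℕ, s ≤ Fintype.card (β ⊕ (γ ⊕ δ)) * S →
        VanishesAlong 𝔟 (thetaEval L cls κM P) ((s : ℂ) • v) (Fintype.card (β ⊕ (γ ⊕ δ)) * T + 1)) →
      ∃ K : SubgroupDataC β γ δ cls κM, (∃ w₀, ∀ w ∈ K.tangent, thetaEval L cls κM P (w₀ + w) = 0) ∧
        (Nat.choose (T + (Module.finrank ℂ 𝔟 - Module.finrank ℂ ↥(𝔟 ⊓ K.tangent)))
            (Module.finrank ℂ 𝔟 - Module.finrank ℂ ↥(𝔟 ⊓ K.tangent)) : ℝ) *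
          (orbitCard L cls κM K v S : ℝ) * (D : ℝ) ^ Module.finrank ℂ K.tangent ≤
          c * (D : ℝ) ^ Fintype.card (β ⊕ (γ ⊕ δ)))
    {𝔟 : Submodule ℂ (β ⊕ (γ ⊕ δ) → ℂ)} (hrat : IsKRational Kbar 𝔟) (h𝔟 : 𝔟 ≠ ⊤)
    (hss : Semistable cls κM 𝔟)
    (hst : ∀ D : SubgroupData β γ δ cls κM, D.tangent ≠ ⊤ → D.tangent ≠ ⊥ →
      Module.finrank ℂ 𝔟 * (Fintype.card (β ⊕ (γ ⊕ δ)) - Module.finrank ℂ D.tangent) ≠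
        (Module.finrank ℂ 𝔟 - Module.finrank ℂ ↥(𝔟 ⊓ D.tangent)) * Fintype.card (β ⊕ (γ ⊕ δ)))
    {w : β ⊕ (γ ⊕ δ) → ℂ} (hw𝔟 : w ∈ 𝔟) (hw : w ∈ AlgTors L cls κM) : w ∈ ker L cls κM := by
  by_contra hwker
  -- the first run of Baker's method
  obtain ⟨K, hKtop, hbord, r, hr, hrmem⟩ := BakerData.dichotomy' L cls hL κM hphil hrat h𝔟 hss hw𝔟 hw
  -- by stability, `Lie K = 0`
  have hKbot : K.tangent = ⊥ := by
    by_contra hKbot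
    obtain ⟨D, hDtop, hDbot, hDbord⟩ := hss.exists_borderline_rational cls κM hrat K hKtop hKbot hbord
    exact hst D hDtop hDbot hDbord
  -- so `r·w` is a period: the torsion case
  have hrw : (r : ℂ) • w ∈ ker L cls κM := (mem_preimageSubgroup_of_tangent_eq_bot L cls κM hKbot).mp hrmem
  obtain ⟨K₂, hK₂top, hK₂bot, hK₂bord⟩ :=
    torsionDichotomy L cls hL κM hphil hrat h𝔟 hss hw𝔟 hw hr hrw hwker
  obtain ⟨D, hDtop, hDbot, hDbord⟩ := hss.exists_borderline_rational cls κM hrat K₂ hK₂top hK₂bot hK₂bord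
  exact hst D hDtop hDbot hDbord


end Stable


end Std

end GaGmEFam

/-! ### The closing theorems modulo Philippon's zero estimate for the family theta model -/

open GaGmEFam GaGmEFam.Std GaGmE.Std in
/-- **The stable case of the Semistability Theorem for the `k`-lattice standard models follows
from Philippon's zero estimate on them** (both statements written out inline, D-0026): the
hypothesis `hphil` is Philippon 1986, Thm. 2.1, for the family standard models `M = 𝔾ₘ^β × P`
in the theta embedding of `ManyCurveTheta.lean` — the lattice-family twin of the tree's named fact
`PhilipponZeroEstimateStd.philippon1986_std` (same dictionary: `A = exp 𝔟`, `Σ = {0, g, …, Sg}`,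
order `≥ nT + 1` along `𝔟`, obstruction datum `SubgroupDataC` with block-diagonal abelian part,
the printed inequality read through `H(G'; D) ≥ D^{dim G'}`), asserted for finite families of
pairwise non-isogenous lattices with algebraic invariants and block structures whose CM classes
carry at most one block; the conclusion is the hypothesis `hclose` of
`ManyCurveInduction.HuberWustholzManyCurvePeriods_of_stableClosing` (Baker–Wüstholz 2007, Thm. 6.15
for STABLE `𝔟` at points with torsion abelian part), by the two runs of Baker's method
(`GaGmEFam.Std.mem_ker_of_stable`, which uses neither the non-isogeny nor the CM condition).
[cite: BakerWustholz2007, Thm. 6.15, §6.8 (pp. 116–119)] [cite: Philippon1986, Thm 2.1] -/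
theorem GaGmEFam.Std.stableClosing_of_philippon
    (hphil : ∀ (𝓙 : Type) [Fintype 𝓙] [DecidableEq 𝓙] (L : 𝓙 → PeriodPair),
      (∀ i, IsAlgebraic ℚ (L i).g₂ ∧ IsAlgebraic ℚ (L i).g₃) →
      (∀ i j, i ≠ j → ¬ (L i).IsIsogenousTo (L j)) →
      ∀ (β γ δ : Type) [Fintype β] [Fintype γ] [Fintype δ] [DecidableEq γ] (cls : γ → 𝓙),
        (∀ b b', cls b = cls b' → (L (cls b)).HasCM → b = b') →
        ∀ (κM : δ → γ → GaGmE.Kbar),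
      ∃ c : ℝ, 0 < c ∧ ∀ (𝔟 : Submodule ℂ (β ⊕ (γ ⊕ δ) → ℂ)) (v : β ⊕ (γ ⊕ δ) → ℂ)
        (P : MvPolynomial (Option β × ThetaIdx γ δ) ℂ) (D S T : ℕ),
        0 < Module.finrank ℂ 𝔟 → 1 ≤ D → 1 ≤ S → P.IsHomogeneous D → (∃ w, thetaEval L cls κM P w ≠ 0) →
        (∀ s : ℕ, s ≤ Fintype.card (β ⊕ (γ ⊕ δ)) * S →
          VanishesAlong 𝔟 (thetaEval L cls κM P) ((s : ℂ) • v) (Fintype.card (β ⊕ (γ ⊕ δ)) * T + 1)) →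
        ∃ K : SubgroupDataC β γ δ cls κM, (∃ w₀, ∀ w ∈ K.tangent, thetaEval L cls κM P (w₀ + w) = 0) ∧
          (Nat.choose (T + (Module.finrank ℂ 𝔟 - Module.finrank ℂ ↥(𝔟 ⊓ K.tangent)))
              (Module.finrank ℂ 𝔟 - Module.finrank ℂ ↥(𝔟 ⊓ K.tangent)) : ℝ) *
            (orbitCard L cls κM K v S : ℝ) * (D : ℝ) ^ Module.finrank ℂ K.tangent ≤
            c * (D : ℝ) ^ Fintype.card (β ⊕ (γ ⊕ δ))) :
    ∀ (𝓙 : Type) [Fintype 𝓙] [DecidableEq 𝓙] (L : 𝓙 → PeriodPair),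
      (∀ i, IsAlgebraic ℚ (L i).g₂ ∧ IsAlgebraic ℚ (L i).g₃) →
      (∀ i j, i ≠ j → ¬ (L i).IsIsogenousTo (L j)) →
      ∀ (β γ δ : Type) [Fintype β] [Fintype γ] [Fintype δ] (cls : γ → 𝓙),
        (∀ b b', cls b = cls b' → (L (cls b)).HasCM → b = b') →
        ∀ (κM : δ → γ → GaGmE.Kbar) (𝔟 : Submodule ℂ (β ⊕ (γ ⊕ δ) → ℂ)),
        LiePresentation.IsKRational GaGmE.Kbar 𝔟 → 𝔟 ≠ ⊤ → Semistable cls κM 𝔟 →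
        (∀ D : SubgroupData β γ δ cls κM, D.tangent ≠ ⊤ → D.tangent ≠ ⊥ →
          Module.finrank ℂ 𝔟 * (Fintype.card (β ⊕ (γ ⊕ δ)) - Module.finrank ℂ D.tangent) ≠
            (Module.finrank ℂ 𝔟 - Module.finrank ℂ ↥(𝔟 ⊓ D.tangent)) * Fintype.card (β ⊕ (γ ⊕ δ))) →
        ∀ w ∈ 𝔟, w ∈ AlgTors L cls κM → w ∈ GaGmEFam.Std.ker L cls κM := by
  intro 𝓙 _ _ L hL hiso β γ δ _ _ _ cls hcm1 κM 𝔟 hrat h𝔟 hss hst w hw𝔟 hw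
  classical
  exact mem_ker_of_stable κM L cls hL
    (hphil 𝓙 L hL hiso β γ δ cls hcm1 κM) hrat h𝔟 hss hst hw𝔟 hw

open GaGmEFam GaGmEFam.Std GaGmE.Std in
/-- **The `2 + 4k` 1-periods of `k` pairwise non-isogenous elliptic curves split**
(`HuberWustholzManyCurvePeriods`, Huber–Wüstholz 2022, Thm. 15.3 (1) for
`[ℤ →⁰ 𝔾ₘ] × E₁ × ⋯ × E_k`) **granted Philippon's zero estimate (1986, Thm. 2.1) for the
`k`-lattice standard models in their theta embedding** — the ONE remaining input, stated inline
as `hphil` (the lattice-family twin of the tree's named fact `philippon1986_std`, asserted for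
finite families of pairwise non-isogenous lattices with algebraic invariants and block structures
whose CM classes carry at most one block). Everything between the zero estimate and the periods —
the theta model of `M = 𝔾ₘ^β × P`, Siegel's lemma, extrapolation, Liouville, the two dichotomy
theorems, the induction over borderline quotients and subgroups, the transport of the hyperplane
theorem, the dévissage at the period point, the CM normal form — is proved in the tree
(`ManyCurvePeriodsProofs`, `ManyCurveSemistable`, `ManyCurveStd*`, `ManyCurveSub`,
`ManyCurveInduction`, `ManyCurveTheta`, `ManyCurveLineODE`, `ManyCurveBaker`, `ManyCurveEngine`,
this file). The discharge `HuberWustholzManyCurvePeriods_holds` is this theorem applied to a proof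
of `hphil`, i.e. to the lattice-family port of a proof of `philippon1986_std` (Roy's zero estimate
for analytic group models and the classification of the `Θ`-closed irreducible subgroups, which
for several classes uses `Hom(E_i, E_j) = 0`).
[cite: HuberWustholz2022, Thm. 15.3 (1)] [cite: BakerWustholz2007, Thm. 6.15, §6.8] [cite: Philippon1986, Thm 2.1] -/
theorem HuberWustholzManyCurvePeriods_of_philippon
    (hphil : ∀ (𝓙 : Type) [Fintype 𝓙] [DecidableEq 𝓙] (L : 𝓙 → PeriodPair),
      (∀ i, IsAlgebraic ℚ (L i).g₂ ∧ IsAlgebraic ℚ (L i).g₃) →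
      (∀ i j, i ≠ j → ¬ (L i).IsIsogenousTo (L j)) →
      ∀ (β γ δ : Type) [Fintype β] [Fintype γ] [Fintype δ] [DecidableEq γ] (cls : γ → 𝓙),
        (∀ b b', cls b = cls b' → (L (cls b)).HasCM → b = b') →
        ∀ (κM : δ → γ → GaGmE.Kbar),
      ∃ c : ℝ, 0 < c ∧ ∀ (𝔟 : Submodule ℂ (β ⊕ (γ ⊕ δ) → ℂ)) (v : β ⊕ (γ ⊕ δ) → ℂ)
        (P : MvPolynomial (Option β × ThetaIdx γ δ) ℂ) (D S T : ℕ),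
        0 < Module.finrank ℂ 𝔟 → 1 ≤ D → 1 ≤ S → P.IsHomogeneous D → (∃ w, thetaEval L cls κM P w ≠ 0) →
        (∀ s : ℕ, s ≤ Fintype.card (β ⊕ (γ ⊕ δ)) * S →
          VanishesAlong 𝔟 (thetaEval L cls κM P) ((s : ℂ) • v) (Fintype.card (β ⊕ (γ ⊕ δ)) * T + 1)) →
        ∃ K : SubgroupDataC β γ δ cls κM, (∃ w₀, ∀ w ∈ K.tangent, thetaEval L cls κM P (w₀ + w) = 0) ∧
          (Nat.choose (T + (Module.finrank ℂ 𝔟 - Module.finrank ℂ ↥(𝔟 ⊓ K.tangent)))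
              (Module.finrank ℂ 𝔟 - Module.finrank ℂ ↥(𝔟 ⊓ K.tangent)) : ℝ) *
            (orbitCard L cls κM K v S : ℝ) * (D : ℝ) ^ Module.finrank ℂ K.tangent ≤
            c * (D : ℝ) ^ Fintype.card (β ⊕ (γ ⊕ δ))) :
    HuberWustholzManyCurvePeriods :=
  HuberWustholzManyCurvePeriods_of_stableClosing (GaGmEFam.Std.stableClosing_of_philippon hphil)

end Literature.NumberTheory.Transcendental

end
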